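import Summits.AtomisticToContinuum.HydrodynamicLimit.Theses.InformationPercolationEngine
import Summits.AtomisticToContinuum.HydrodynamicLimit.Theses.TwoClocks
import Summits.AtomisticToContinuum.HydrodynamicLimit.Theses.LimitCollisionMeasure
import Summits.AtomisticToContinuum.HydrodynamicLimit.Theorems.InformationPercolationEngineKineticClosureBridge
import Summits.AtomisticToContinuum.HydrodynamicLimit.Theorems.InformationPercolationEngineChaosClosesEulerCollisionInvariance
import Summits.AtomisticToContinuum.HydrodynamicLimit.Theorems.InformationPercolationEngineChaosClosesEulerBridge
import Summits.AtomisticToContinuum.HydrodynamicLimit.Theorems.InformationPercolationEngineChaosClosesEulerMassBalance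
import Summits.AtomisticToContinuum.HydrodynamicLimit.Theorems.InformationPercolationEngineChaosClosesEulerInitialLayer
import Summits.AtomisticToContinuum.HydrodynamicLimit.Theorems.InformationPercolationEngineChaosClosesEulerWindowedInvariance
import Summits.AtomisticToContinuum.HydrodynamicLimit.Theorems.InformationPercolationEngineChaosClosesEulerWeakEquation
import Summits.AtomisticToContinuum.HydrodynamicLimit.Theorems.InformationPercolationEngineChaosClosesEulerEnskogIdentity
import Summits.AtomisticToContinuum.HydrodynamicLimit.Theorems.InformationPercolationEngineChaosClosesEulerCollisionMomentUI
import Summits.AtomisticToContinuum.HydrodynamicLimit.Theorems.InformationPercolationEngineChaosClosesEulerReadout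
import Summits.AtomisticToContinuum.HydrodynamicLimit.Theorems.InformationPercolationEngineChaosClosesEulerMassBalanceC1
import Summits.AtomisticToContinuum.HydrodynamicLimit.Theorems.InformationPercolationEngineChaosClosesEulerBF18Shell
import Summits.AtomisticToContinuum.HydrodynamicLimit.Theorems.InformationPercolationEngineChaosClosesEulerKineticReduction
import Summits.AtomisticToContinuum.HydrodynamicLimit.Theorems.InformationPercolationEngineChaosClosesEulerMaxwellianMoments
import Summits.AtomisticToContinuum.HydrodynamicLimit.Theorems.InformationPercolationEngineChaosClosesEulerWeakLimitToolkit
import Summits.AtomisticToContinuum.HydrodynamicLimit.Theorems.InformationPercolationEngineChaosClosesEulerBalanceTestFamily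
import Summits.AtomisticToContinuum.HydrodynamicLimit.Theorems.InformationPercolationEngineChaosClosesEulerStressIsotropy
import Summits.AtomisticToContinuum.HydrodynamicLimit.Theorems.InformationPercolationEngineChaosClosesEulerPressureValue
import Summits.AtomisticToContinuum.HydrodynamicLimit.Theorems.InformationPercolationEngineChaosClosesEulerQuantitativeRigidity
import Summits.AtomisticToContinuum.HydrodynamicLimit.Theorems.InformationPercolationEngineChaosClosesEulerEnergyDistance
import Summits.AtomisticToContinuum.HydrodynamicLimit.Theorems.InformationPercolationEngineChaosClosesEulerDock
import HarnessLib

/-!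
# Line `Sketch` — crux `InformationPercolationEngine.ChaosClosesEuler` (stmt-AtomisticToContinuum-15141)

THE QUENCHED ISOTROPY DOCK — skeleton **v15** (lead c4, cycle 5, 2026-08-17).  History v1–v10 (cycles 1–4, leads
…-15141-0 / -c1-0 / -c2-0 / -c3-0) is in `Cruxes/ChaosClosesEuler/NOTES.md` §A–§E and the evidence notes; this
docstring states the CURRENT shape only.

**v12 → v13 (2026-08-17T11:xxZ).**  Wave 9 LANDED all five provable v11 stubs — `stub_maxwellianMoments`
(p145917), `stub_weakLimitToolkit` (p145976), `stub_balanceTestFamily` (p145745), `stub_stressIsotropyOfLocalEquilibrium`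
(p148636 + helpers A–F) and `stub_pressureValueOfEnskog` (p156386 + helpers A–O) — so the DOCK
`chaosClosesEuler_of_localEquilibriumLevel : PLE → PEC → 13352 → 13354 → 9235 → 13082 → ChaosClosesEuler` is SORRY-FREE
(standalone tree copy: `Theorems/InformationPercolationEngineChaosClosesEulerDock.lean`,
`ChaosClosesEulerDock.chaosClosesEuler_of_pointwiseLocalEquilibrium`, the crux-strategist's glue `LocalEquilibriumDock`
of `Cruxes/ChaosClosesEuler/SPLIT-REQUEST.md`).  v13 reshapes the lead's crux-sized `stub_localEquilibrium`: its two
deterministic cores are split off as the provable stubs `stub_quantitativeRigidity` (13355 + the three tools ⇒ the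
quantitative rigidity statement `QuantitativeRigidity`, §1b) and `stub_energyDistance` (Székely's energy distance:
inequality + stability, `EnergyDistance`, §1b) for wave 10; the remainder `stub_localEquilibrium : QuantitativeRigidity →
EnergyDistance → PointwiseContactChaos → PointwiseEnskogCollisions → WindowedCollisionInvariance → 9235 → 13354 → 13082 →
PointwiseLocalEquilibrium` is the strategist's child `KineticLocalEquilibrium` (promote-stub candidate).  **v14 (12:3xZ):**
wave 10 LANDED both: `stub_quantitativeRigidity` (p160547 + helpers A p159014, B p159083, C p160338) and
`stub_energyDistance` (p160436 + helpers A p159060, B p160286); the dock landed as `Theorems/…ChaosClosesEulerDock.lean`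
(p157936).  REGISTERED STUBS (v14, 2 open): `stub_inputs` [external: 9235, 13354, 13352, 13082, 13355, PCC, PEC],
`stub_localEquilibrium` [XL, lead; = KineticLocalEquilibrium].  **v15 (12:5xZ):** `NOTES.md` §G2 (R3, DIAGONAL BLINDNESS): the rigidity
sub-line cannot derive PLE from windowed collision functionals (blob-train witness), so `stub_localEquilibrium` is stated BARE
(`PointwiseLocalEquilibrium`, the object to promote) and `stub_inputs` drops 13355 / PointwiseContactChaos; `ChaosClosesEuler_of` is the
landed dock applied to the inputs.  REGISTERED STUBS (v15, 2 open): `stub_inputs` [external], `stub_localEquilibrium` [primitive, promote].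
The paragraphs below describe v11 and are kept for the record.

THE LINE.  The crux is `ContactChaos → CollisionRate → LocalSecondLaw → HydroLimitInBand` (the packing-guarded
conjunct stmt-9133 verbatim).  The proof format is the PATHWISE (quenched) Březina–Feireisl relative energy of the
`r`-cone-mollified empirical fields `U_r = (ρ_r, m_r, e_r)` of ONE hard-sphere trajectory against the classical
hs-Euler solution ("`N → ∞` then `r → 0`", the native format of every antecedent):
* LANDED (cycles 1–4): the `t = 0` layer (p97752), Bogolyubov's collision invariance (p98069) and its windowed form
  (p102261), the exact mass balance (p98482, `C¹` form p133127), the exact weak equation (p108039) and its library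
  form `LimitCollisionMeasure.EmpiricalEnskogIdentity` (stmt-13356 VERBATIM, p107599), the UI of the quadratic
  collision mark from `CollisionTightness` (p110597), THE DETERMINISTIC BF18 CORE `stub_bf18Shell` (p136414 + 20
  helper files), THE KINETIC REDUCTION `stub_kineticReduction` (p138091 + the Reduction* pyramid) and THE WEAK
  READOUT `stub_readout` (p119530 + 6 helpers).  Given the two in-band flux closures `WeakStressIsotropyInBand` (WSI)
  and `CollisionalPressureValueInBand` (CPV), the line therefore PROVES
  `[13352 ∧ 13354 ∧ 9235 ∧ 13082 ∧ CollisionRate] ⇒ HydroLimitInBand`, kernel-checked.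
* OPEN = THE KINETIC HALF (WSI ∧ CPV).  v10 obtained it by ONE stub `stub_fluxClosure` from windowed invariance +
  13356 + the two-time chaos 13350 + rigidity 13355 + rate 13481 + tails.  CYCLE-5 AUDIT (`NOTES.md` §F): that stub
  is NOT derivable from those antecedents — (R1) every chaos / rate input on the board (13350, 13477, 13481) is
  tested against test functions `χ(t, x)` FIXED BEFORE `r`, hence controls only Young-measure AVERAGES over
  mesoscopic scales `r ≪ ℓ ≪ 1`, while Maxwellian rigidity is a NONLINEAR, pointwise step and collisional balance
  is not convex: a local velocity law oscillating at scale `ℓ` between two mutually balance-compensating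
  non-Maxwellian states (`Q(ν₁,ν₁) + Q(ν₂,ν₂) = 0`, constructible order by order around a Maxwellian; for hard
  spheres the averaged stress deviator is `O(ε²) ≠ 0`, kit job j022293) satisfies every fixed-`χ` input and
  violates WSI; (R2) rigidity of the `r`-WINDOWED law (13350's two-time products) controls the SAME-TIME stresses
  WSI / CPV / the reduction speak about only up to the within-window fluctuation of the velocity law (the window
  duration `r` equals the crossing time of the cone, so a priori the conserved fields move by `O(1)` inside one
  window); the fluctuation is killed exactly by SAME-TIME chaos in pointwise form together with two-time chaos in
  pointwise form (energy-distance argument: `avg_s ⟨μ_s⊗μ_s, |v−w|⟩ ≤ ⟨ν⊗ν, |v−w|⟩` with equality iff `μ_s ≡ ν`,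
  Székely), and the VALUE of the collisional pressure needs the collision intensity pointwise.
* v11 THEREFORE docks the kinetic half one level up, at POINTWISE LOCAL EQUILIBRIUM: two NEW typed inputs,
  `PointwiseLocalEquilibrium` (PLE: at scale `r`, in `L¹` over `(s, x)`, in probability, the cone-mollified
  same-time velocity law is the Maxwellian of its own conserved fields, away from vacuum / cold / hot / fast /
  out-of-band states) and `PointwiseEnskogCollisions` (PEC: the `r`-windowed collision statistics of bounded
  continuous marks equal `σ³ Y(σ³ρ_r)` times the same-time Enskog pair functional, in `L¹` over windows — the
  pointwise strengthening of `13477 ∧ 13481`), from which WSI (`stub_stressIsotropyOfLocalEquilibrium`) and CPV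
  (`stub_pressureValueOfEnskog`) follow by bookkeeping + tails + the landed Enskog tensor identity (both PROVABLE
  NOW, wave 9); and it keeps the rigidity route to PLE as ONE crux-sized stub `stub_localEquilibrium` (lead;
  promote-stub candidate = `LimitCollisionMeasure`'s "KineticRigidityClosure") fed by the pointwise two-time chaos
  `PointwiseContactChaos` (13350 with `|·|` inside the window integral), `BalanceRigidity` (13355) and three
  provable-now measure-theoretic tools registered for workers: `stub_weakLimitToolkit` (weak limits of finite
  measures on `ℝ³` with UI second moments: moments and the collisional balance functional pass to the limit),
  `stub_maxwellianMoments` (mass / momentum / stress / energy of `ρ M_{θ,u}`), `stub_balanceTestFamily` (a countable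
  bounded continuous family is balance-determining).
* `theorem chaosClosesEuler_of_localEquilibriumLevel` records the (recommended) docking level for the PLANNER:
  `PLE → PEC → LimitCollisionMeasure.LocalSecondLaw → LimitCollisionMeasure.CollisionTightness →
  TwoClocks.EnergyCurrentTails → DensityCap → ChaosClosesEuler`, proved here modulo the two wave-9 stubs and
  `stub_maxwellianMoments` only.

REGISTERED STUBS (v11, 7): `stub_inputs` [external: the board items 9235, 13354, 13352, 13082, 13355 VERBATIM by
name, plus the two NEW inputs PointwiseContactChaos (feeds only `stub_localEquilibrium`) and PointwiseEnskogCollisions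
— to be FILED by the planner], `stub_weakLimitToolkit` [M, wave 9], `stub_maxwellianMoments` [M, wave 9],
`stub_balanceTestFamily` [M–L, wave 9], `stub_stressIsotropyOfLocalEquilibrium` [L, wave 9],
`stub_pressureValueOfEnskog` [L, wave 9], `stub_localEquilibrium` [XL, lead; crux-sized].  CLOSED and kept as
theorems pointing at the landed files: `stub_collisionInvariance`, `stub_windowedCollisionInvariance`,
`stub_massBalance`, `stub_massBalanceC1`, `stub_weakEquation`, `stub_empiricalEnskogIdentity`, `stub_initialLayer`,
`stub_collisionMomentUI`, `stub_bf18Shell`, `stub_kineticReduction`, `stub_relativeEnergyGronwall` (derived),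
`stub_readout`, `stub_bridge`; `stub_fluxClosure` is now DERIVED from the v11 stubs.

Of the crux's own antecedents, `CollisionRate` (13481) is consumed by the landed reduction and readout (fixed bump
tests); `ContactChaos` (13477, same-time, fixed `χ`) and `LocalSecondLaw` (13081, unclamped) are not consumed (wrong
formats, §B2/§B3/§F).  PLANNER (§D/§F): the crux is not closable AS FILED; closable restatement =
`chaosClosesEuler_of_localEquilibriumLevel`'s hypothesis list, i.e. dock at pointwise local equilibrium + pointwise
Enskog collision statistics + clamped second law + quartic collision tightness + cubic tails + fine-scale cap.

DISPROOF USED: `Cruxes/ChaosClosesEuler/Disproof.lean` v2 (2026-08-16T11:24Z, rc 0, 0 sorry): no stub killed, no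
`-- Targets` handed over; `Theorems/ChaosClosesEuler/Negative/Structure.lean` (p100282) kills no stub.
-/

noncomputable section

namespace Summit.AtomisticToContinuum.HydrodynamicLimit.Cruxes.ChaosClosesEuler.Sketch

open scoped BigOperators Topology Classical MeasureTheory ENNReal InnerProductSpace
open Filter Set MeasureTheory
open Literature.MathematicalPhysics.KineticTheory
open Literature.Analysis.FluidPDE
open Summit.AtomisticToContinuum.HydrodynamicLimit.Theses
open Summit.AtomisticToContinuum.HydrodynamicLimit.Theses.InformationPercolationEngine

/-! ## §1 The typed waypoints (local names; bodies are VERBATIM the registered stub signatures) -/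

/-- **Collision invariance of the normalised collision functional (Bogolyubov's exact weak equation, pathwise).**
For a bounded `ψ` of the velocity and a bounded Lipschitz space–time localiser `χ`, the `K_N`-functional of the jump
`χ(s, xᵢ)(ψ(vᵢ⁺) − ψ(vᵢ⁻))` along one good orbit is `O(ε_N)`: Abel summation along each particle's participations
(velocities are constant between them, positions move at most `|vᵢ|Δs` in the minimal-image distance), the boundary
terms cost `2‖χ‖‖ψ‖` per particle and the summed increments `‖ψ‖·Lip(χ)·∫₀^τ(1 + |vᵢ|)`, and
`(N+1)⁻¹∑ᵢ|vᵢ| ≤ 1/2 + E/(N+1)` with the energy `E` conserved. -/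
def CollisionInvariance : Prop :=
  ∀ (σ : ℝ), 0 < σ → σ < 2⁻¹ → ∀ (N : ℕ)
    (Φ : HardSphereFlow (Torus.geometry (Fin 3)) (hsDiameter σ N) (N + 1)),
    ∀ z ∈ Φ.good, ∀ τ : ℝ, 0 < τ →
    ∀ (χ : ℝ × T3 → ℝ) (Cχ Lχ : ℝ), 0 ≤ Cχ → 0 ≤ Lχ → (∀ p, |χ p| ≤ Cχ) →
      (∀ (s s' : ℝ) (x x' : T3), |χ (s, x) - χ (s', x')| ≤ Lχ * (|s - s'| + Torus.euclidDist x x')) →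
    ∀ (ψ : V3 → ℝ) (Cψ : ℝ), 0 ≤ Cψ → (∀ v, |ψ v| ≤ Cψ) →
    let ε := hsDiameter σ N
    let G : Geometry (Fin 3) T3 := Torus.geometry (Fin 3)
    let γ : ℝ → Config (N + 1) (Fin 3) T3 := fun s => Φ.flow s z
    let pv : ℝ → Fin (N + 1) → Fin (N + 1) → V3 × V3 := fun s i j =>
      reflectVel (G.sepVec (γ s i).1 (γ s j).1) ((γ s i).2, (γ s j).2)
    |ε / (N + 1 : ℝ) * ∑ᶠ (s : ℝ) (_ : s ∈ collisionTimes G ε γ ∩ Set.Icc 0 τ),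
        ∑ i : Fin (N + 1), ∑ j : Fin (N + 1),
          (if i ≠ j ∧ ‖G.sepVec (γ s i).1 (γ s j).1‖ = ε then
            χ (s, (γ s i).1) * (ψ (γ s i).2 - ψ (pv s i j).1) else 0)|
      ≤ ε * Cψ * (2 * Cχ + Lχ * τ * (3 / 2 + configEnergy z / (N + 1 : ℝ)))

/-- **Windowed collision invariance (the form the two-time chaos 13350 consumes).**  For every window centre
`(t₀, x₀)`, radius `r` and bounded `ψ`, the tent-in-time × cone-in-space windowed, normalised collision functional of
the jump `ψ(vᵢ⁺) − ψ(vᵢ⁻)` — written against the empirical collision measure with its pre-collisional marks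
`(t, xᵢ, n̂, vᵢ⁻, vⱼ⁻)`, `vᵢ⁺ = (reflectVel n̂ (vᵢ⁻, vⱼ⁻)).1` — is `O(ε_N)` along every good orbit:
`CollisionInvariance` (landed p98069) with the Lipschitz weight `bt(t−t₀)·bx(x,x₀)` (`sup = 3/(πr⁴)`, `Lip = 3/(πr⁵)`),
plus `HardSphereFlow.integral_empiricalCollisionMeasure_eq_finsum_ite` and the reflection involution. -/
def WindowedCollisionInvariance : Prop :=
  ∀ (σ : ℝ), 0 < σ → σ < 2⁻¹ → ∀ (N : ℕ)
    (Φ : HardSphereFlow (Torus.geometry (Fin 3)) (hsDiameter σ N) (N + 1)),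
    ∀ z ∈ Φ.good, ∀ τ : ℝ, 0 < τ → ∀ r : ℝ, 0 < r → ∀ (t₀ : ℝ) (x₀ : T3),
    ∀ (ψ : V3 → ℝ) (Cψ : ℝ), 0 ≤ Cψ → (∀ v, |ψ v| ≤ Cψ) →
    let ε := hsDiameter σ N
    let bx : T3 → T3 → ℝ := fun x y => 3 / (Real.pi * r ^ 3) * max (1 - Torus.euclidDist x y / r) 0
    let bt : ℝ → ℝ := fun a => r⁻¹ * max (1 - |a| / r) 0
    |ε / (N + 1 : ℝ) * ∫ m, bt (m.1 - t₀) * bx m.2.1 x₀ *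
        (ψ (reflectVel m.2.2.1 (m.2.2.2.1, m.2.2.2.2)).1 - ψ m.2.2.2.1)
        ∂(Φ.empiricalCollisionMeasure (Set.Icc 0 τ) z)|
      ≤ ε * Cψ * (6 / (Real.pi * r ^ 4) + 3 / (Real.pi * r ^ 5) * τ * (3 / 2 + configEnergy z / (N + 1 : ℝ)))

/-- **Exact pathwise mass balance of the cone-mollified empirical density.**  Along a good orbit, for a smooth
space–time test `φ` and the cone mollifier `b_r` of the route decls, `∫φ(t)ρ_r(t) − ∫φ(0)ρ_r(0) =
∫₀ᵗ∫ (∂ₛφ ρ_r + m_r·∇φ)`: positions are continuous and piecewise free flight, collisions move no mass, and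
`∇_{xᵢ}∫ b_r(xᵢ,x)φ(x)dx = ∫ b_r(xᵢ,x)∇φ(x)dx` (translation invariance of `b_r`; no derivative falls on the cone). -/
def MassBalance : Prop :=
  ∀ (σ : ℝ), 0 < σ → σ < 2⁻¹ → ∀ (N : ℕ)
    (Φ : HardSphereFlow (Torus.geometry (Fin 3)) (hsDiameter σ N) (N + 1)),
    ∀ z ∈ Φ.good, ∀ r : ℝ, 0 < r → r < 2⁻¹ →
    ∀ φ : ℝ → T3 → ℝ, Literature.Analysis.FunctionSpaces.Torus.IsSmoothSpaceTimeOn Set.univ φ →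
    ∀ t : ℝ, 0 ≤ t →
    let bx : T3 → T3 → ℝ := fun y x => 3 / (Real.pi * r ^ 3) * max (1 - Torus.euclidDist y x / r) 0
    let ρm : Config (N + 1) (Fin 3) T3 → T3 → ℝ := fun w x₀ => ∫ q, bx q.1 x₀ ∂(empiricalMeasure w)
    let mm : Config (N + 1) (Fin 3) T3 → T3 → V3 := fun w x₀ => ∫ q, bx q.1 x₀ • q.2 ∂(empiricalMeasure w)
    (∫ x, φ t x * ρm (Φ.flow t z) x) - ∫ x, φ 0 x * ρm (Φ.flow 0 z) x =
      ∫ s in Set.Icc 0 t, ∫ x, (deriv (fun s' => φ s' x) s * ρm (Φ.flow s z) x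
        + ∑ k : Fin 3, mm (Φ.flow s z) x k * Literature.Analysis.FunctionSpaces.Torus.partialDeriv k (φ s) x)

/-- **Exact pathwise mass balance for `C¹` space–time tests** (v8): the landed `MassBalance` (p98482) uses only
the `C¹` regularity of the test function (chain rule along free flight + continuity of the transport derivative),
and the deterministic BF18 shell tests the continuity equation with `½|ũ|² − μ(ρ̃, θ̃)`, which is only `C¹` in
general (`μ` carries `f′`, `f ∈ C²`) and has a global `C¹` extension from `[0, T)` (`Torus.exists_contDiff_one_extension`)
but no smooth one; so the shell's (H1) — and hence the reduction's mass balance — quantify over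
`ContDiff ℝ 1 (Torus.stLift φ)`. -/
def MassBalanceC1 : Prop :=
  ∀ (σ : ℝ), 0 < σ → σ < 2⁻¹ → ∀ (N : ℕ)
    (Φ : HardSphereFlow (Torus.geometry (Fin 3)) (hsDiameter σ N) (N + 1)),
    ∀ z ∈ Φ.good, ∀ r : ℝ, 0 < r → r < 2⁻¹ →
    ∀ φ : ℝ → T3 → ℝ, ContDiff ℝ 1 (Literature.Analysis.FunctionSpaces.Torus.stLift φ) →
    ∀ t : ℝ, 0 ≤ t →
    let bx : T3 → T3 → ℝ := fun y x => 3 / (Real.pi * r ^ 3) * max (1 - Torus.euclidDist y x / r) 0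
    let ρm : Config (N + 1) (Fin 3) T3 → T3 → ℝ := fun w x₀ => ∫ q, bx q.1 x₀ ∂(empiricalMeasure w)
    let mm : Config (N + 1) (Fin 3) T3 → T3 → V3 := fun w x₀ => ∫ q, bx q.1 x₀ • q.2 ∂(empiricalMeasure w)
    (∫ x, φ t x * ρm (Φ.flow t z) x) - ∫ x, φ 0 x * ρm (Φ.flow 0 z) x =
      ∫ s in Set.Icc 0 t, ∫ x, (deriv (fun s' => φ s' x) s * ρm (Φ.flow s z) x
        + ∑ k : Fin 3, mm (Φ.flow s z) x k * Literature.Analysis.FunctionSpaces.Torus.partialDeriv k (φ s) x)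

/-- **Bogolyubov's exact weak equation for the cone-mollified `ψ`-moments of ONE trajectory** (v3, the general
balance law the momentum / energy / `ψ`-balances of both XL stubs consume; Pulvirenti–Simonella arXiv:1504.03215
§1 (1.3)–(1.5), Bogolyubov 1975).  Along a good orbit, for every smooth space–time test `φ`, EVERY velocity weight
`ψ : ℝ³ → ℝ` (no regularity: at finite `N` all velocity integrals are finite sums and `s ↦ ψ(vᵢ(s))` is a step
function) and the cone `b_r`, the pairing of `φ(t, ·)` with the mollified `ψ`-moment field
`M_ψ(w)(x₀) = ∫ b_r(q.1, x₀) ψ(q.2) dμ_w` satisfies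
`∫φ(t)M_ψ(t) − ∫φ(0)M_ψ(0) = ∫₀ᵗ∫ (∂ₛφ M_ψ + ∑ₖ J_{ψ,k} ∂ₖφ) + (N+1)⁻¹ Σ_{collisions s ∈ (0,t]} Σ_{ordered contact
pairs (i,j)} (∫φ(s,x)b_r(xᵢ(s),x)dx)(ψ(vᵢ(s)) − ψ(vᵢ(s⁻)))`, `J_{ψ,k}(w)(x₀) = ∫ b_r(q.1,x₀) q.2ₖ ψ(q.2) dμ_w` the
kinetic `ψ`-flux and `vᵢ(s⁻) = (reflectVel n̂ (vᵢ(s), vⱼ(s))).1` the pre-collisional velocity (trajectories are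
right-continuous; the reflection is an involution).  Free transport between collisions exactly as in `MassBalance`
(no derivative falls on the Lipschitz cone), plus the jump of the step function `s ↦ ψ(vᵢ(s))` at each collision,
carried by the two ordered pairs of the unique colliding pair (`pairSum_eq_particleSum`).  Collisions in `(0, t]`
(`Ioc`: a collision AT time `0` is already post-collisional in `γ 0`).  `ψ ≡ 1` is `MassBalance`; `ψ = vₖ` the
momentum balance with the collision sum as flux; `ψ = ‖v‖²/2` the energy balance (kinetic energy current = the
CUBIC moment field, collisional transfer = the jump term). -/
def EmpiricalWeakEquation : Prop :=
  ∀ (σ : ℝ), 0 < σ → σ < 2⁻¹ → ∀ (N : ℕ)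
    (Φ : HardSphereFlow (Torus.geometry (Fin 3)) (hsDiameter σ N) (N + 1)),
    ∀ z ∈ Φ.good, ∀ r : ℝ, 0 < r →
    ∀ φ : ℝ → T3 → ℝ, Literature.Analysis.FunctionSpaces.Torus.IsSmoothSpaceTimeOn Set.univ φ →
    ∀ ψ : V3 → ℝ, ∀ t : ℝ, 0 ≤ t →
    let ε := hsDiameter σ N
    let G : Geometry (Fin 3) T3 := Torus.geometry (Fin 3)
    let γ : ℝ → Config (N + 1) (Fin 3) T3 := fun s => Φ.flow s z
    let pv : ℝ → Fin (N + 1) → Fin (N + 1) → V3 × V3 := fun s i j =>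
      reflectVel (G.sepVec (γ s i).1 (γ s j).1) ((γ s i).2, (γ s j).2)
    let bx : T3 → T3 → ℝ := fun y x => 3 / (Real.pi * r ^ 3) * max (1 - Torus.euclidDist y x / r) 0
    let Mψ : Config (N + 1) (Fin 3) T3 → T3 → ℝ := fun w x₀ => ∫ q, bx q.1 x₀ * ψ q.2 ∂(empiricalMeasure w)
    let Jψ : Config (N + 1) (Fin 3) T3 → T3 → Fin 3 → ℝ := fun w x₀ k =>
      ∫ q, bx q.1 x₀ * (q.2 k * ψ q.2) ∂(empiricalMeasure w)
    (∫ x, φ t x * Mψ (γ t) x) - ∫ x, φ 0 x * Mψ (γ 0) x =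
      (∫ s in Set.Icc 0 t, ∫ x, (deriv (fun s' => φ s' x) s * Mψ (γ s) x
        + ∑ k : Fin 3, Jψ (γ s) x k * Literature.Analysis.FunctionSpaces.Torus.partialDeriv k (φ s) x))
      + (N + 1 : ℝ)⁻¹ * ∑ᶠ (s : ℝ) (_ : s ∈ collisionTimes G ε γ ∩ Set.Ioc 0 t),
          ∑ i : Fin (N + 1), ∑ j : Fin (N + 1),
            (if i ≠ j ∧ ‖G.sepVec (γ s i).1 (γ s j).1‖ = ε then
              (∫ x, φ s x * bx (γ s i).1 x) * (ψ (γ s i).2 - ψ (pv s i j).1) else 0)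

/-- **The `t = 0` layer.**  Under the conjunct's tie `TendstoHydroFieldsAt … 0` (tested convergence, `χ` by `χ`), at
every fixed mollification radius `r` the three cone-mollified empirical fields are UNIFORMLY-in-`x` close to the
Euler data `(ρ, ρu, E)(0, ·)` in probability: test with the finitely many cones of a net, control the cone fields'
`x`-modulus by `Lip(b_r)·(mass, (N+1)⁻¹∑|vᵢ|, (N+1)⁻¹∑|vᵢ|²/2)` (energy tightness of local Gibbs laws,
`exists_energy_tail_le`), and the data's own modulus of continuity. -/
def InitialLayer : Prop :=
  ∀ (a₀ θ₀ : T3 → ℝ) (u₀ : T3 → V3), Continuous a₀ → Continuous θ₀ → Continuous u₀ →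
    (∀ x, 0 < a₀ x) → (∀ x, 0 < θ₀ x) → ∃ σ₀ : ℝ, 0 < σ₀ ∧ ∀ σ : ℝ, 0 < σ → σ < σ₀ →
    ∀ (T : ℝ) (ρ θ : ℝ → T3 → ℝ) (u : ℝ → T3 → V3), IsHardSphereEulerSolution σ T ρ u θ → 0 < T →
    ∀ Φ : (N : ℕ) → HardSphereFlow (Torus.geometry (Fin 3)) (hsDiameter σ N) (N + 1),
    TendstoHydroFieldsAt (fun N => localGibbsLaw σ a₀ u₀ θ₀ N (Φ N)) Φ ρ u θ 0 →
    ∀ η δ : ℝ, 0 < η → 0 < δ → ∃ r₀ : ℝ, 0 < r₀ ∧ ∀ r : ℝ, 0 < r → r < r₀ → ∃ N₀ : ℕ, ∀ N : ℕ, N₀ ≤ N →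
    let bx : T3 → T3 → ℝ := fun y x => 3 / (Real.pi * r ^ 3) * max (1 - Torus.euclidDist y x / r) 0
    localGibbsLaw σ a₀ u₀ θ₀ N (Φ N)
        {z | ∃ x, η < |empiricalDensityField ((Φ N).flow 0 z) (fun y => bx y x) - ρ 0 x|} ≤ ENNReal.ofReal δ ∧
    localGibbsLaw σ a₀ u₀ θ₀ N (Φ N)
        {z | ∃ x, η < ‖empiricalMomentumField ((Φ N).flow 0 z) (fun y => bx y x) - ρ 0 x • u 0 x‖} ≤
          ENNReal.ofReal δ ∧
    localGibbsLaw σ a₀ u₀ θ₀ N (Φ N)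
        {z | ∃ x, η < |empiricalEnergyField ((Φ N).flow 0 z) (fun y => bx y x) -
          totalEnergyDensity (ρ 0 x) (u 0 x) (θ 0 x)|} ≤ ENNReal.ofReal δ

/-- **Uniform integrability of the quadratic collision mark** (the collisional tail channel in the form the
fixed-instant readout needs; frame of `CollisionMomentBound`, stmt-15144, which is TIGHTNESS of `K_N[1+|v|²+|w|²]` and
does not control the share of one short time window): for every `η, δ` there is a level `L` beyond which the part of
`K_N[1+|vᵢ|²+|vⱼ|²]` carried by collisions with `|vᵢ|²+|vⱼ|² > L` is `≤ η` with probability `≥ 1 − δ`, eventually in `N`.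
Equilibrium value: Enskog rate × Gaussian tails, uniformly in `N`; along the flow: same hardness class as 15144. -/
def CollisionMomentUI : Prop :=
  ∀ (a₀ θ₀ : T3 → ℝ) (u₀ : T3 → V3), Continuous a₀ → Continuous θ₀ → Continuous u₀ →
    (∀ x, 0 < a₀ x) → (∀ x, 0 < θ₀ x) → ∃ σ₀ : ℝ, 0 < σ₀ ∧ ∀ σ : ℝ, 0 < σ → σ < σ₀ →
    ∀ Φ : (N : ℕ) → HardSphereFlow (Torus.geometry (Fin 3)) (hsDiameter σ N) (N + 1),
    ∀ τ : ℝ, 0 < τ → ∀ η δ : ℝ, 0 < η → 0 < δ → ∃ L : ℝ, ∃ N₀ : ℕ, ∀ N : ℕ, N₀ ≤ N →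
    let ε := hsDiameter σ N
    let G : Geometry (Fin 3) T3 := Torus.geometry (Fin 3)
    let γ : Config (N + 1) (Fin 3) T3 → ℝ → Config (N + 1) (Fin 3) T3 := fun z s => (Φ N).flow s z
    let Kc : (Config (N + 1) (Fin 3) T3 → ℝ → Fin (N + 1) → Fin (N + 1) → ℝ) → Config (N + 1) (Fin 3) T3 → ℝ := fun F z =>
      ε / (N + 1 : ℝ) * ∑ᶠ (s : ℝ) (_ : s ∈ collisionTimes G ε (γ z) ∩ Set.Icc 0 τ),
        ∑ i : Fin (N + 1), ∑ j : Fin (N + 1),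
          (if i ≠ j ∧ ‖G.sepVec (γ z s i).1 (γ z s j).1‖ = ε then F z s i j else 0)
    localGibbsLaw σ a₀ u₀ θ₀ N (Φ N)
        {z | η < Kc (fun z s i j => if L < ‖(γ z s i).2‖ ^ 2 + ‖(γ z s j).2‖ ^ 2 then
          1 + ‖(γ z s i).2‖ ^ 2 + ‖(γ z s j).2‖ ^ 2 else 0) z} ≤ ENNReal.ofReal δ

/-- **Weak isotropy of the local pressure tensor, in band, pre-shock.**  In the Euler-tied frame (the cubic tail
input `EnergyCurrentTails` is tied), for every continuous TRACELESS tensor test field `a(s,x)` and every continuous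
density cut-off `g` vanishing on `[η₀, ∞)`, the space–time integral of `g(σ³ρ_r)·a : P_r` — `P_r` the full cone-mollified
second central moment tensor `∫ b_r v⊗v dμ − m_r⊗m_r/ρ_r` (no velocity truncation; `tr P_r = 3ρ_rθ_r`) — tends to `0`
in probability (`N → ∞` then `r → 0`).  Mechanism: collision invariance + ContactChaos ⇒ local Boltzmann–Enskog balance;
CollisionRate ⇒ positive rate in band; measure rigidity ⇒ Maxwellian/Dirac ⇒ isotropy on bounded velocity sets; cubic
(hence quadratic) one-body tails pay the rest. -/
def WeakStressIsotropyInBand : Prop :=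
  ∃ η₀ : ℝ, 0 < η₀ ∧ ∀ (a₀ θ₀ : T3 → ℝ) (u₀ : T3 → V3), Continuous a₀ → Continuous θ₀ → Continuous u₀ →
    (∀ x, 0 < a₀ x) → (∀ x, 0 < θ₀ x) → ∃ σ₀ : ℝ, 0 < σ₀ ∧ ∀ σ : ℝ, 0 < σ → σ < σ₀ →
    ∀ (T : ℝ) (ρ θ : ℝ → T3 → ℝ) (u : ℝ → T3 → V3), IsHardSphereEulerSolution σ T ρ u θ →
    ∀ Φ : (N : ℕ) → HardSphereFlow (Torus.geometry (Fin 3)) (hsDiameter σ N) (N + 1),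
    TendstoHydroFieldsAt (fun N => localGibbsLaw σ a₀ u₀ θ₀ N (Φ N)) Φ ρ u θ 0 →
    ∀ t ∈ Set.Ico 0 T, ∀ a : Fin 3 → Fin 3 → ℝ × T3 → ℝ, (∀ j k, Continuous (a j k)) →
    (∀ p, ∑ j : Fin 3, a j j p = 0) →
    ∀ g : ℝ → ℝ, Continuous g → (∀ b, η₀ ≤ b → g b = 0) →
    ∀ η δ : ℝ, 0 < η → 0 < δ → ∃ r₀ : ℝ, 0 < r₀ ∧ ∀ r : ℝ, 0 < r → r < r₀ → ∃ N₀ : ℕ, ∀ N : ℕ, N₀ ≤ N →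
    let bx : T3 → T3 → ℝ := fun y x => 3 / (Real.pi * r ^ 3) * max (1 - Torus.euclidDist y x / r) 0
    let ρm : Config (N + 1) (Fin 3) T3 → T3 → ℝ := fun w x₀ => ∫ q, bx q.1 x₀ ∂(empiricalMeasure w)
    let mm : Config (N + 1) (Fin 3) T3 → T3 → V3 := fun w x₀ => ∫ q, bx q.1 x₀ • q.2 ∂(empiricalMeasure w)
    let Pm : Config (N + 1) (Fin 3) T3 → T3 → Fin 3 → Fin 3 → ℝ := fun w x₀ j k =>
      (∫ q, bx q.1 x₀ * (q.2 j * q.2 k) ∂(empiricalMeasure w)) - mm w x₀ j * mm w x₀ k / ρm w x₀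
    localGibbsLaw σ a₀ u₀ θ₀ N (Φ N)
      {z | η < |∫ s in Set.Icc 0 t, ∫ x, g (σ ^ 3 * ρm ((Φ N).flow s z) x) *
        ∑ j : Fin 3, ∑ k : Fin 3, a j k (s, x) * Pm ((Φ N).flow s z) x j k|} ≤ ENNReal.ofReal δ

/-- **Collisional pressure value, in band, pre-shock.**  With CollisionRate's universal `η₀`: for every continuous
symmetric tensor test field `a(s,x)` and continuous cut-off `g` vanishing on `[η₀,∞)`, the normalised collision
functional of the stress mark `g(σ³ρ_r(xᵢ))·|(vᵢ⁻−vⱼ⁻)·ω|·(ω⊗ω : a(s,xᵢ))` minus `2∫₀ᵗ∫ g(σ³ρ_r)(p_hs(ρ_r,θ_r) − ρ_rθ_r) tr a`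
tends to `0` in probability (`N → ∞` then `r → 0`); factor `2` = ordered pairs.  Mechanism: truncated mark by
ContactChaos, remainder by CollisionMomentBound/UI, rate by CollisionRate, isotropic value by WSI and the identity
`∫(g·ω)₊² ω⊗ω dω = (2π/15)(|g|²𝟙 + 2g⊗g)`, `p_hs − ρθ = ρ²θσ³f_ex'` by `HsEosLowDensity_holds`. -/
def CollisionalPressureValueInBand : Prop :=
  ∃ η₀ : ℝ, 0 < η₀ ∧ ∀ (a₀ θ₀ : T3 → ℝ) (u₀ : T3 → V3), Continuous a₀ → Continuous θ₀ → Continuous u₀ →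
    (∀ x, 0 < a₀ x) → (∀ x, 0 < θ₀ x) → ∃ σ₀ : ℝ, 0 < σ₀ ∧ ∀ σ : ℝ, 0 < σ → σ < σ₀ →
    ∀ (T : ℝ) (ρ θ : ℝ → T3 → ℝ) (u : ℝ → T3 → V3), IsHardSphereEulerSolution σ T ρ u θ →
    ∀ Φ : (N : ℕ) → HardSphereFlow (Torus.geometry (Fin 3)) (hsDiameter σ N) (N + 1),
    TendstoHydroFieldsAt (fun N => localGibbsLaw σ a₀ u₀ θ₀ N (Φ N)) Φ ρ u θ 0 →
    ∀ t ∈ Set.Ico 0 T, ∀ a : Fin 3 → Fin 3 → ℝ × T3 → ℝ, (∀ j k, Continuous (a j k)) →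
    (∀ j k p, a j k p = a k j p) →
    ∀ g : ℝ → ℝ, Continuous g → (∀ b, η₀ ≤ b → g b = 0) →
    ∀ η δ : ℝ, 0 < η → 0 < δ → ∃ r₀ : ℝ, 0 < r₀ ∧ ∀ r : ℝ, 0 < r → r < r₀ → ∃ N₀ : ℕ, ∀ N : ℕ, N₀ ≤ N →
    let ε := hsDiameter σ N
    let G : Geometry (Fin 3) T3 := Torus.geometry (Fin 3)
    let γ : Config (N + 1) (Fin 3) T3 → ℝ → Config (N + 1) (Fin 3) T3 := fun z s => (Φ N).flow s z
    let bx : T3 → T3 → ℝ := fun y x => 3 / (Real.pi * r ^ 3) * max (1 - Torus.euclidDist y x / r) 0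
    let ρm : Config (N + 1) (Fin 3) T3 → T3 → ℝ := fun w x₀ => ∫ q, bx q.1 x₀ ∂(empiricalMeasure w)
    let mm : Config (N + 1) (Fin 3) T3 → T3 → V3 := fun w x₀ => ∫ q, bx q.1 x₀ • q.2 ∂(empiricalMeasure w)
    let em : Config (N + 1) (Fin 3) T3 → T3 → ℝ := fun w x₀ =>
      ∫ q, bx q.1 x₀ * (‖q.2‖ ^ 2 / 2) ∂(empiricalMeasure w)
    let θm : Config (N + 1) (Fin 3) T3 → T3 → ℝ := fun w x₀ =>
      2 / 3 * (em w x₀ / ρm w x₀ - ‖mm w x₀‖ ^ 2 / (2 * ρm w x₀ ^ 2))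
    let pv : Config (N + 1) (Fin 3) T3 → ℝ → Fin (N + 1) → Fin (N + 1) → V3 × V3 := fun z s i j =>
      reflectVel (G.sepVec (γ z s i).1 (γ z s j).1) ((γ z s i).2, (γ z s j).2)
    let Kc : (Config (N + 1) (Fin 3) T3 → ℝ → Fin (N + 1) → Fin (N + 1) → ℝ) → Config (N + 1) (Fin 3) T3 → ℝ := fun F z =>
      ε / (N + 1 : ℝ) * ∑ᶠ (s : ℝ) (_ : s ∈ collisionTimes G ε (γ z) ∩ Set.Icc 0 t),
        ∑ i : Fin (N + 1), ∑ j : Fin (N + 1),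
          (if i ≠ j ∧ ‖G.sepVec (γ z s i).1 (γ z s j).1‖ = ε then F z s i j else 0)
    let D : Config (N + 1) (Fin 3) T3 → ℝ := fun z =>
      Kc (fun z s i j =>
          g (σ ^ 3 * ρm (γ z s) (γ z s i).1) *
            |⟪(pv z s i j).1 - (pv z s i j).2, ε⁻¹ • G.sepVec (γ z s i).1 (γ z s j).1⟫_ℝ| *
            ∑ k : Fin 3, ∑ l : Fin 3, a k l (s, (γ z s i).1) *
              ((ε⁻¹ • G.sepVec (γ z s i).1 (γ z s j).1) k * (ε⁻¹ • G.sepVec (γ z s i).1 (γ z s j).1) l)) z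
        - 2 * ∫ s in Set.Icc 0 t, ∫ x, g (σ ^ 3 * ρm (γ z s) x) *
            (hsPressure σ (ρm (γ z s) x) (θm (γ z s) x) - ρm (γ z s) x * θm (γ z s) x) *
            ∑ k : Fin 3, a k k (s, x)
    localGibbsLaw σ a₀ u₀ θ₀ N (Φ N) {z | η < |D z|} ≤ ENNReal.ofReal δ

/-- **Mollified fields close in the band** (v1–v3 output format, SUPERSEDED at v4 by `MollifiedCloseTimeAveraged` +
`stub_readout`: `L¹` closeness AT the instant `t` is not derivable with `r`-independent tolerances, §B5; kept because the
landed `stub_bridge` p98117 is stated over it).  The frame of the crux's conclusion (`∃ η₀` first,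
profiles, `∃ σ₀`, guarded classical hs-Euler solution tied at `t = 0`), with the `χ`-tested convergence at `t`
replaced by `L¹(dx)` closeness in probability ("`N → ∞` then `r → 0`") of the three cone-mollified empirical fields
to `(ρ, ρu, E)(t, ·)` — exactly the hypotheses of `KineticClosureBridge.tendstoHydroFieldsAt_of_mollified`. -/
def MollifiedCloseInBand : Prop :=
  ∃ η₀ : ℝ, 0 < η₀ ∧ ∀ (a₀ θ₀ : T3 → ℝ) (u₀ : T3 → V3), Continuous a₀ → Continuous θ₀ → Continuous u₀ →
    (∀ x, 0 < a₀ x) → (∀ x, 0 < θ₀ x) → ∃ σ₀ : ℝ, 0 < σ₀ ∧ ∀ σ : ℝ, 0 < σ → σ < σ₀ →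
    ∀ (T : ℝ) (ρ θ : ℝ → T3 → ℝ) (u : ℝ → T3 → V3), IsHardSphereEulerSolution σ T ρ u θ →
    (∀ t ∈ Set.Ico 0 T, ∀ x, ρ t x * σ ^ 3 < η₀) →
    ∀ Φ : (N : ℕ) → HardSphereFlow (Torus.geometry (Fin 3)) (hsDiameter σ N) (N + 1),
    TendstoHydroFieldsAt (fun N => localGibbsLaw σ a₀ u₀ θ₀ N (Φ N)) Φ ρ u θ 0 →
    ∀ t ∈ Set.Ico 0 T, ∀ η δ : ℝ, 0 < η → 0 < δ →
    ∃ r₀ : ℝ, 0 < r₀ ∧ ∀ r : ℝ, 0 < r → r < r₀ → ∃ N₀ : ℕ, ∀ N : ℕ, N₀ ≤ N →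
    let bx : T3 → T3 → ℝ := fun y x => 3 / (Real.pi * r ^ 3) * max (1 - Torus.euclidDist y x / r) 0
    localGibbsLaw σ a₀ u₀ θ₀ N (Φ N)
        {z | η < ∫ x, |empiricalDensityField ((Φ N).flow t z) (fun y => bx y x) - ρ t x|} ≤ ENNReal.ofReal δ ∧
    localGibbsLaw σ a₀ u₀ θ₀ N (Φ N)
        {z | η < ∫ x, ‖empiricalMomentumField ((Φ N).flow t z) (fun y => bx y x) - ρ t x • u t x‖} ≤
          ENNReal.ofReal δ ∧
    localGibbsLaw σ a₀ u₀ θ₀ N (Φ N)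
        {z | η < ∫ x, |empiricalEnergyField ((Φ N).flow t z) (fun y => bx y x) -
          totalEnergyDensity (ρ t x) (u t x) (θ t x)|} ≤ ENNReal.ofReal δ

/-- **Mollified fields close in TIME AVERAGE (v4: the Grönwall's honest output).**  The frame of the crux's
conclusion, with the `χ`-tested convergence at `t` replaced by the TIME-AVERAGED `L¹(dx)` closeness in probability of
the three cone-mollified empirical fields to `(ρ, ρu, E)` over a forward window `[t, t + Δ] ⊆ [0, T)` of ANY fixed
length `Δ > 0` ("`N → ∞` then `r → 0`", window fixed before both): `P(η·Δ < ∫_{[t,t+Δ]} (‖ρ_r(s) − ρ(s)‖₁ +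
‖m_r(s) − ρu(s)‖₁ + ‖e_r(s) − E(s)‖₁) ds) ≤ δ`.  This — and not closeness AT the instant `t` — is what a relative-energy
Grönwall fed by in-probability inputs with FIXED test functions delivers (the entropy input arrives tested against
time cut-offs, BF18 itself concludes for a.a. `τ`); the instant `t` is reached by `stub_readout` in the WEAK
(`χ`-tested) topology, where the time-modulus of `∫χ dμ_N(s)` costs `‖∇χ'‖·(windowed collision functional + windowed
cubic current)` with `r`-INDEPENDENT tolerances (`Cruxes/ChaosClosesEuler/NOTES.md` §B5).  The consumer must establish
integrability in `s` of the pathwise error (right-continuous with finitely many jumps) before exploiting the Bochner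
integral. -/
def MollifiedCloseTimeAveraged : Prop :=
  ∃ η₀ : ℝ, 0 < η₀ ∧ ∀ (a₀ θ₀ : T3 → ℝ) (u₀ : T3 → V3), Continuous a₀ → Continuous θ₀ → Continuous u₀ →
    (∀ x, 0 < a₀ x) → (∀ x, 0 < θ₀ x) → ∃ σ₀ : ℝ, 0 < σ₀ ∧ ∀ σ : ℝ, 0 < σ → σ < σ₀ →
    ∀ (T : ℝ) (ρ θ : ℝ → T3 → ℝ) (u : ℝ → T3 → V3), IsHardSphereEulerSolution σ T ρ u θ →
    (∀ t ∈ Set.Ico 0 T, ∀ x, ρ t x * σ ^ 3 < η₀) →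
    ∀ Φ : (N : ℕ) → HardSphereFlow (Torus.geometry (Fin 3)) (hsDiameter σ N) (N + 1),
    TendstoHydroFieldsAt (fun N => localGibbsLaw σ a₀ u₀ θ₀ N (Φ N)) Φ ρ u θ 0 →
    ∀ t ∈ Set.Ico 0 T, ∀ Δ : ℝ, 0 < Δ → t + Δ < T → ∀ η δ : ℝ, 0 < η → 0 < δ →
    ∃ r₀ : ℝ, 0 < r₀ ∧ ∀ r : ℝ, 0 < r → r < r₀ → ∃ N₀ : ℕ, ∀ N : ℕ, N₀ ≤ N →
    let bx : T3 → T3 → ℝ := fun y x => 3 / (Real.pi * r ^ 3) * max (1 - Torus.euclidDist y x / r) 0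
    localGibbsLaw σ a₀ u₀ θ₀ N (Φ N)
        {z | η * Δ < ∫ s in Set.Icc t (t + Δ),
          ((∫ x, |empiricalDensityField ((Φ N).flow s z) (fun y => bx y x) - ρ s x|)
          + (∫ x, ‖empiricalMomentumField ((Φ N).flow s z) (fun y => bx y x) - ρ s x • u s x‖)
          + ∫ x, |empiricalEnergyField ((Φ N).flow s z) (fun y => bx y x) -
              totalEnergyDensity (ρ s x) (u s x) (θ s x)|)} ≤ ENNReal.ofReal δ

/-- **BF18 a-priori stability shell for FUNCTIONS, hard-sphere class (v6; the deterministic core of the Grönwall).**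
Březina–Feireisl's relative-energy weak–strong argument (BF18 §3; the tree's `weakStrong_core` is its Young-measure
form) re-run for a GENUINE measurable, bounded, admissible field `V = (ϱ, m, E)` on `[0, t] × 𝕋³` against a classical
hard-sphere Euler solution in the band `ρσ³ ≤ η₁/2`, the equation of state being a band extension `(χ, f)` of the
hard-sphere one (`C²`, virial `χ = 1 + ρf′`, stable, `χ` bounded, `= (hsCompressibility, hsExcessFreeEnergy)(·σ³)`
for `ρσ³ ≤ η₁` — supplied by `exists_hsEos_band_extension`, BF hypotheses by `monatomicExcess_bf_hypotheses`).  The shell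
fixes clamp levels `a < b` (around the range of the classical entropy) and, for every `ε` and every short window
`Δ ≤ Δ₀`, a tolerance `δ`, such that the five BF18 inputs with defect `δ` — (H1) the continuity equation EXACTLY
against every smooth space–time test, (H2) the momentum equation tested against `ũ` with the EOS flux `m⊗m/ϱ + p(ϱ,θᵥ)𝟙`
up to `δ` at every `τ ≤ t`, (H3) the CLAMPED entropy inequality `∂ₜ(ϱZ(s)) + div(Z(s)m) ≥ 0`, `Z = clamp a b`,
tested against `θ̃(s,x)·ζ((τ₀+Δ−s)/Δ)` (`ζ = Real.smoothTransition`, a smooth decreasing time cut-off) up to `δ`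
for every `τ₀ ≤ t − Δ`, (H4) the global energy inequality up to `δ` at every `τ`, (H5) sup-closeness `δ` at `τ = 0`
— force the TIME-AVERAGED `L¹` distance to the classical state over every window `[τ₀, τ₀+Δ]` below `ε·Δ`.  Vacuum,
cold and dense values of `V` are allowed (priced by the far-field linear coercivity of the clamped relative energy and
BF's growth condition `|p| ≤ c(1+ρ+ρ|s|+ρe)`, automatic here since `|p| = ρθ|χ| ≤ Bρθ`); junk values of `log` at
`ϱ = 0` or `θᵥ ≤ 0` are clamped by `Z` and multiplied by `ϱ = 0` resp. priced far-field.  The windowed (not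
instantaneous) form of (H3) and of the conclusion is what fixed-test in-probability inputs can deliver and all a
Grönwall needs (discrete Grönwall on `I(τ) = ∫₀^τ ℰ`).  Deterministic; no particle system.  v7 (wave-5 `stub-misstated`,
both corrections kernel-witnessed by the shell worker): `E ≥ 0` is hypothesised (admissibility `‖m‖² ≤ 2ϱE` leaves `E` free
on the vacuum: a hole with `E := −N` inside breaks the conclusion), and the clamped entropy takes the cut-off VALUE `a` on
exactly-cold states `θo ≤ 0` (with Lean's `log 0 = 0` the junk entropy of a suddenly cooled state would read as an entropy
INCREASE; the kinetic consumer pays only the `ϱ`- and `|m|`-mass of single-particle cones, `O(√(Ē/(r³N)))`).  v8 (lead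
c3): (H1) quantifies over `C¹` space–time tests (`ContDiff ℝ 1 (Torus.stLift φ)`, BF18's own test class) instead of smooth
ones: the shell tests the continuity equation with `½|ũ|² − μ(ρ̃,θ̃)` (`C¹` only, `μ` carries `f′`), extended globally in
`C¹` from `[0, T)` by `Torus.exists_contDiff_one_extension`; the kinetic consumer supplies it by `MassBalanceC1`. -/
def BF18ShellHS : Prop :=
  ∀ (σ : ℝ), 0 < σ → ∀ (η₁ : ℝ), 0 < η₁ → ∀ (χe f : ℝ → ℝ),
    ContDiffOn ℝ 2 χe (Set.Ioi 0) → ContDiffOn ℝ 2 f (Set.Ioi 0) →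
    (∀ a, 0 < a → χe a = 1 + a * deriv f a) → (∀ a, 0 < a → 0 < χe a + a * deriv χe a) →
    (∃ B : ℝ, ∀ a, 0 < a → |χe a| ≤ B) →
    (∀ a, 0 < a → a * σ ^ 3 ≤ η₁ → f a = hsExcessFreeEnergy (a * σ ^ 3) ∧ χe a = hsCompressibility (a * σ ^ 3)) →
    ∀ (T : ℝ) (ρ θ : ℝ → T3 → ℝ) (u : ℝ → T3 → V3), IsHardSphereEulerSolution σ T ρ u θ →
    (∀ s ∈ Set.Ico 0 T, ∀ x, ρ s x * σ ^ 3 ≤ η₁ / 2) →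
    ∀ t ∈ Set.Ioo 0 T, ∃ a b : ℝ, a < b ∧ ∀ ε : ℝ, 0 < ε → ∃ Δ₀ : ℝ, 0 < Δ₀ ∧ ∀ Δ : ℝ, 0 < Δ → Δ ≤ Δ₀ → Δ < t →
    ∃ δ : ℝ, 0 < δ ∧ ∀ V : ℝ → T3 → ℝ × V3 × ℝ, Measurable (Function.uncurry V) →
    (∃ C : ℝ, ∀ s x, |(V s x).1| ≤ C ∧ ‖(V s x).2.1‖ ≤ C ∧ |(V s x).2.2| ≤ C) →
    (∀ s x, 0 ≤ (V s x).1) → (∀ s x, 0 ≤ (V s x).2.2) →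
    (∀ s x, ‖(V s x).2.1‖ ^ 2 ≤ 2 * (V s x).1 * (V s x).2.2) →
    let θo : ℝ × V3 × ℝ → ℝ := fun U => 2 / 3 * (U.2.2 / U.1 - ‖U.2.1‖ ^ 2 / (2 * U.1 ^ 2))
    let pV : ℝ × V3 × ℝ → ℝ := fun U => U.1 * θo U * χe U.1
    let Zs : ℝ × V3 × ℝ → ℝ := fun U => if 0 < θo U then max a (min (3 / 2 * Real.log (θo U) - Real.log U.1 - f U.1) b) else a
    let Etot : ℝ → T3 → ℝ := fun s x => totalEnergyDensity (ρ s x) (u s x) (θ s x)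
    let cut : ℝ → ℝ → ℝ := fun τ₀ s => Real.smoothTransition ((τ₀ + Δ - s) / Δ)
    (∀ φ : ℝ → T3 → ℝ, ContDiff ℝ 1 (Literature.Analysis.FunctionSpaces.Torus.stLift φ) → ∀ τ ∈ Set.Icc 0 t, (∫ x, φ τ x * (V τ x).1) - ∫ x, φ 0 x * (V 0 x).1 = ∫ s in Set.Icc 0 τ, ∫ x, (deriv (fun s' => φ s' x) s * (V s x).1 + ∑ k : Fin 3, (V s x).2.1 k * Literature.Analysis.FunctionSpaces.Torus.partialDeriv k (φ s) x)) →
    (∀ τ ∈ Set.Icc 0 t, |(∫ x, ⟪u τ x, (V τ x).2.1⟫_ℝ) - (∫ x, ⟪u 0 x, (V 0 x).2.1⟫_ℝ) - ∫ s in Set.Icc 0 τ, ∫ x, (⟪Literature.Analysis.FunctionSpaces.Torus.timeDerivWithin (Set.Ico 0 T) u s x, (V s x).2.1⟫_ℝ + ∑ i : Fin 3, ∑ j : Fin 3, Literature.Analysis.FunctionSpaces.Torus.partialDeriv j (fun y => u s y i) x * ((V s x).2.1 i * (V s x).2.1 j / (V s x).1 + if i = j then pV (V s x) else 0))| ≤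 δ) →
    (∀ τ₀ ∈ Set.Icc 0 (t - Δ), (∫ s in Set.Icc 0 t, ∫ x, ((V s x).1 * Zs (V s x) * Literature.Analysis.FunctionSpaces.Torus.timeDerivWithin (Set.Ico 0 T) (fun s' y => θ s' y * cut τ₀ s') s x + Zs (V s x) * ⟪(V s x).2.1, Literature.Analysis.FunctionSpaces.Torus.gradient (fun y => θ s y * cut τ₀ s) x⟫_ℝ)) + ∫ x, (V 0 x).1 * Zs (V 0 x) * (θ 0 x * cut τ₀ 0) ≤ δ) →
    (∀ τ ∈ Set.Icc 0 t, ∫ x, (V τ x).2.2 ≤ (∫ x, (V 0 x).2.2) + δ) →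
    (∀ x, |(V 0 x).1 - ρ 0 x| ≤ δ ∧ ‖(V 0 x).2.1 - ρ 0 x • u 0 x‖ ≤ δ ∧ |(V 0 x).2.2 - Etot 0 x| ≤ δ) →
    ∀ τ₀ ∈ Set.Icc 0 (t - Δ), ∫ s in Set.Icc τ₀ (τ₀ + Δ), ∫ x, (|(V s x).1 - ρ s x| + ‖(V s x).2.1 - ρ s x • u s x‖ + |(V s x).2.2 - Etot s x|) ≤ ε * Δ

/-- **The crux's conclusion** — VERBATIM the packing-guarded conjunct `HydroLimitInBand` (stmt-9133) that
`ChaosClosesEuler` concludes after its three antecedents. -/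
def HydroLimitInBandConclusion : Prop :=
  ∃ η₀ : ℝ, 0 < η₀ ∧ ∀ (a₀ θ₀ : T3 → ℝ) (u₀ : T3 → V3), Continuous a₀ → Continuous θ₀ → Continuous u₀ →
    (∀ x, 0 < a₀ x) → (∀ x, 0 < θ₀ x) → ∃ σ₀ : ℝ, 0 < σ₀ ∧ ∀ σ : ℝ, 0 < σ → σ < σ₀ →
    ∀ (T : ℝ) (ρ θ : ℝ → T3 → ℝ) (u : ℝ → T3 → V3), IsHardSphereEulerSolution σ T ρ u θ →
    (∀ t ∈ Set.Ico 0 T, ∀ x, ρ t x * σ ^ 3 < η₀) →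
    ∀ Φ : (N : ℕ) → HardSphereFlow (Torus.geometry (Fin 3)) (hsDiameter σ N) (N + 1),
    TendstoHydroFieldsAt (fun N => localGibbsLaw σ a₀ u₀ θ₀ N (Φ N)) Φ ρ u θ 0 →
    ∀ t ∈ Set.Ico 0 T, TendstoHydroFieldsAt (fun N => localGibbsLaw σ a₀ u₀ θ₀ N (Φ N)) Φ ρ u θ t

/-- The crux is its three antecedents implying `HydroLimitInBandConclusion` (by `Iff.rfl`). -/
theorem chaosClosesEuler_iff :
    ChaosClosesEuler ↔ (ContactChaos → CollisionRate → LocalSecondLaw → HydroLimitInBandConclusion) :=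
  Iff.rfl

/-! ## §1b The v11 waypoints (cycle 5): pointwise local equilibrium, pointwise Enskog collision statistics,
pointwise two-time chaos, and the three measure-theoretic tools of the rigidity route -/

/-- **Pointwise local equilibrium at scale `r`, in band, pre-shock (NEW INPUT, v11; to be FILED by the planner —
the recommended docking level of the kinetic half).**  In the Euler-tied frame, for every bounded continuous
velocity test `ψ` and every bounded continuous state weight `h(ρ, u, θ)` supported away from vacuum (`ρ ≤ ρ₁`),
from the band edge (`σ³ρ ≥ η₀`), from cold (`θ ≤ θ₁`), hot (`θ ≥ Θ`) and fast (`|u| ≥ U`) states — all FIXED before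
`r` — the `ψ`-moment of the cone-mollified SAME-TIME empirical velocity law at `(s, x)` equals `ρ_r(s,x)` times the
`ψ`-moment of the unit Maxwellian with the law's OWN velocity `u_r = m_r/ρ_r` and temperature
`θ_r = ⅔(e_r/ρ_r − |m_r|²/2ρ_r²)`, up to an error that is small in `L¹(ds dx)` over `[0, t] × 𝕋³` in probability
(`N → ∞` then `r → 0`).  This is what Maxwellian rigidity is FOR; it is stated pointwise (absolute value INSIDE the
`(s, x)`-integral) because the consumers (the same-time stress `P_r` in WSI, the same-time temperature in CPV) are
nonlinear in the local law and a fixed-`χ` (weak) statement controls only mesoscopic Young-measure averages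
(`NOTES.md` §F, (R1)).  Junk values (`ρ_r = 0`, `θ_r ≤ 0`: `localMaxwellian` is then junk) are multiplied by
`h = 0`. -/
def PointwiseLocalEquilibrium : Prop :=
  ∃ η₀ : ℝ, 0 < η₀ ∧ ∀ (a₀ θ₀ : T3 → ℝ) (u₀ : T3 → V3), Continuous a₀ → Continuous θ₀ → Continuous u₀ →
    (∀ x, 0 < a₀ x) → (∀ x, 0 < θ₀ x) → ∃ σ₀ : ℝ, 0 < σ₀ ∧ ∀ σ : ℝ, 0 < σ → σ < σ₀ →
    ∀ (T : ℝ) (ρ θ : ℝ → T3 → ℝ) (u : ℝ → T3 → V3), IsHardSphereEulerSolution σ T ρ u θ →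
    ∀ Φ : (N : ℕ) → HardSphereFlow (Torus.geometry (Fin 3)) (hsDiameter σ N) (N + 1),
    TendstoHydroFieldsAt (fun N => localGibbsLaw σ a₀ u₀ θ₀ N (Φ N)) Φ ρ u θ 0 →
    ∀ t ∈ Set.Ico 0 T, ∀ ψ : V3 → ℝ, Continuous ψ → (∃ C : ℝ, ∀ v, |ψ v| ≤ C) →
    ∀ h : ℝ × V3 × ℝ → ℝ, Continuous h → (∃ C : ℝ, ∀ p, |h p| ≤ C) →
    (∃ ρ₁ θ₁ Θ U : ℝ, 0 < ρ₁ ∧ 0 < θ₁ ∧ ∀ p : ℝ × V3 × ℝ,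
      (p.1 ≤ ρ₁ ∨ η₀ ≤ σ ^ 3 * p.1 ∨ p.2.2 ≤ θ₁ ∨ Θ ≤ p.2.2 ∨ U ≤ ‖p.2.1‖) → h p = 0) →
    ∀ η δ : ℝ, 0 < η → 0 < δ → ∃ r₀ : ℝ, 0 < r₀ ∧ ∀ r : ℝ, 0 < r → r < r₀ → ∃ N₀ : ℕ, ∀ N : ℕ, N₀ ≤ N →
    let bx : T3 → T3 → ℝ := fun y x => 3 / (Real.pi * r ^ 3) * max (1 - Torus.euclidDist y x / r) 0
    let ρm : Config (N + 1) (Fin 3) T3 → T3 → ℝ := fun w x₀ => ∫ q, bx q.1 x₀ ∂(empiricalMeasure w)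
    let mm : Config (N + 1) (Fin 3) T3 → T3 → V3 := fun w x₀ => ∫ q, bx q.1 x₀ • q.2 ∂(empiricalMeasure w)
    let em : Config (N + 1) (Fin 3) T3 → T3 → ℝ := fun w x₀ =>
      ∫ q, bx q.1 x₀ * (‖q.2‖ ^ 2 / 2) ∂(empiricalMeasure w)
    let um : Config (N + 1) (Fin 3) T3 → T3 → V3 := fun w x₀ => (ρm w x₀)⁻¹ • mm w x₀
    let θm : Config (N + 1) (Fin 3) T3 → T3 → ℝ := fun w x₀ =>
      2 / 3 * (em w x₀ / ρm w x₀ - ‖mm w x₀‖ ^ 2 / (2 * ρm w x₀ ^ 2))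
    let Mψ : Config (N + 1) (Fin 3) T3 → T3 → ℝ := fun w x₀ => ∫ q, bx q.1 x₀ * ψ q.2 ∂(empiricalMeasure w)
    localGibbsLaw σ a₀ u₀ θ₀ N (Φ N)
      {z | η < ∫ s in Set.Icc 0 t, ∫ x,
        |h (ρm ((Φ N).flow s z) x, um ((Φ N).flow s z) x, θm ((Φ N).flow s z) x)| *
          |Mψ ((Φ N).flow s z) x - ρm ((Φ N).flow s z) x *
            ∫ v, ψ v * localMaxwellian 1 (θm ((Φ N).flow s z) x) (um ((Φ N).flow s z) x) v|} ≤ ENNReal.ofReal δ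

/-- **Pointwise Enskog collision statistics at scale `r`, in band (NEW INPUT, v11; to be FILED by the planner —
the pointwise strengthening of the route's own `ContactChaos` (13477, same-time products) ∧ `CollisionRate` (13481,
contact value)).**  For local Gibbs data, every horizon `τ`, every bounded continuous mark test `G(ω, v⁻, v⁻_*)`
and every bounded continuous state weight `h(ρ, u, θ)` vanishing out of band (`σ³ρ ≥ η₀`), the tent-in-time ×
cone-in-space windowed, normalised collision functional of `h(ρ_r, u_r, θ_r)(s, xᵢ)·G(n̂ᵢⱼ, vᵢ⁻, vⱼ⁻)` at window
`(t₀, x₀)` equals `σ³` times the same window of `h·Y(σ³ρ_r)·B^G_r`, `B^G_r(s, x) = ∫∫ b_r b_r Θ_G d(μ_s ⊗ μ_s)` the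
SAME-TIME cone pair functional, `Θ_G(v, w) = ∫ G(ω, v, w)((w − v)·ω)₊ dω`, `Y = (3/2π) f_ex′` the contact value
(`HsEosLowDensity`, proved), up to an error small in `L¹(dt₀ dx₀)` over `[0, τ] × 𝕋³` in probability (`N → ∞` then
`r → 0`).  Conventions (ordered contact pairs, pre-collisional marks `pv`, impact vector `ε⁻¹ sepVec`, kernel
`hardSphereKernel (w, v)`) are VERBATIM those of 13477 / 13481 / 13350; with `G ≡ 1` and `h = g(σ³ρ)` this is 13481
window by window (`Θ_1 = π|v − w|`, `B¹_r`).  Pointwise because the VALUE of the collisional pressure multiplies the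
`(s, x)`-dependent temperature (`NOTES.md` §F, (R1)/(R2)); the general weight `h` lets the consumer localise
collisions to cold / hot / fast / dilute states, whose contribution it must price separately. -/
def PointwiseEnskogCollisions : Prop :=
  ∃ η₀ : ℝ, 0 < η₀ ∧ ∀ (a₀ θ₀ : T3 → ℝ) (u₀ : T3 → V3), Continuous a₀ → Continuous θ₀ → Continuous u₀ →
    (∀ x, 0 < a₀ x) → (∀ x, 0 < θ₀ x) → ∃ σ₀ : ℝ, 0 < σ₀ ∧ ∀ σ : ℝ, 0 < σ → σ < σ₀ →
    ∀ Φ : (N : ℕ) → HardSphereFlow (Torus.geometry (Fin 3)) (hsDiameter σ N) (N + 1),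
    ∀ τ : ℝ, 0 < τ → ∀ G : V3 × V3 × V3 → ℝ, Continuous G → (∃ C : ℝ, ∀ p, |G p| ≤ C) →
    ∀ h : ℝ × V3 × ℝ → ℝ, Continuous h → (∃ C : ℝ, ∀ p, |h p| ≤ C) →
    (∀ p : ℝ × V3 × ℝ, η₀ ≤ σ ^ 3 * p.1 → h p = 0) →
    ∀ η δ : ℝ, 0 < η → 0 < δ → ∃ r₀ : ℝ, 0 < r₀ ∧ ∀ r : ℝ, 0 < r → r < r₀ → ∃ N₀ : ℕ, ∀ N : ℕ, N₀ ≤ N →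
    let ε := hsDiameter σ N
    let Gm : Geometry (Fin 3) T3 := Torus.geometry (Fin 3)
    let γ : Config (N + 1) (Fin 3) T3 → ℝ → Config (N + 1) (Fin 3) T3 := fun z s => (Φ N).flow s z
    let bx : T3 → T3 → ℝ := fun y x => 3 / (Real.pi * r ^ 3) * max (1 - Torus.euclidDist y x / r) 0
    let bt : ℝ → ℝ := fun a => r⁻¹ * max (1 - |a| / r) 0
    let ρm : Config (N + 1) (Fin 3) T3 → T3 → ℝ := fun w x₀ => ∫ q, bx q.1 x₀ ∂(empiricalMeasure w)
    let mm : Config (N + 1) (Fin 3) T3 → T3 → V3 := fun w x₀ => ∫ q, bx q.1 x₀ • q.2 ∂(empiricalMeasure w)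
    let em : Config (N + 1) (Fin 3) T3 → T3 → ℝ := fun w x₀ =>
      ∫ q, bx q.1 x₀ * (‖q.2‖ ^ 2 / 2) ∂(empiricalMeasure w)
    let um : Config (N + 1) (Fin 3) T3 → T3 → V3 := fun w x₀ => (ρm w x₀)⁻¹ • mm w x₀
    let θm : Config (N + 1) (Fin 3) T3 → T3 → ℝ := fun w x₀ =>
      2 / 3 * (em w x₀ / ρm w x₀ - ‖mm w x₀‖ ^ 2 / (2 * ρm w x₀ ^ 2))
    let Hw : Config (N + 1) (Fin 3) T3 → T3 → ℝ := fun w x => h (ρm w x, um w x, θm w x)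
    let Θ : V3 → V3 → ℝ := fun v w =>
      ∫ ω : Metric.sphere (0 : V3) 1, G ((ω : V3), v, w) * hardSphereKernel (w, v) ω ∂sphereMeasure
    let BG : Config (N + 1) (Fin 3) T3 → T3 → ℝ := fun w x₀ =>
      ∫ p, bx p.1.1 x₀ * bx p.2.1 x₀ * Θ p.1.2 p.2.2 ∂((empiricalMeasure w).prod (empiricalMeasure w))
    let pv : Config (N + 1) (Fin 3) T3 → ℝ → Fin (N + 1) → Fin (N + 1) → V3 × V3 := fun z s i j =>
      reflectVel (Gm.sepVec (γ z s i).1 (γ z s j).1) ((γ z s i).2, (γ z s j).2)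
    let Y : ℝ → ℝ := fun a => 3 / (2 * Real.pi) * deriv hsExcessFreeEnergy a
    let Kr : Config (N + 1) (Fin 3) T3 → ℝ → T3 → ℝ := fun z t₀ x₀ =>
      ε / (N + 1 : ℝ) * ∑ᶠ (s : ℝ) (_ : s ∈ collisionTimes Gm ε (γ z) ∩ Set.Icc 0 τ),
        ∑ i : Fin (N + 1), ∑ j : Fin (N + 1),
          (if i ≠ j ∧ ‖Gm.sepVec (γ z s i).1 (γ z s j).1‖ = ε then
            bt (s - t₀) * bx (γ z s i).1 x₀ * Hw (γ z s) (γ z s i).1 *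
              G (ε⁻¹ • Gm.sepVec (γ z s i).1 (γ z s j).1, (pv z s i j).1, (pv z s i j).2) else 0)
    let R : Config (N + 1) (Fin 3) T3 → ℝ → T3 → ℝ := fun z t₀ x₀ =>
      σ ^ 3 * ∫ s in Set.Icc 0 τ, bt (s - t₀) *
        ∫ x, bx x x₀ * (Hw (γ z s) x * Y (σ ^ 3 * ρm (γ z s) x) * BG (γ z s) x)
    localGibbsLaw σ a₀ u₀ θ₀ N (Φ N)
      {z | η < ∫ t₀ in Set.Icc 0 τ, ∫ x₀, |Kr z t₀ x₀ - R z t₀ x₀|} ≤ ENNReal.ofReal δ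

/-- **Pointwise two-time chaos at contact (NEW INPUT of the rigidity route only, v11): `LimitCollisionMeasure.ContactChaos`
(stmt-13350) with the absolute value INSIDE the window integral and the fixed localiser `χ` dropped** — for every
continuous mark test `G` of quadratic growth, `∫∫ |K_r(G)·ρ_w² − K_r(q)·⟨ν_r ⊗ ν_r, Θ_G⟩|(t₀, x₀) dt₀ dx₀ → 0` in
probability; all binders VERBATIM 13350's.  Feeds `stub_localEquilibrium` (Maxwellian rigidity needs the balance
defect at INDIVIDUAL windows, `NOTES.md` §F (R1)); implies 13350 (`|∫χ d| ≤ ‖χ‖∞ ∫|d|`). -/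
def PointwiseContactChaos : Prop :=
  ∀ (a₀ θ₀ : T3 → ℝ) (u₀ : T3 → V3), Continuous a₀ → Continuous θ₀ → Continuous u₀ →
    (∀ x, 0 < a₀ x) → (∀ x, 0 < θ₀ x) → ∃ σ₀ : ℝ, 0 < σ₀ ∧ ∀ σ : ℝ, 0 < σ → σ < σ₀ →
    ∀ Φ : (N : ℕ) → HardSphereFlow (Torus.geometry (Fin 3)) (hsDiameter σ N) (N + 1),
    ∀ τ : ℝ, 0 < τ → ∀ G : V3 × V3 × V3 → ℝ, Continuous G → (∃ C : ℝ, ∀ p, |G p| ≤ C * (1 + ‖p.2.1‖ ^ 2)) →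
    ∀ η δ : ℝ, 0 < η → 0 < δ → ∃ r₀ : ℝ, 0 < r₀ ∧ ∀ r : ℝ, 0 < r → r < r₀ → ∃ N₀ : ℕ, ∀ N : ℕ, N₀ ≤ N →
    let ε := hsDiameter σ N
    let μ := fun (z : Config (N + 1) (Fin 3) T3) (s : ℝ) => empiricalMeasure ((Φ N).flow s z)
    let κ := fun (z : Config (N + 1) (Fin 3) T3) => (Φ N).empiricalCollisionMeasure (Set.Icc 0 τ) z
    let bx : T3 → T3 → ℝ := fun x y => 3 / (Real.pi * r ^ 3) * max (1 - Torus.euclidDist x y / r) 0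
    let bt : ℝ → ℝ := fun a => r⁻¹ * max (1 - |a| / r) 0
    let Θ : V3 → V3 → ℝ := fun v w =>
      ∫ ω : Metric.sphere (0 : V3) 1, G ((ω : V3), v, w) * hardSphereKernel (w, v) ω ∂sphereMeasure
    let K := fun (F : V3 × V3 × V3 → ℝ) (z : Config (N + 1) (Fin 3) T3) (t₀ : ℝ) (x₀ : T3) =>
      ε / (N + 1 : ℝ) * ∫ m, bt (m.1 - t₀) * bx m.2.1 x₀ * F m.2.2 ∂(κ z)
    let ρw := fun (z : Config (N + 1) (Fin 3) T3) (t₀ : ℝ) (x₀ : T3) =>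
      ∫ s in Set.Icc (0 : ℝ) τ, bt (s - t₀) * ∫ q, bx q.1 x₀ ∂(μ z s)
    let Pw := fun (z : Config (N + 1) (Fin 3) T3) (t₀ : ℝ) (x₀ : T3) =>
      ∫ s in Set.Icc (0 : ℝ) τ, ∫ s' in Set.Icc (0 : ℝ) τ, bt (s - t₀) * bt (s' - t₀) *
        ∫ p, bx p.1.1 x₀ * bx p.2.1 x₀ * Θ p.1.2 p.2.2 ∂((μ z s).prod (μ z s'))
    let D := fun (z : Config (N + 1) (Fin 3) T3) =>
      ∫ t₀ in Set.Icc (0 : ℝ) τ, ∫ x₀ : T3,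
        |K (fun p => G p) z t₀ x₀ * ρw z t₀ x₀ ^ 2 - K (fun p => 1 / (Real.pi * ‖p.2.1 - p.2.2‖)) z t₀ x₀ * Pw z t₀ x₀|
    localGibbsLaw σ a₀ u₀ θ₀ N (Φ N) {z | η < D z} ≤ ENNReal.ofReal δ

/-- **Weak-limit toolkit for finite measures on `ℝ³` with uniformly integrable second moments (provable now; the
compactness half of quantitative rigidity).**  If finite Borel measures `μₙ → μ` weakly on `ℝ³` and `|v|²` is
uniformly integrable along the sequence, then `|v|²` is `μ`-integrable, masses, first and second moments converge,
and for every bounded continuous `ψ` the COLLISIONAL BALANCE functional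
`Bal_ψ(m) = ∫∫∫ ((v − w)·ω)₊ [ψ(v′) + ψ(w′) − ψ(v) − ψ(w)] dω dm(v) dm(w)` (VERBATIM the functional of
`LimitCollisionMeasure.BalanceRigidity`, stmt-13355; kernel of linear growth, hence continuous under UI) converges.
Mathlib: `FiniteMeasure.tendsto_iff_forall_integral_tendsto`, products of weakly convergent finite measures,
truncation `min(|v|², K)`. [folklore; Billingsley, *Convergence of Probability Measures*, Thm 3.5 / §5] -/
def WeakLimitToolkit : Prop :=
  ∀ (μs : ℕ → FiniteMeasure V3) (μ : FiniteMeasure V3), Tendsto μs atTop (𝓝 μ) →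
    (∀ n, Integrable (fun v : V3 => ‖v‖ ^ 2) (μs n : Measure V3)) →
    (∀ ε : ℝ, 0 < ε → ∃ L : ℝ, ∀ n, ∫ v in {v : V3 | L < ‖v‖}, ‖v‖ ^ 2 ∂(μs n : Measure V3) ≤ ε) →
    let Bal : (V3 → ℝ) → Measure V3 → ℝ := fun ψ m =>
      ∫ v, ∫ w, ∫ ω : Metric.sphere (0 : V3) 1,
        hardSphereKernel (v, w) ω * (ψ (collide ω (v, w)).1 + ψ (collide ω (v, w)).2 - ψ v - ψ w) ∂sphereMeasure ∂m ∂m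
    Integrable (fun v : V3 => ‖v‖ ^ 2) (μ : Measure V3) ∧
    Tendsto (fun n => ((μs n : Measure V3) Set.univ).toReal) atTop (𝓝 ((μ : Measure V3) Set.univ).toReal) ∧
    (∀ j : Fin 3, Tendsto (fun n => ∫ v, v j ∂(μs n : Measure V3)) atTop (𝓝 (∫ v, v j ∂(μ : Measure V3)))) ∧
    (∀ j k : Fin 3, Tendsto (fun n => ∫ v, v j * v k ∂(μs n : Measure V3)) atTop
      (𝓝 (∫ v, v j * v k ∂(μ : Measure V3)))) ∧
    Tendsto (fun n => ∫ v, ‖v‖ ^ 2 ∂(μs n : Measure V3)) atTop (𝓝 (∫ v, ‖v‖ ^ 2 ∂(μ : Measure V3))) ∧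
    (∀ ψ : V3 → ℝ, Continuous ψ → (∃ C : ℝ, ∀ v, |ψ v| ≤ C) →
      Tendsto (fun n => Bal ψ (μs n : Measure V3)) atTop (𝓝 (Bal ψ (μ : Measure V3))))

/-- **Moments of the local Maxwellian measure (provable now).**  For `ρ, θ > 0` and `u ∈ ℝ³` the measure
`ρ M_{θ,u}(v) dv` (`localMaxwellian ρ θ u`, density `ρ(2πθ)^{-3/2} e^{-|v-u|²/2θ}`) is finite with `|v|²`
integrable, mass `ρ`, momentum `ρu`, second moments `ρ(uⱼuₖ + θδⱼₖ)`, energy `ρ(|u|² + 3θ)`, and integrates a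
bounded continuous `ψ` to `ρ ∫ ψ M_{1,θ,u}`.  Gaussian integrals by the substitution `v = u + √θ x` and the tree's
`ChaosClosesEulerEnskogTensor` (GaussianMoments) coordinate integrals. [folklore; CIP 1994 §3.2] -/
def MaxwellianMoments : Prop :=
  ∀ (ρ θ : ℝ) (u : V3), 0 < ρ → 0 < θ →
    let m : Measure V3 := volume.withDensity (fun v => ENNReal.ofReal (localMaxwellian ρ θ u v))
    IsFiniteMeasure m ∧ Integrable (fun v : V3 => ‖v‖ ^ 2) m ∧
    (m Set.univ).toReal = ρ ∧ (∀ j : Fin 3, ∫ v, v j ∂m = ρ * u j) ∧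
    (∀ j k : Fin 3, ∫ v, v j * v k ∂m = ρ * (u j * u k + if j = k then θ else 0)) ∧
    (∫ v, ‖v‖ ^ 2 ∂m = ρ * (‖u‖ ^ 2 + 3 * θ)) ∧
    (∀ ψ : V3 → ℝ, Continuous ψ → (∃ C : ℝ, ∀ v, |ψ v| ≤ C) →
      Integrable ψ m ∧ ∫ v, ψ v ∂m = ρ * ∫ v, ψ v * localMaxwellian 1 θ u v)

/-- **A countable bounded continuous family is balance-determining (provable now; the density half of quantitative
rigidity).**  There is a sequence `ψᵢ` of continuous functions `ℝ³ → [−1, 1]` such that every finite Borel measure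
with finite second moment whose collisional balance functional (VERBATIM 13355's) vanishes on every `ψᵢ` is
collisionally balanced against ALL bounded continuous tests — so that `BalanceRigidity` applies to weak limits
balanced along the family.  Proof: clamped rational-coefficient polynomials times the cut-offs
`max 0 (min 1 (R + 1 − |v|))` (Stone–Weierstrass on closed balls), bounded-pointwise approximation and dominated
convergence in the triple integral (dominating function `4‖ψ‖∞ π |v − w|`). [folklore] -/
def BalanceTestFamily : Prop :=
  ∃ ψs : ℕ → V3 → ℝ, (∀ i, Continuous (ψs i)) ∧ (∀ i v, |ψs i v| ≤ 1) ∧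
    let Bal : (V3 → ℝ) → Measure V3 → ℝ := fun ψ m =>
      ∫ v, ∫ w, ∫ ω : Metric.sphere (0 : V3) 1,
        hardSphereKernel (v, w) ω * (ψ (collide ω (v, w)).1 + ψ (collide ω (v, w)).2 - ψ v - ψ w) ∂sphereMeasure ∂m ∂m
    ∀ m : Measure V3, IsFiniteMeasure m → Integrable (fun v : V3 => ‖v‖ ^ 2) m →
      (∀ i, Bal (ψs i) m = 0) →
      ∀ ψ : V3 → ℝ, Continuous ψ → (∃ C : ℝ, ∀ v, |ψ v| ≤ C) → Bal ψ m = 0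

/-- **Quantitative Maxwellian rigidity by compactness (v13; provable now from `LimitCollisionMeasure.BalanceRigidity`
(stmt-13355), `WeakLimitToolkit`, `MaxwellianMoments`, `BalanceTestFamily` — the deterministic core of the rigidity
route to pointwise local equilibrium).**  There is a countable family of continuous tests `ψᵢ : ℝ³ → [−1, 1]` such
that for every tail schedule `Lt`, mass window `[ρ₁, ρ₂]` (`ρ₁ > 0`), temperature floor `θ₁ > 0`, bounded continuous
`ψ` and `ε > 0` there is a level `n` with: every finite Borel measure `m` on `ℝ³` with `|v|²` integrable, mass in
`[ρ₁, ρ₂]`, tails `∫_{|v| > Lt j} |v|² dm ≤ 1/(j+1)` for `j ≤ n`, own temperature `θ_m ≥ θ₁` and collisional balance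
defects `|Bal_{ψᵢ}(m)| ≤ 1/(n+1)` for `i < n` has its `ψ`-moment within `ε` of `ρ_m ∫ ψ M_{1,θ_m,u_m}` (its OWN mass,
velocity and temperature).  Proof: by contradiction along a sequence `m_n`; masses bounded and second moments
uniformly integrable ⇒ tight ⇒ a weakly convergent subsequence (Prokhorov, Mathlib
`isCompact_setOf_finiteMeasure_mass_le_compl_isCompact_le` / `isCompact_closure_of_isTightMeasureSet` after
normalisation); `WeakLimitToolkit` passes moments and every `Bal_{ψ'}` to the limit, so the limit is balanced on the
family, hence on all bounded continuous tests (`BalanceTestFamily`), hence Dirac or Maxwellian (`BalanceRigidity`);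
`θ ≥ θ₁ > 0` excludes Dirac; `MaxwellianMoments` identifies the parameters with the limits of `(ρ_n, u_n, θ_n)`, and
continuity of `(θ, u) ↦ ∫ψ M_{1,θ,u}` at `θ > 0` finishes.  The functional `Bal` is VERBATIM 13355's. [folklore;
compactness upgrade of Boltzmann's uniqueness of collision equilibria, CIP 1994 §3.2] -/
def QuantitativeRigidity : Prop :=
  ∃ ψs : ℕ → V3 → ℝ, (∀ i, Continuous (ψs i)) ∧ (∀ i v, |ψs i v| ≤ 1) ∧
    ∀ (Lt : ℕ → ℝ) (ρ₁ ρ₂ θ₁ : ℝ), 0 < ρ₁ → 0 < θ₁ →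
    ∀ ψ : V3 → ℝ, Continuous ψ → (∃ C : ℝ, ∀ v, |ψ v| ≤ C) →
    ∀ ε : ℝ, 0 < ε → ∃ n : ℕ, ∀ m : Measure V3, IsFiniteMeasure m →
    Integrable (fun v : V3 => ‖v‖ ^ 2) m →
    ρ₁ ≤ (m Set.univ).toReal → (m Set.univ).toReal ≤ ρ₂ →
    (∀ j : ℕ, j ≤ n → ∫ v in {v : V3 | Lt j < ‖v‖}, ‖v‖ ^ 2 ∂m ≤ 1 / ((j : ℝ) + 1)) →
    let Bal : (V3 → ℝ) → Measure V3 → ℝ := fun ψ m =>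
      ∫ v, ∫ w, ∫ ω : Metric.sphere (0 : V3) 1,
        hardSphereKernel (v, w) ω * (ψ (collide ω (v, w)).1 + ψ (collide ω (v, w)).2 - ψ v - ψ w) ∂sphereMeasure ∂m ∂m
    let ρm : ℝ := (m Set.univ).toReal
    let um : V3 := ρm⁻¹ • ∫ v, v ∂m
    let θm : ℝ := 2 / 3 * ((∫ v, ‖v‖ ^ 2 / 2 ∂m) / ρm - ‖∫ v, v ∂m‖ ^ 2 / (2 * ρm ^ 2))
    θ₁ ≤ θm → (∀ i : ℕ, i < n → |Bal (ψs i) m| ≤ 1 / ((n : ℝ) + 1)) →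
    |(∫ v, ψ v ∂m) - ρm * ∫ v, ψ v * localMaxwellian 1 θm um v| ≤ ε

/-- **Energy distance: conditional negative-definiteness of `|v − w|` and its stability (v13; provable now — the
"no within-window fluctuation" tool of the rigidity route, lead NOTES §F2).**  (i) For finite Borel measures `μ, ν`
on `ℝ³` with EQUAL mass and finite first moments, `∫∫|v−w| dμdμ + ∫∫|v−w| dνdν ≤ 2∫∫|v−w| dμdν` (Székely's energy
distance `ℰ(μ,ν) ≥ 0`); (ii) stability of the equality case `ℰ = 0 ⇔ μ = ν`: for every tail schedule, mass window,
bounded continuous `ψ` and `ε > 0` there are `n, δ > 0` such that equal-mass `μ, ν` with masses in `[ρ₁, ρ₂]`, `|v|²`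
integrable with tails `≤ 1/(j+1)` beyond `Lt j` (`j ≤ n`) and `ℰ(μ, ν) ≤ δ` have `|∫ψ dμ − ∫ψ dν| ≤ ε`.  Proof: slicing
`π|x| = ∫_{S²} (x·ω)₊ dω` (`SphereMeasureSymmetry.integral_posPart_inner_sphere_eq`) reduces to one dimension, where
`2∫∫|a−b|dαdβ − ∫∫|a−b|dαdα − ∫∫|a−b|dβdβ = 2∫ (F_α − F_β)² dt` for equal masses (`|a − b| = ∫ (𝟙_{t≤a} − 𝟙_{t≤b})² dt`);
equality forces equal distribution functions of every projection, hence equal characteristic functions, hence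
`μ = ν` (`MeasureTheory.Measure.ext_of_charFun`); stability by contradiction + Prokhorov + continuity of `ℰ` under
weak convergence with uniformly integrable first moments. [cite: G. J. Székely, M. L. Rizzo, *Energy statistics*,
J. Statist. Plann. Inference 143 (2013) 1249–1272, Prop. 1–2; folklore (Mattner 1997) for the conditional
negative-definiteness of the Euclidean norm] -/
def EnergyDistance : Prop :=
  (∀ μ ν : Measure V3, IsFiniteMeasure μ → IsFiniteMeasure ν →
    Integrable (fun v : V3 => ‖v‖) μ → Integrable (fun v : V3 => ‖v‖) ν → μ Set.univ = ν Set.univ →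
    (∫ v, ∫ w, ‖v - w‖ ∂μ ∂μ) + (∫ v, ∫ w, ‖v - w‖ ∂ν ∂ν) ≤ 2 * ∫ v, ∫ w, ‖v - w‖ ∂ν ∂μ) ∧
  (∀ (Lt : ℕ → ℝ) (ρ₁ ρ₂ : ℝ), 0 < ρ₁ →
    ∀ ψ : V3 → ℝ, Continuous ψ → (∃ C : ℝ, ∀ v, |ψ v| ≤ C) →
    ∀ ε : ℝ, 0 < ε → ∃ n : ℕ, ∃ δ : ℝ, 0 < δ ∧ ∀ μ ν : Measure V3, IsFiniteMeasure μ → IsFiniteMeasure ν →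
    Integrable (fun v : V3 => ‖v‖ ^ 2) μ → Integrable (fun v : V3 => ‖v‖ ^ 2) ν →
    μ Set.univ = ν Set.univ → ρ₁ ≤ (μ Set.univ).toReal → (μ Set.univ).toReal ≤ ρ₂ →
    (∀ j : ℕ, j ≤ n → (∫ v in {v : V3 | Lt j < ‖v‖}, ‖v‖ ^ 2 ∂μ ≤ 1 / ((j : ℝ) + 1)) ∧
      (∫ v in {v : V3 | Lt j < ‖v‖}, ‖v‖ ^ 2 ∂ν ≤ 1 / ((j : ℝ) + 1))) →
    2 * (∫ v, ∫ w, ‖v - w‖ ∂ν ∂μ) - (∫ v, ∫ w, ‖v - w‖ ∂μ ∂μ) - (∫ v, ∫ w, ‖v - w‖ ∂ν ∂ν) ≤ δ →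
    |(∫ v, ψ v ∂μ) - ∫ v, ψ v ∂ν| ≤ ε)

/-! ## §2 The registered stubs (v13) -/

/-- STUB `stub_inputs` (EXTERNAL, v15 — not work of this line): the four open items of the board the DOCK consumes,
VERBATIM by name — `TwoClocks.EnergyCurrentTails` (shared crux stmt-9235), `LimitCollisionMeasure.CollisionTightness` (stmt-13354),
`LimitCollisionMeasure.LocalSecondLaw` (stmt-13352, the CLAMPED second law), `InformationPercolationEngine.DensityCap` (the route's own
stmt-13082) — together with the NEW input `PointwiseEnskogCollisions` (pointwise `13477 ∧ 13481`, to be FILED by the split; consumed by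
the landed `stub_pressureValueOfEnskog`).  v15 drops `LimitCollisionMeasure.BalanceRigidity` and `PointwiseContactChaos` (they fed only
the rigidity sub-line, dead by `NOTES.md` §G2 (R3)).  A seat handed this stub answers `stub-blocked` naming the items. -/
theorem stub_inputs :
    TwoClocks.EnergyCurrentTails ∧ LimitCollisionMeasure.CollisionTightness ∧
      LimitCollisionMeasure.LocalSecondLaw ∧ DensityCap ∧ PointwiseEnskogCollisions := by
  sorry

/-- STUB `stub_weakLimitToolkit` (own, M, provable now, wave 9): body VERBATIM `WeakLimitToolkit`. -/
theorem stub_weakLimitToolkit :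
    ∀ (μs : ℕ → FiniteMeasure V3) (μ : FiniteMeasure V3), Tendsto μs atTop (𝓝 μ) →
      (∀ n, Integrable (fun v : V3 => ‖v‖ ^ 2) (μs n : Measure V3)) →
      (∀ ε : ℝ, 0 < ε → ∃ L : ℝ, ∀ n, ∫ v in {v : V3 | L < ‖v‖}, ‖v‖ ^ 2 ∂(μs n : Measure V3) ≤ ε) →
      let Bal : (V3 → ℝ) → Measure V3 → ℝ := fun ψ m =>
        ∫ v, ∫ w, ∫ ω : Metric.sphere (0 : V3) 1,
          hardSphereKernel (v, w) ω * (ψ (collide ω (v, w)).1 + ψ (collide ω (v, w)).2 - ψ v - ψ w) ∂sphereMeasure ∂m ∂m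
      Integrable (fun v : V3 => ‖v‖ ^ 2) (μ : Measure V3) ∧
      Tendsto (fun n => ((μs n : Measure V3) Set.univ).toReal) atTop (𝓝 ((μ : Measure V3) Set.univ).toReal) ∧
      (∀ j : Fin 3, Tendsto (fun n => ∫ v, v j ∂(μs n : Measure V3)) atTop (𝓝 (∫ v, v j ∂(μ : Measure V3)))) ∧
      (∀ j k : Fin 3, Tendsto (fun n => ∫ v, v j * v k ∂(μs n : Measure V3)) atTop
        (𝓝 (∫ v, v j * v k ∂(μ : Measure V3)))) ∧
      Tendsto (fun n => ∫ v, ‖v‖ ^ 2 ∂(μs n : Measure V3)) atTop (𝓝 (∫ v, ‖v‖ ^ 2 ∂(μ : Measure V3))) ∧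
      (∀ ψ : V3 → ℝ, Continuous ψ → (∃ C : ℝ, ∀ v, |ψ v| ≤ C) →
        Tendsto (fun n => Bal ψ (μs n : Measure V3)) atTop (𝓝 (Bal ψ (μ : Measure V3)))) :=
  Summit.AtomisticToContinuum.HydrodynamicLimit.Theorems.ChaosClosesEulerWeakLimitToolkit.stub_weakLimitToolkit

/-- STUB `stub_maxwellianMoments` (own, M, provable now, wave 9): body VERBATIM `MaxwellianMoments`. -/
theorem stub_maxwellianMoments :
    ∀ (ρ θ : ℝ) (u : V3), 0 < ρ → 0 < θ →
      let m : Measure V3 := volume.withDensity (fun v => ENNReal.ofReal (localMaxwellian ρ θ u v))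
      IsFiniteMeasure m ∧ Integrable (fun v : V3 => ‖v‖ ^ 2) m ∧
      (m Set.univ).toReal = ρ ∧ (∀ j : Fin 3, ∫ v, v j ∂m = ρ * u j) ∧
      (∀ j k : Fin 3, ∫ v, v j * v k ∂m = ρ * (u j * u k + if j = k then θ else 0)) ∧
      (∫ v, ‖v‖ ^ 2 ∂m = ρ * (‖u‖ ^ 2 + 3 * θ)) ∧
      (∀ ψ : V3 → ℝ, Continuous ψ → (∃ C : ℝ, ∀ v, |ψ v| ≤ C) →
        Integrable ψ m ∧ ∫ v, ψ v ∂m = ρ * ∫ v, ψ v * localMaxwellian 1 θ u v) :=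
  Summit.AtomisticToContinuum.HydrodynamicLimit.Theorems.ChaosClosesEulerMaxwellianMoments.stub_maxwellianMoments

/-- STUB `stub_balanceTestFamily` (own, M–L, provable now, wave 9): body VERBATIM `BalanceTestFamily`. -/
theorem stub_balanceTestFamily :
    ∃ ψs : ℕ → V3 → ℝ, (∀ i, Continuous (ψs i)) ∧ (∀ i v, |ψs i v| ≤ 1) ∧
      let Bal : (V3 → ℝ) → Measure V3 → ℝ := fun ψ m =>
        ∫ v, ∫ w, ∫ ω : Metric.sphere (0 : V3) 1,
          hardSphereKernel (v, w) ω * (ψ (collide ω (v, w)).1 + ψ (collide ω (v, w)).2 - ψ v - ψ w) ∂sphereMeasure ∂m ∂m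
      ∀ m : Measure V3, IsFiniteMeasure m → Integrable (fun v : V3 => ‖v‖ ^ 2) m →
        (∀ i, Bal (ψs i) m = 0) →
        ∀ ψ : V3 → ℝ, Continuous ψ → (∃ C : ℝ, ∀ v, |ψ v| ≤ C) → Bal ψ m = 0 :=
  Summit.AtomisticToContinuum.HydrodynamicLimit.Theorems.ChaosClosesEulerBalanceTestFamily.stub_balanceTestFamily

/-- STUB `stub_stressIsotropyOfLocalEquilibrium` (own, L, provable now, wave 9): **weak stress isotropy from
pointwise local equilibrium** — `MaxwellianMoments → PointwiseLocalEquilibrium → TwoClocks.EnergyCurrentTails →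
WeakStressIsotropyInBand`, all bodies VERBATIM.  Proof sketch (`NOTES.md` §F3): `η₀ :=` PLE's.  Fix `a` (traceless,
continuous), `g`, `η`, `δ`.  `P_r = ∫ b_r (v − u_r)⊗(v − u_r) dμ_s` is PSD with `tr P_r = 3ρ_rθ_r` (identity; `= 0`
on empty cones, Lean `0/0 = 0`).  Split `(s, x)` by a continuous partition of unity in the state
`(ρ_r, u_r, θ_r)`: (i) dilute `ρ_r ≤ 2ρ₁`: `|P_r| ≤ ∫ b_r |v|² ≤ L²ρ_r + tail_L`, (ii) cold `θ_r ≤ 2θ₁`: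
`|a : P_r| ≤ 9‖a‖ tr P_r ≤ 27‖a‖ ρ_r θ₁`, (iii) hot `θ_r ≥ Θ` or fast `|u_r| ≥ U`: energy there is
`≤ tail₃/M + M²·(mass ≤ 2Ē/(3Θ) + 2Ē/U²)` by the cubic tail (9235, Markov) and `∫ρ_r = 1`, `∫e_r = Ē` conserved and
tight (`KineticClosureBridge.exists_energy_tail_le`), (iv) bulk: truncate `v_jv_k = v_jv_kφ_L + rest` (rest by the
quadratic tail ≤ cubic/`L`), apply PLE to the finitely many bounded continuous `ψ ∈ {φ_L, v_jφ_L, v_jv_kφ_L}` with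
the bulk weight `h`, and evaluate the Maxwellian side by `MaxwellianMoments` + Gaussian tails beyond `L ≫ U + √Θ`:
`Σ a_jk ρ(θδ_jk + u_ju_k) − Σ a_jk ρ u_j u_k = ρθ tr a = 0`.  Tolerances `(L, M) → (ρ₁, θ₁, Θ, U) → PLE/ECT (η', δ')
→ r₀ → N₀`, all before `r`. -/
theorem stub_stressIsotropyOfLocalEquilibrium :
    (∀ (ρ θ : ℝ) (u : V3), 0 < ρ → 0 < θ →
      let m : Measure V3 := volume.withDensity (fun v => ENNReal.ofReal (localMaxwellian ρ θ u v))
      IsFiniteMeasure m ∧ Integrable (fun v : V3 => ‖v‖ ^ 2) m ∧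
      (m Set.univ).toReal = ρ ∧ (∀ j : Fin 3, ∫ v, v j ∂m = ρ * u j) ∧
      (∀ j k : Fin 3, ∫ v, v j * v k ∂m = ρ * (u j * u k + if j = k then θ else 0)) ∧
      (∫ v, ‖v‖ ^ 2 ∂m = ρ * (‖u‖ ^ 2 + 3 * θ)) ∧
      (∀ ψ : V3 → ℝ, Continuous ψ → (∃ C : ℝ, ∀ v, |ψ v| ≤ C) →
        Integrable ψ m ∧ ∫ v, ψ v ∂m = ρ * ∫ v, ψ v * localMaxwellian 1 θ u v)) →
    (∃ η₀ : ℝ, 0 < η₀ ∧ ∀ (a₀ θ₀ : T3 → ℝ) (u₀ : T3 → V3), Continuous a₀ → Continuous θ₀ → Continuous u₀ →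
      (∀ x, 0 < a₀ x) → (∀ x, 0 < θ₀ x) → ∃ σ₀ : ℝ, 0 < σ₀ ∧ ∀ σ : ℝ, 0 < σ → σ < σ₀ →
      ∀ (T : ℝ) (ρ θ : ℝ → T3 → ℝ) (u : ℝ → T3 → V3), IsHardSphereEulerSolution σ T ρ u θ →
      ∀ Φ : (N : ℕ) → HardSphereFlow (Torus.geometry (Fin 3)) (hsDiameter σ N) (N + 1),
      TendstoHydroFieldsAt (fun N => localGibbsLaw σ a₀ u₀ θ₀ N (Φ N)) Φ ρ u θ 0 →
      ∀ t ∈ Set.Ico 0 T, ∀ ψ : V3 → ℝ, Continuous ψ → (∃ C : ℝ, ∀ v, |ψ v| ≤ C) →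
      ∀ h : ℝ × V3 × ℝ → ℝ, Continuous h → (∃ C : ℝ, ∀ p, |h p| ≤ C) →
      (∃ ρ₁ θ₁ Θ U : ℝ, 0 < ρ₁ ∧ 0 < θ₁ ∧ ∀ p : ℝ × V3 × ℝ,
        (p.1 ≤ ρ₁ ∨ η₀ ≤ σ ^ 3 * p.1 ∨ p.2.2 ≤ θ₁ ∨ Θ ≤ p.2.2 ∨ U ≤ ‖p.2.1‖) → h p = 0) →
      ∀ η δ : ℝ, 0 < η → 0 < δ → ∃ r₀ : ℝ, 0 < r₀ ∧ ∀ r : ℝ, 0 < r → r < r₀ → ∃ N₀ : ℕ, ∀ N : ℕ, N₀ ≤ N →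
      let bx : T3 → T3 → ℝ := fun y x => 3 / (Real.pi * r ^ 3) * max (1 - Torus.euclidDist y x / r) 0
      let ρm : Config (N + 1) (Fin 3) T3 → T3 → ℝ := fun w x₀ => ∫ q, bx q.1 x₀ ∂(empiricalMeasure w)
      let mm : Config (N + 1) (Fin 3) T3 → T3 → V3 := fun w x₀ => ∫ q, bx q.1 x₀ • q.2 ∂(empiricalMeasure w)
      let em : Config (N + 1) (Fin 3) T3 → T3 → ℝ := fun w x₀ =>
        ∫ q, bx q.1 x₀ * (‖q.2‖ ^ 2 / 2) ∂(empiricalMeasure w)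
      let um : Config (N + 1) (Fin 3) T3 → T3 → V3 := fun w x₀ => (ρm w x₀)⁻¹ • mm w x₀
      let θm : Config (N + 1) (Fin 3) T3 → T3 → ℝ := fun w x₀ =>
        2 / 3 * (em w x₀ / ρm w x₀ - ‖mm w x₀‖ ^ 2 / (2 * ρm w x₀ ^ 2))
      let Mψ : Config (N + 1) (Fin 3) T3 → T3 → ℝ := fun w x₀ => ∫ q, bx q.1 x₀ * ψ q.2 ∂(empiricalMeasure w)
      localGibbsLaw σ a₀ u₀ θ₀ N (Φ N)
        {z | η < ∫ s in Set.Icc 0 t, ∫ x,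
          |h (ρm ((Φ N).flow s z) x, um ((Φ N).flow s z) x, θm ((Φ N).flow s z) x)| *
            |Mψ ((Φ N).flow s z) x - ρm ((Φ N).flow s z) x *
              ∫ v, ψ v * localMaxwellian 1 (θm ((Φ N).flow s z) x) (um ((Φ N).flow s z) x) v|} ≤ ENNReal.ofReal δ) →
    TwoClocks.EnergyCurrentTails →
    ∃ η₀ : ℝ, 0 < η₀ ∧ ∀ (a₀ θ₀ : T3 → ℝ) (u₀ : T3 → V3), Continuous a₀ → Continuous θ₀ → Continuous u₀ →
      (∀ x, 0 < a₀ x) → (∀ x, 0 < θ₀ x) → ∃ σ₀ : ℝ, 0 < σ₀ ∧ ∀ σ : ℝ, 0 < σ → σ < σ₀ →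
      ∀ (T : ℝ) (ρ θ : ℝ → T3 → ℝ) (u : ℝ → T3 → V3), IsHardSphereEulerSolution σ T ρ u θ →
      ∀ Φ : (N : ℕ) → HardSphereFlow (Torus.geometry (Fin 3)) (hsDiameter σ N) (N + 1),
      TendstoHydroFieldsAt (fun N => localGibbsLaw σ a₀ u₀ θ₀ N (Φ N)) Φ ρ u θ 0 →
      ∀ t ∈ Set.Ico 0 T, ∀ a : Fin 3 → Fin 3 → ℝ × T3 → ℝ, (∀ j k, Continuous (a j k)) →
      (∀ p, ∑ j : Fin 3, a j j p = 0) →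
      ∀ g : ℝ → ℝ, Continuous g → (∀ b, η₀ ≤ b → g b = 0) →
      ∀ η δ : ℝ, 0 < η → 0 < δ → ∃ r₀ : ℝ, 0 < r₀ ∧ ∀ r : ℝ, 0 < r → r < r₀ → ∃ N₀ : ℕ, ∀ N : ℕ, N₀ ≤ N →
      let bx : T3 → T3 → ℝ := fun y x => 3 / (Real.pi * r ^ 3) * max (1 - Torus.euclidDist y x / r) 0
      let ρm : Config (N + 1) (Fin 3) T3 → T3 → ℝ := fun w x₀ => ∫ q, bx q.1 x₀ ∂(empiricalMeasure w)
      let mm : Config (N + 1) (Fin 3) T3 → T3 → V3 := fun w x₀ => ∫ q, bx q.1 x₀ • q.2 ∂(empiricalMeasure w)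
      let Pm : Config (N + 1) (Fin 3) T3 → T3 → Fin 3 → Fin 3 → ℝ := fun w x₀ j k =>
        (∫ q, bx q.1 x₀ * (q.2 j * q.2 k) ∂(empiricalMeasure w)) - mm w x₀ j * mm w x₀ k / ρm w x₀
      localGibbsLaw σ a₀ u₀ θ₀ N (Φ N)
        {z | η < |∫ s in Set.Icc 0 t, ∫ x, g (σ ^ 3 * ρm ((Φ N).flow s z) x) *
          ∑ j : Fin 3, ∑ k : Fin 3, a j k (s, x) * Pm ((Φ N).flow s z) x j k|} ≤ ENNReal.ofReal δ :=
  Summit.AtomisticToContinuum.HydrodynamicLimit.Theorems.ChaosClosesEulerStressIsotropy.stub_stressIsotropyOfLocalEquilibrium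

/-- STUB `stub_pressureValueOfEnskog` (own, L, provable now, wave 9): **the collisional pressure value from pointwise
Enskog collision statistics and pointwise local equilibrium** — `MaxwellianMoments → PointwiseLocalEquilibrium →
PointwiseEnskogCollisions → TwoClocks.EnergyCurrentTails → LimitCollisionMeasure.CollisionTightness →
CollisionMomentUI → CollisionalPressureValueInBand`, all bodies VERBATIM.  Proof sketch (`NOTES.md` §F3): `η₀ :=
min(PLE's, PEC's)`.  (1) `a` continuous at scale 1 and `∫bt = ∫bx = 1`: the per-collision weight `a(s, xᵢ)` is the
window average `∫∫ a(t₀,x₀) bt(s−t₀) bx(xᵢ,x₀) dt₀dx₀` up to `ω_a(2r)` (time ends: collisions within `r` of `0`/`t`,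
mass `O(r)` of a tight count), so `Kc[F·a(s,xᵢ)] = ∫∫ a·K_r[F] + ω_a(r)·Kc[|F|]`, `Kc[|F|]` tight by 13354;
(2) velocity truncation of the mark `|g·ω|(ω⊗ω : a) = |g·ω| φ_L(v)φ_L(w)(…) + rest`, rest `≤ ‖a‖(|v|+|w|)𝟙_{|v|∨|w|>L}`
paid by `CollisionMomentUI`; (3) PEC with the bounded continuous marks `G_kl = |g·ω| φ_L φ_L ω_k ω_l` and the
weights `h ∈ {bulk, dilute, cold, hot/fast} × g(σ³ρ)` (continuous partition of unity in the state, all vanishing out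
of band because `g` does); (4) the same-time pair functional `B^{G_kl}_r = ∫∫ b_r b_r Θ_{G_kl} dμ_s dμ_s` with
`Θ_{G_kl}(v,w) = φ_L(v)φ_L(w)·(2π/15)(|v−w|²δ_kl + 2(v−w)_k(v−w)_l)` (landed Enskog tensor identity
`ChaosClosesEulerEnskogTensor.stub_enskogTensorIdentity`, `∫(g·ω)₊²ω_kω_l = (2π/15)(|g|²δ + 2g_kg_l)`, and
`|g·ω|((w−v)·ω)₊` integrates like `½(g·ω)²` by `ω ↦ −ω`) is a finite combination of PRODUCTS of single-law moments
`∫ b_r ψ_a dμ_s · ∫ b_r ψ_b dμ_s`, `ψ ∈ {φ_L, v_jφ_L, v_jv_kφ_L, |v|²φ_L}` — so PLE (single law, fixed `ψ`) prices it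
on the bulk: `≈ ρ_r² ∫∫ Θ dM̂ dM̂ = ρ_r²(4π/3)θ_r δ_kl + (L-tails)`; (5) value: `σ³ Y ρ_r² (4π/3) θ_r tr a =
2(hsPressure σ ρ_r θ_r − ρ_rθ_r) tr a` IDENTICALLY (`hsPressure = ρθ(1 + ρσ³ f_ex′(ρσ³))`, `Y = (3/2π)f_ex′`; no
analyticity needed); (6) the non-bulk weights: dilute `B¹ ≤ 2πρ_r(Lρ_r + tail)`, cold `B¹ ≤ πρ_r²√(6θ_r)`
(Cauchy–Schwarz), hot/fast small mass (as in WSI) with `ρ_r ≤ η₀/σ³` in band, and the EOS side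
`|p_hs − ρθ| ≤ C(η₀)σ³ρ_r·ρ_rθ_r`; (7) `t = 0`: no collision at time `0` a.s. (`P ≪` Liouville).  Tolerances as in
WSI, all before `r`. -/
theorem stub_pressureValueOfEnskog :
    (∀ (ρ θ : ℝ) (u : V3), 0 < ρ → 0 < θ →
      let m : Measure V3 := volume.withDensity (fun v => ENNReal.ofReal (localMaxwellian ρ θ u v))
      IsFiniteMeasure m ∧ Integrable (fun v : V3 => ‖v‖ ^ 2) m ∧
      (m Set.univ).toReal = ρ ∧ (∀ j : Fin 3, ∫ v, v j ∂m = ρ * u j) ∧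
      (∀ j k : Fin 3, ∫ v, v j * v k ∂m = ρ * (u j * u k + if j = k then θ else 0)) ∧
      (∫ v, ‖v‖ ^ 2 ∂m = ρ * (‖u‖ ^ 2 + 3 * θ)) ∧
      (∀ ψ : V3 → ℝ, Continuous ψ → (∃ C : ℝ, ∀ v, |ψ v| ≤ C) →
        Integrable ψ m ∧ ∫ v, ψ v ∂m = ρ * ∫ v, ψ v * localMaxwellian 1 θ u v)) →
    (∃ η₀ : ℝ, 0 < η₀ ∧ ∀ (a₀ θ₀ : T3 → ℝ) (u₀ : T3 → V3), Continuous a₀ → Continuous θ₀ → Continuous u₀ →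
      (∀ x, 0 < a₀ x) → (∀ x, 0 < θ₀ x) → ∃ σ₀ : ℝ, 0 < σ₀ ∧ ∀ σ : ℝ, 0 < σ → σ < σ₀ →
      ∀ (T : ℝ) (ρ θ : ℝ → T3 → ℝ) (u : ℝ → T3 → V3), IsHardSphereEulerSolution σ T ρ u θ →
      ∀ Φ : (N : ℕ) → HardSphereFlow (Torus.geometry (Fin 3)) (hsDiameter σ N) (N + 1),
      TendstoHydroFieldsAt (fun N => localGibbsLaw σ a₀ u₀ θ₀ N (Φ N)) Φ ρ u θ 0 →
      ∀ t ∈ Set.Ico 0 T, ∀ ψ : V3 → ℝ, Continuous ψ → (∃ C : ℝ, ∀ v, |ψ v| ≤ C) →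
      ∀ h : ℝ × V3 × ℝ → ℝ, Continuous h → (∃ C : ℝ, ∀ p, |h p| ≤ C) →
      (∃ ρ₁ θ₁ Θ U : ℝ, 0 < ρ₁ ∧ 0 < θ₁ ∧ ∀ p : ℝ × V3 × ℝ,
        (p.1 ≤ ρ₁ ∨ η₀ ≤ σ ^ 3 * p.1 ∨ p.2.2 ≤ θ₁ ∨ Θ ≤ p.2.2 ∨ U ≤ ‖p.2.1‖) → h p = 0) →
      ∀ η δ : ℝ, 0 < η → 0 < δ → ∃ r₀ : ℝ, 0 < r₀ ∧ ∀ r : ℝ, 0 < r → r < r₀ → ∃ N₀ : ℕ, ∀ N : ℕ, N₀ ≤ N →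
      let bx : T3 → T3 → ℝ := fun y x => 3 / (Real.pi * r ^ 3) * max (1 - Torus.euclidDist y x / r) 0
      let ρm : Config (N + 1) (Fin 3) T3 → T3 → ℝ := fun w x₀ => ∫ q, bx q.1 x₀ ∂(empiricalMeasure w)
      let mm : Config (N + 1) (Fin 3) T3 → T3 → V3 := fun w x₀ => ∫ q, bx q.1 x₀ • q.2 ∂(empiricalMeasure w)
      let em : Config (N + 1) (Fin 3) T3 → T3 → ℝ := fun w x₀ =>
        ∫ q, bx q.1 x₀ * (‖q.2‖ ^ 2 / 2) ∂(empiricalMeasure w)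
      let um : Config (N + 1) (Fin 3) T3 → T3 → V3 := fun w x₀ => (ρm w x₀)⁻¹ • mm w x₀
      let θm : Config (N + 1) (Fin 3) T3 → T3 → ℝ := fun w x₀ =>
        2 / 3 * (em w x₀ / ρm w x₀ - ‖mm w x₀‖ ^ 2 / (2 * ρm w x₀ ^ 2))
      let Mψ : Config (N + 1) (Fin 3) T3 → T3 → ℝ := fun w x₀ => ∫ q, bx q.1 x₀ * ψ q.2 ∂(empiricalMeasure w)
      localGibbsLaw σ a₀ u₀ θ₀ N (Φ N)
        {z | η < ∫ s in Set.Icc 0 t, ∫ x,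
          |h (ρm ((Φ N).flow s z) x, um ((Φ N).flow s z) x, θm ((Φ N).flow s z) x)| *
            |Mψ ((Φ N).flow s z) x - ρm ((Φ N).flow s z) x *
              ∫ v, ψ v * localMaxwellian 1 (θm ((Φ N).flow s z) x) (um ((Φ N).flow s z) x) v|} ≤ ENNReal.ofReal δ) →
    (∃ η₀ : ℝ, 0 < η₀ ∧ ∀ (a₀ θ₀ : T3 → ℝ) (u₀ : T3 → V3), Continuous a₀ → Continuous θ₀ → Continuous u₀ →
      (∀ x, 0 < a₀ x) → (∀ x, 0 < θ₀ x) → ∃ σ₀ : ℝ, 0 < σ₀ ∧ ∀ σ : ℝ, 0 < σ → σ < σ₀ →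
      ∀ Φ : (N : ℕ) → HardSphereFlow (Torus.geometry (Fin 3)) (hsDiameter σ N) (N + 1),
      ∀ τ : ℝ, 0 < τ → ∀ G : V3 × V3 × V3 → ℝ, Continuous G → (∃ C : ℝ, ∀ p, |G p| ≤ C) →
      ∀ h : ℝ × V3 × ℝ → ℝ, Continuous h → (∃ C : ℝ, ∀ p, |h p| ≤ C) →
      (∀ p : ℝ × V3 × ℝ, η₀ ≤ σ ^ 3 * p.1 → h p = 0) →
      ∀ η δ : ℝ, 0 < η → 0 < δ → ∃ r₀ : ℝ, 0 < r₀ ∧ ∀ r : ℝ, 0 < r → r < r₀ → ∃ N₀ : ℕ, ∀ N : ℕ, N₀ ≤ N →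
      let ε := hsDiameter σ N
      let Gm : Geometry (Fin 3) T3 := Torus.geometry (Fin 3)
      let γ : Config (N + 1) (Fin 3) T3 → ℝ → Config (N + 1) (Fin 3) T3 := fun z s => (Φ N).flow s z
      let bx : T3 → T3 → ℝ := fun y x => 3 / (Real.pi * r ^ 3) * max (1 - Torus.euclidDist y x / r) 0
      let bt : ℝ → ℝ := fun a => r⁻¹ * max (1 - |a| / r) 0
      let ρm : Config (N + 1) (Fin 3) T3 → T3 → ℝ := fun w x₀ => ∫ q, bx q.1 x₀ ∂(empiricalMeasure w)
      let mm : Config (N + 1) (Fin 3) T3 → T3 → V3 := fun w x₀ => ∫ q, bx q.1 x₀ • q.2 ∂(empiricalMeasure w)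
      let em : Config (N + 1) (Fin 3) T3 → T3 → ℝ := fun w x₀ =>
        ∫ q, bx q.1 x₀ * (‖q.2‖ ^ 2 / 2) ∂(empiricalMeasure w)
      let um : Config (N + 1) (Fin 3) T3 → T3 → V3 := fun w x₀ => (ρm w x₀)⁻¹ • mm w x₀
      let θm : Config (N + 1) (Fin 3) T3 → T3 → ℝ := fun w x₀ =>
        2 / 3 * (em w x₀ / ρm w x₀ - ‖mm w x₀‖ ^ 2 / (2 * ρm w x₀ ^ 2))
      let Hw : Config (N + 1) (Fin 3) T3 → T3 → ℝ := fun w x => h (ρm w x, um w x, θm w x)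
      let Θ : V3 → V3 → ℝ := fun v w =>
        ∫ ω : Metric.sphere (0 : V3) 1, G ((ω : V3), v, w) * hardSphereKernel (w, v) ω ∂sphereMeasure
      let BG : Config (N + 1) (Fin 3) T3 → T3 → ℝ := fun w x₀ =>
        ∫ p, bx p.1.1 x₀ * bx p.2.1 x₀ * Θ p.1.2 p.2.2 ∂((empiricalMeasure w).prod (empiricalMeasure w))
      let pv : Config (N + 1) (Fin 3) T3 → ℝ → Fin (N + 1) → Fin (N + 1) → V3 × V3 := fun z s i j =>
        reflectVel (Gm.sepVec (γ z s i).1 (γ z s j).1) ((γ z s i).2, (γ z s j).2)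
      let Y : ℝ → ℝ := fun a => 3 / (2 * Real.pi) * deriv hsExcessFreeEnergy a
      let Kr : Config (N + 1) (Fin 3) T3 → ℝ → T3 → ℝ := fun z t₀ x₀ =>
        ε / (N + 1 : ℝ) * ∑ᶠ (s : ℝ) (_ : s ∈ collisionTimes Gm ε (γ z) ∩ Set.Icc 0 τ),
          ∑ i : Fin (N + 1), ∑ j : Fin (N + 1),
            (if i ≠ j ∧ ‖Gm.sepVec (γ z s i).1 (γ z s j).1‖ = ε then
              bt (s - t₀) * bx (γ z s i).1 x₀ * Hw (γ z s) (γ z s i).1 *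
                G (ε⁻¹ • Gm.sepVec (γ z s i).1 (γ z s j).1, (pv z s i j).1, (pv z s i j).2) else 0)
      let R : Config (N + 1) (Fin 3) T3 → ℝ → T3 → ℝ := fun z t₀ x₀ =>
        σ ^ 3 * ∫ s in Set.Icc 0 τ, bt (s - t₀) *
          ∫ x, bx x x₀ * (Hw (γ z s) x * Y (σ ^ 3 * ρm (γ z s) x) * BG (γ z s) x)
      localGibbsLaw σ a₀ u₀ θ₀ N (Φ N)
        {z | η < ∫ t₀ in Set.Icc 0 τ, ∫ x₀, |Kr z t₀ x₀ - R z t₀ x₀|} ≤ ENNReal.ofReal δ) →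
    TwoClocks.EnergyCurrentTails → LimitCollisionMeasure.CollisionTightness →
    (∀ (a₀ θ₀ : T3 → ℝ) (u₀ : T3 → V3), Continuous a₀ → Continuous θ₀ → Continuous u₀ →
      (∀ x, 0 < a₀ x) → (∀ x, 0 < θ₀ x) → ∃ σ₀ : ℝ, 0 < σ₀ ∧ ∀ σ : ℝ, 0 < σ → σ < σ₀ →
      ∀ Φ : (N : ℕ) → HardSphereFlow (Torus.geometry (Fin 3)) (hsDiameter σ N) (N + 1),
      ∀ τ : ℝ, 0 < τ → ∀ η δ : ℝ, 0 < η → 0 < δ → ∃ L : ℝ, ∃ N₀ : ℕ, ∀ N : ℕ, N₀ ≤ N →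
      let ε := hsDiameter σ N
      let G : Geometry (Fin 3) T3 := Torus.geometry (Fin 3)
      let γ : Config (N + 1) (Fin 3) T3 → ℝ → Config (N + 1) (Fin 3) T3 := fun z s => (Φ N).flow s z
      let Kc : (Config (N + 1) (Fin 3) T3 → ℝ → Fin (N + 1) → Fin (N + 1) → ℝ) → Config (N + 1) (Fin 3) T3 → ℝ := fun F z =>
        ε / (N + 1 : ℝ) * ∑ᶠ (s : ℝ) (_ : s ∈ collisionTimes G ε (γ z) ∩ Set.Icc 0 τ),
          ∑ i : Fin (N + 1), ∑ j : Fin (N + 1),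
            (if i ≠ j ∧ ‖G.sepVec (γ z s i).1 (γ z s j).1‖ = ε then F z s i j else 0)
      localGibbsLaw σ a₀ u₀ θ₀ N (Φ N)
          {z | η < Kc (fun z s i j => if L < ‖(γ z s i).2‖ ^ 2 + ‖(γ z s j).2‖ ^ 2 then
            1 + ‖(γ z s i).2‖ ^ 2 + ‖(γ z s j).2‖ ^ 2 else 0) z} ≤ ENNReal.ofReal δ) →
    ∃ η₀ : ℝ, 0 < η₀ ∧ ∀ (a₀ θ₀ : T3 → ℝ) (u₀ : T3 → V3), Continuous a₀ → Continuous θ₀ → Continuous u₀ →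
      (∀ x, 0 < a₀ x) → (∀ x, 0 < θ₀ x) → ∃ σ₀ : ℝ, 0 < σ₀ ∧ ∀ σ : ℝ, 0 < σ → σ < σ₀ →
      ∀ (T : ℝ) (ρ θ : ℝ → T3 → ℝ) (u : ℝ → T3 → V3), IsHardSphereEulerSolution σ T ρ u θ →
      ∀ Φ : (N : ℕ) → HardSphereFlow (Torus.geometry (Fin 3)) (hsDiameter σ N) (N + 1),
      TendstoHydroFieldsAt (fun N => localGibbsLaw σ a₀ u₀ θ₀ N (Φ N)) Φ ρ u θ 0 →
      ∀ t ∈ Set.Ico 0 T, ∀ a : Fin 3 → Fin 3 → ℝ × T3 → ℝ, (∀ j k, Continuous (a j k)) →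
      (∀ j k p, a j k p = a k j p) →
      ∀ g : ℝ → ℝ, Continuous g → (∀ b, η₀ ≤ b → g b = 0) →
      ∀ η δ : ℝ, 0 < η → 0 < δ → ∃ r₀ : ℝ, 0 < r₀ ∧ ∀ r : ℝ, 0 < r → r < r₀ → ∃ N₀ : ℕ, ∀ N : ℕ, N₀ ≤ N →
      let ε := hsDiameter σ N
      let G : Geometry (Fin 3) T3 := Torus.geometry (Fin 3)
      let γ : Config (N + 1) (Fin 3) T3 → ℝ → Config (N + 1) (Fin 3) T3 := fun z s => (Φ N).flow s z
      let bx : T3 → T3 → ℝ := fun y x => 3 / (Real.pi * r ^ 3) * max (1 - Torus.euclidDist y x / r) 0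
      let ρm : Config (N + 1) (Fin 3) T3 → T3 → ℝ := fun w x₀ => ∫ q, bx q.1 x₀ ∂(empiricalMeasure w)
      let mm : Config (N + 1) (Fin 3) T3 → T3 → V3 := fun w x₀ => ∫ q, bx q.1 x₀ • q.2 ∂(empiricalMeasure w)
      let em : Config (N + 1) (Fin 3) T3 → T3 → ℝ := fun w x₀ =>
        ∫ q, bx q.1 x₀ * (‖q.2‖ ^ 2 / 2) ∂(empiricalMeasure w)
      let θm : Config (N + 1) (Fin 3) T3 → T3 → ℝ := fun w x₀ =>
        2 / 3 * (em w x₀ / ρm w x₀ - ‖mm w x₀‖ ^ 2 / (2 * ρm w x₀ ^ 2))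
      let pv : Config (N + 1) (Fin 3) T3 → ℝ → Fin (N + 1) → Fin (N + 1) → V3 × V3 := fun z s i j =>
        reflectVel (G.sepVec (γ z s i).1 (γ z s j).1) ((γ z s i).2, (γ z s j).2)
      let Kc : (Config (N + 1) (Fin 3) T3 → ℝ → Fin (N + 1) → Fin (N + 1) → ℝ) → Config (N + 1) (Fin 3) T3 → ℝ := fun F z =>
        ε / (N + 1 : ℝ) * ∑ᶠ (s : ℝ) (_ : s ∈ collisionTimes G ε (γ z) ∩ Set.Icc 0 t),
          ∑ i : Fin (N + 1), ∑ j : Fin (N + 1),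
            (if i ≠ j ∧ ‖G.sepVec (γ z s i).1 (γ z s j).1‖ = ε then F z s i j else 0)
      let D : Config (N + 1) (Fin 3) T3 → ℝ := fun z =>
        Kc (fun z s i j =>
            g (σ ^ 3 * ρm (γ z s) (γ z s i).1) *
              |⟪(pv z s i j).1 - (pv z s i j).2, ε⁻¹ • G.sepVec (γ z s i).1 (γ z s j).1⟫_ℝ| *
              ∑ k : Fin 3, ∑ l : Fin 3, a k l (s, (γ z s i).1) *
                ((ε⁻¹ • G.sepVec (γ z s i).1 (γ z s j).1) k * (ε⁻¹ • G.sepVec (γ z s i).1 (γ z s j).1) l)) z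
          - 2 * ∫ s in Set.Icc 0 t, ∫ x, g (σ ^ 3 * ρm (γ z s) x) *
              (hsPressure σ (ρm (γ z s) x) (θm (γ z s) x) - ρm (γ z s) x * θm (γ z s) x) *
              ∑ k : Fin 3, a k k (s, x)
      localGibbsLaw σ a₀ u₀ θ₀ N (Φ N) {z | η < |D z|} ≤ ENNReal.ofReal δ :=
  Summit.AtomisticToContinuum.HydrodynamicLimit.Theorems.ChaosClosesEulerPressureValue.stub_pressureValueOfEnskog

/-- STUB `stub_quantitativeRigidity` (CLOSED — landed p160547, wave 10, `Theorems.ChaosClosesEulerQuantitativeRigidity`): body VERBATIM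
`LimitCollisionMeasure.BalanceRigidity → WeakLimitToolkit → MaxwellianMoments → BalanceTestFamily → QuantitativeRigidity`. -/
theorem stub_quantitativeRigidity :
    LimitCollisionMeasure.BalanceRigidity →
    (∀ (μs : ℕ → FiniteMeasure V3) (μ : FiniteMeasure V3), Tendsto μs atTop (𝓝 μ) →
      (∀ n, Integrable (fun v : V3 => ‖v‖ ^ 2) (μs n : Measure V3)) →
      (∀ ε : ℝ, 0 < ε → ∃ L : ℝ, ∀ n, ∫ v in {v : V3 | L < ‖v‖}, ‖v‖ ^ 2 ∂(μs n : Measure V3) ≤ ε) →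
      let Bal : (V3 → ℝ) → Measure V3 → ℝ := fun ψ m =>
        ∫ v, ∫ w, ∫ ω : Metric.sphere (0 : V3) 1,
          hardSphereKernel (v, w) ω * (ψ (collide ω (v, w)).1 + ψ (collide ω (v, w)).2 - ψ v - ψ w) ∂sphereMeasure ∂m ∂m
      Integrable (fun v : V3 => ‖v‖ ^ 2) (μ : Measure V3) ∧
      Tendsto (fun n => ((μs n : Measure V3) Set.univ).toReal) atTop (𝓝 ((μ : Measure V3) Set.univ).toReal) ∧
      (∀ j : Fin 3, Tendsto (fun n => ∫ v, v j ∂(μs n : Measure V3)) atTop (𝓝 (∫ v, v j ∂(μ : Measure V3)))) ∧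
      (∀ j k : Fin 3, Tendsto (fun n => ∫ v, v j * v k ∂(μs n : Measure V3)) atTop
        (𝓝 (∫ v, v j * v k ∂(μ : Measure V3)))) ∧
      Tendsto (fun n => ∫ v, ‖v‖ ^ 2 ∂(μs n : Measure V3)) atTop (𝓝 (∫ v, ‖v‖ ^ 2 ∂(μ : Measure V3))) ∧
      (∀ ψ : V3 → ℝ, Continuous ψ → (∃ C : ℝ, ∀ v, |ψ v| ≤ C) →
        Tendsto (fun n => Bal ψ (μs n : Measure V3)) atTop (𝓝 (Bal ψ (μ : Measure V3))))) →
    (∀ (ρ θ : ℝ) (u : V3), 0 < ρ → 0 < θ →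
      let m : Measure V3 := volume.withDensity (fun v => ENNReal.ofReal (localMaxwellian ρ θ u v))
      IsFiniteMeasure m ∧ Integrable (fun v : V3 => ‖v‖ ^ 2) m ∧
      (m Set.univ).toReal = ρ ∧ (∀ j : Fin 3, ∫ v, v j ∂m = ρ * u j) ∧
      (∀ j k : Fin 3, ∫ v, v j * v k ∂m = ρ * (u j * u k + if j = k then θ else 0)) ∧
      (∫ v, ‖v‖ ^ 2 ∂m = ρ * (‖u‖ ^ 2 + 3 * θ)) ∧
      (∀ ψ : V3 → ℝ, Continuous ψ → (∃ C : ℝ, ∀ v, |ψ v| ≤ C) →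
        Integrable ψ m ∧ ∫ v, ψ v ∂m = ρ * ∫ v, ψ v * localMaxwellian 1 θ u v)) →
    (∃ ψs : ℕ → V3 → ℝ, (∀ i, Continuous (ψs i)) ∧ (∀ i v, |ψs i v| ≤ 1) ∧
      let Bal : (V3 → ℝ) → Measure V3 → ℝ := fun ψ m =>
        ∫ v, ∫ w, ∫ ω : Metric.sphere (0 : V3) 1,
          hardSphereKernel (v, w) ω * (ψ (collide ω (v, w)).1 + ψ (collide ω (v, w)).2 - ψ v - ψ w) ∂sphereMeasure ∂m ∂m
      ∀ m : Measure V3, IsFiniteMeasure m → Integrable (fun v : V3 => ‖v‖ ^ 2) m →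
        (∀ i, Bal (ψs i) m = 0) →
        ∀ ψ : V3 → ℝ, Continuous ψ → (∃ C : ℝ, ∀ v, |ψ v| ≤ C) → Bal ψ m = 0) →
    ∃ ψs : ℕ → V3 → ℝ, (∀ i, Continuous (ψs i)) ∧ (∀ i v, |ψs i v| ≤ 1) ∧
      ∀ (Lt : ℕ → ℝ) (ρ₁ ρ₂ θ₁ : ℝ), 0 < ρ₁ → 0 < θ₁ →
      ∀ ψ : V3 → ℝ, Continuous ψ → (∃ C : ℝ, ∀ v, |ψ v| ≤ C) →
      ∀ ε : ℝ, 0 < ε → ∃ n : ℕ, ∀ m : Measure V3, IsFiniteMeasure m →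
      Integrable (fun v : V3 => ‖v‖ ^ 2) m →
      ρ₁ ≤ (m Set.univ).toReal → (m Set.univ).toReal ≤ ρ₂ →
      (∀ j : ℕ, j ≤ n → ∫ v in {v : V3 | Lt j < ‖v‖}, ‖v‖ ^ 2 ∂m ≤ 1 / ((j : ℝ) + 1)) →
      let Bal : (V3 → ℝ) → Measure V3 → ℝ := fun ψ m =>
        ∫ v, ∫ w, ∫ ω : Metric.sphere (0 : V3) 1,
          hardSphereKernel (v, w) ω * (ψ (collide ω (v, w)).1 + ψ (collide ω (v, w)).2 - ψ v - ψ w) ∂sphereMeasure ∂m ∂m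
      let ρm : ℝ := (m Set.univ).toReal
      let um : V3 := ρm⁻¹ • ∫ v, v ∂m
      let θm : ℝ := 2 / 3 * ((∫ v, ‖v‖ ^ 2 / 2 ∂m) / ρm - ‖∫ v, v ∂m‖ ^ 2 / (2 * ρm ^ 2))
      θ₁ ≤ θm → (∀ i : ℕ, i < n → |Bal (ψs i) m| ≤ 1 / ((n : ℝ) + 1)) →
      |(∫ v, ψ v ∂m) - ρm * ∫ v, ψ v * localMaxwellian 1 θm um v| ≤ ε :=
  Summit.AtomisticToContinuum.HydrodynamicLimit.Theorems.ChaosClosesEulerQuantitativeRigidity.stub_quantitativeRigidity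

/-- STUB `stub_energyDistance` (CLOSED — landed p160436, wave 10, `Theorems.ChaosClosesEulerEnergyDistance`): body VERBATIM `EnergyDistance`. -/
theorem stub_energyDistance :
    (∀ μ ν : Measure V3, IsFiniteMeasure μ → IsFiniteMeasure ν →
      Integrable (fun v : V3 => ‖v‖) μ → Integrable (fun v : V3 => ‖v‖) ν → μ Set.univ = ν Set.univ →
      (∫ v, ∫ w, ‖v - w‖ ∂μ ∂μ) + (∫ v, ∫ w, ‖v - w‖ ∂ν ∂ν) ≤ 2 * ∫ v, ∫ w, ‖v - w‖ ∂ν ∂μ) ∧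
    (∀ (Lt : ℕ → ℝ) (ρ₁ ρ₂ : ℝ), 0 < ρ₁ →
      ∀ ψ : V3 → ℝ, Continuous ψ → (∃ C : ℝ, ∀ v, |ψ v| ≤ C) →
      ∀ ε : ℝ, 0 < ε → ∃ n : ℕ, ∃ δ : ℝ, 0 < δ ∧ ∀ μ ν : Measure V3, IsFiniteMeasure μ → IsFiniteMeasure ν →
      Integrable (fun v : V3 => ‖v‖ ^ 2) μ → Integrable (fun v : V3 => ‖v‖ ^ 2) ν →
      μ Set.univ = ν Set.univ → ρ₁ ≤ (μ Set.univ).toReal → (μ Set.univ).toReal ≤ ρ₂ →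
      (∀ j : ℕ, j ≤ n → (∫ v in {v : V3 | Lt j < ‖v‖}, ‖v‖ ^ 2 ∂μ ≤ 1 / ((j : ℝ) + 1)) ∧
        (∫ v in {v : V3 | Lt j < ‖v‖}, ‖v‖ ^ 2 ∂ν ≤ 1 / ((j : ℝ) + 1))) →
      2 * (∫ v, ∫ w, ‖v - w‖ ∂ν ∂μ) - (∫ v, ∫ w, ‖v - w‖ ∂μ ∂μ) - (∫ v, ∫ w, ‖v - w‖ ∂ν ∂ν) ≤ δ →
      |(∫ v, ψ v ∂μ) - ∫ v, ψ v ∂ν| ≤ ε) :=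
  Summit.AtomisticToContinuum.HydrodynamicLimit.Theorems.ChaosClosesEulerEnergyDistance.stub_energyDistance

/-- STUB `stub_localEquilibrium` (v15: THE OBJECT TO PROMOTE — `PointwiseLocalEquilibrium` BARE, = the crux-strategist's child
`KineticLocalEquilibrium` of `Cruxes/ChaosClosesEuler/SPLIT-REQUEST.md`, a PRIMITIVE kinetic input of Boltzmann-hypothesis class).
History: v11 typed it as the rigidity route (pointwise two-time chaos + 13355 + tools ⇒ PLE), v13 split off and LANDED its two
deterministic cores (`stub_quantitativeRigidity` p160547, `stub_energyDistance` p160436); `NOTES.md` §G2 (R3, diagonal blindness: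
a train of mono-kinetic clouds with Maxwellian window-average passes every windowed collision functional and violates PLE) shows the
antecedents cannot supply it, so v15 states it bare: nothing inside this line derives it; the planner files it as an item and the
landed dock consumes it. -/
theorem stub_localEquilibrium : PointwiseLocalEquilibrium := by
  sorry

/-! ## §2b CLOSED stubs (landed, cycles 1–4) — kept as theorems pointing at the tree -/

/-- CLOSED (landed p110597, wave 4, `Theorems.ChaosClosesEulerCollisionMomentUI.stub_collisionMomentUI`): uniform integrability
of the quadratic collision mark FROM quartic tightness — `LimitCollisionMeasure.CollisionTightness →` body VERBATIM `CollisionMomentUI`.  Chebyshev inside the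
collision sum: on `{L < |vᵢ|² + |vⱼ|²}`, `1 + |vᵢ|² + |vⱼ|² ≤ (1 + |vᵢ|² + |vⱼ|²)²/(1+L) ≤ 3(1 + |vᵢ|⁴ + |vⱼ|⁴)/(1+L)`,
so `K_N[(1+v²+w²)1_{>L}] ≤ 3/(1+L) · (ε/(N+1))∫(1+|v|⁴+|v_*|⁴)(1 + 1/(π|v−v_*|))dκ` (the finsum is the integral
against `empiricalCollisionMeasure (Icc 0 τ)` by `HardSphereFlow.integral_empiricalCollisionMeasure_eq_finsum_ite`;
the marks are pre-collisional velocities, and `|vᵢ⁻|²+|vⱼ⁻|² = |vᵢ|²+|vⱼ|²`, `|v⁻|⁴` vs `|v|⁴` needs only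
`|vᵢ⁻|⁴ + |vⱼ⁻|⁴ ≥ (|vᵢ|²+|vⱼ|²)²/2`-type energy conservation of the pair); given `δ`, take `Kb` from 13354 and
`L := 3Kb/η`. -/
theorem stub_collisionMomentUI :
    LimitCollisionMeasure.CollisionTightness →
    ∀ (a₀ θ₀ : T3 → ℝ) (u₀ : T3 → V3), Continuous a₀ → Continuous θ₀ → Continuous u₀ →
    (∀ x, 0 < a₀ x) → (∀ x, 0 < θ₀ x) → ∃ σ₀ : ℝ, 0 < σ₀ ∧ ∀ σ : ℝ, 0 < σ → σ < σ₀ →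
    ∀ Φ : (N : ℕ) → HardSphereFlow (Torus.geometry (Fin 3)) (hsDiameter σ N) (N + 1),
    ∀ τ : ℝ, 0 < τ → ∀ η δ : ℝ, 0 < η → 0 < δ → ∃ L : ℝ, ∃ N₀ : ℕ, ∀ N : ℕ, N₀ ≤ N →
    let ε := hsDiameter σ N
    let G : Geometry (Fin 3) T3 := Torus.geometry (Fin 3)
    let γ : Config (N + 1) (Fin 3) T3 → ℝ → Config (N + 1) (Fin 3) T3 := fun z s => (Φ N).flow s z
    let Kc : (Config (N + 1) (Fin 3) T3 → ℝ → Fin (N + 1) → Fin (N + 1) → ℝ) → Config (N + 1) (Fin 3) T3 → ℝ := fun F z =>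
      ε / (N + 1 : ℝ) * ∑ᶠ (s : ℝ) (_ : s ∈ collisionTimes G ε (γ z) ∩ Set.Icc 0 τ),
        ∑ i : Fin (N + 1), ∑ j : Fin (N + 1),
          (if i ≠ j ∧ ‖G.sepVec (γ z s i).1 (γ z s j).1‖ = ε then F z s i j else 0)
    localGibbsLaw σ a₀ u₀ θ₀ N (Φ N)
        {z | η < Kc (fun z s i j => if L < ‖(γ z s i).2‖ ^ 2 + ‖(γ z s j).2‖ ^ 2 then
          1 + ‖(γ z s i).2‖ ^ 2 + ‖(γ z s j).2‖ ^ 2 else 0) z} ≤ ENNReal.ofReal δ :=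
  Summit.AtomisticToContinuum.HydrodynamicLimit.Theorems.ChaosClosesEulerCollisionMomentUI.stub_collisionMomentUI

/-- CLOSED (landed p98069, `Theorems.ChaosClosesEulerCollisionInvariance.stub_collisionInvariance`): Bogolyubov's
collision invariance of `K_N` — body VERBATIM `CollisionInvariance`. -/
theorem stub_collisionInvariance :
    ∀ (σ : ℝ), 0 < σ → σ < 2⁻¹ → ∀ (N : ℕ)
    (Φ : HardSphereFlow (Torus.geometry (Fin 3)) (hsDiameter σ N) (N + 1)),
    ∀ z ∈ Φ.good, ∀ τ : ℝ, 0 < τ →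
    ∀ (χ : ℝ × T3 → ℝ) (Cχ Lχ : ℝ), 0 ≤ Cχ → 0 ≤ Lχ → (∀ p, |χ p| ≤ Cχ) →
      (∀ (s s' : ℝ) (x x' : T3), |χ (s, x) - χ (s', x')| ≤ Lχ * (|s - s'| + Torus.euclidDist x x')) →
    ∀ (ψ : V3 → ℝ) (Cψ : ℝ), 0 ≤ Cψ → (∀ v, |ψ v| ≤ Cψ) →
    let ε := hsDiameter σ N
    let G : Geometry (Fin 3) T3 := Torus.geometry (Fin 3)
    let γ : ℝ → Config (N + 1) (Fin 3) T3 := fun s => Φ.flow s z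
    let pv : ℝ → Fin (N + 1) → Fin (N + 1) → V3 × V3 := fun s i j =>
      reflectVel (G.sepVec (γ s i).1 (γ s j).1) ((γ s i).2, (γ s j).2)
    |ε / (N + 1 : ℝ) * ∑ᶠ (s : ℝ) (_ : s ∈ collisionTimes G ε γ ∩ Set.Icc 0 τ),
        ∑ i : Fin (N + 1), ∑ j : Fin (N + 1),
          (if i ≠ j ∧ ‖G.sepVec (γ s i).1 (γ s j).1‖ = ε then
            χ (s, (γ s i).1) * (ψ (γ s i).2 - ψ (pv s i j).1) else 0)|
      ≤ ε * Cψ * (2 * Cχ + Lχ * τ * (3 / 2 + configEnergy z / (N + 1 : ℝ))) :=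
  Summit.AtomisticToContinuum.HydrodynamicLimit.Theorems.ChaosClosesEulerCollisionInvariance.stub_collisionInvariance

/-- CLOSED (landed p108039, wave 3, `Theorems.ChaosClosesEulerWeakEquation.stub_weakEquation`): Bogolyubov's exact
weak equation for the cone-mollified `ψ`-moments along one good orbit — body VERBATIM `EmpiricalWeakEquation`.  Template: the landed `ChaosClosesEulerMassBalance` (free
stretches, `hasDerivAt_integral_freeFlight`, `ftc_free`) + `ChaosClosesEulerCollisionInvariance.pairSum_eq_particleSum`
(the jump at a collision time is carried by the two ordered pairs) + `IsHardSphereTrajectory.nthCollisionTime_enum` /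
`leftLim_eq_freeFlight` (enumeration of the collision times of `(0, t]`, pre-collisional values as left limits). -/
theorem stub_weakEquation :
    ∀ (σ : ℝ), 0 < σ → σ < 2⁻¹ → ∀ (N : ℕ)
    (Φ : HardSphereFlow (Torus.geometry (Fin 3)) (hsDiameter σ N) (N + 1)),
    ∀ z ∈ Φ.good, ∀ r : ℝ, 0 < r →
    ∀ φ : ℝ → T3 → ℝ, Literature.Analysis.FunctionSpaces.Torus.IsSmoothSpaceTimeOn Set.univ φ →
    ∀ ψ : V3 → ℝ, ∀ t : ℝ, 0 ≤ t →
    let ε := hsDiameter σ N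
    let G : Geometry (Fin 3) T3 := Torus.geometry (Fin 3)
    let γ : ℝ → Config (N + 1) (Fin 3) T3 := fun s => Φ.flow s z
    let pv : ℝ → Fin (N + 1) → Fin (N + 1) → V3 × V3 := fun s i j =>
      reflectVel (G.sepVec (γ s i).1 (γ s j).1) ((γ s i).2, (γ s j).2)
    let bx : T3 → T3 → ℝ := fun y x => 3 / (Real.pi * r ^ 3) * max (1 - Torus.euclidDist y x / r) 0
    let Mψ : Config (N + 1) (Fin 3) T3 → T3 → ℝ := fun w x₀ => ∫ q, bx q.1 x₀ * ψ q.2 ∂(empiricalMeasure w)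
    let Jψ : Config (N + 1) (Fin 3) T3 → T3 → Fin 3 → ℝ := fun w x₀ k =>
      ∫ q, bx q.1 x₀ * (q.2 k * ψ q.2) ∂(empiricalMeasure w)
    (∫ x, φ t x * Mψ (γ t) x) - ∫ x, φ 0 x * Mψ (γ 0) x =
      (∫ s in Set.Icc 0 t, ∫ x, (deriv (fun s' => φ s' x) s * Mψ (γ s) x
        + ∑ k : Fin 3, Jψ (γ s) x k * Literature.Analysis.FunctionSpaces.Torus.partialDeriv k (φ s) x))
      + (N + 1 : ℝ)⁻¹ * ∑ᶠ (s : ℝ) (_ : s ∈ collisionTimes G ε γ ∩ Set.Ioc 0 t),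
          ∑ i : Fin (N + 1), ∑ j : Fin (N + 1),
            (if i ≠ j ∧ ‖G.sepVec (γ s i).1 (γ s j).1‖ = ε then
              (∫ x, φ s x * bx (γ s i).1 x) * (ψ (γ s i).2 - ψ (pv s i j).1) else 0) :=
  Summit.AtomisticToContinuum.HydrodynamicLimit.Theorems.ChaosClosesEulerWeakEquation.stub_weakEquation

/-- CLOSED (landed p107599, wave 3; shared support stmt-13356 VERBATIM, `LimitCollisionMeasure.EmpiricalEnskogIdentity`, provable now,
M–L): Bogolyubov's microscopic Enskog equation along one trajectory in the LIBRARY vocabulary — product tests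
`a(t) b(x) c(v)` (`a ∈ C¹`, `b` smooth, `c` continuous), collision term as an integral against
`HardSphereFlow.empiricalCollisionMeasure (Set.Ioc 0 τ)` with pre-collisional marks.  This is the form the kinetic
half consumes next to 13350's windowed collision functionals (`HardSphereFlow.integral_empiricalCollisionMeasure_eq_finsum_ite`
converts between the two vocabularies, as in the landed `ChaosClosesEulerWindowedInvariance`). -/
theorem stub_empiricalEnskogIdentity : LimitCollisionMeasure.EmpiricalEnskogIdentity :=
  Summit.AtomisticToContinuum.HydrodynamicLimit.Theorems.ChaosClosesEulerEnskogIdentity.stub_empiricalEnskogIdentity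

/-- CLOSED (landed p102261, `Theorems.ChaosClosesEulerWindowedInvariance.stub_windowedCollisionInvariance`): windowed
collision invariance in the empirical-collision-measure vocabulary — body VERBATIM `WindowedCollisionInvariance`. -/
theorem stub_windowedCollisionInvariance :
    ∀ (σ : ℝ), 0 < σ → σ < 2⁻¹ → ∀ (N : ℕ)
    (Φ : HardSphereFlow (Torus.geometry (Fin 3)) (hsDiameter σ N) (N + 1)),
    ∀ z ∈ Φ.good, ∀ τ : ℝ, 0 < τ → ∀ r : ℝ, 0 < r → ∀ (t₀ : ℝ) (x₀ : T3),
    ∀ (ψ : V3 → ℝ) (Cψ : ℝ), 0 ≤ Cψ → (∀ v, |ψ v| ≤ Cψ) →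
    let ε := hsDiameter σ N
    let bx : T3 → T3 → ℝ := fun x y => 3 / (Real.pi * r ^ 3) * max (1 - Torus.euclidDist x y / r) 0
    let bt : ℝ → ℝ := fun a => r⁻¹ * max (1 - |a| / r) 0
    |ε / (N + 1 : ℝ) * ∫ m, bt (m.1 - t₀) * bx m.2.1 x₀ *
        (ψ (reflectVel m.2.2.1 (m.2.2.2.1, m.2.2.2.2)).1 - ψ m.2.2.2.1)
        ∂(Φ.empiricalCollisionMeasure (Set.Icc 0 τ) z)|
      ≤ ε * Cψ * (6 / (Real.pi * r ^ 4) + 3 / (Real.pi * r ^ 5) * τ * (3 / 2 + configEnergy z / (N + 1 : ℝ))) :=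
  Summit.AtomisticToContinuum.HydrodynamicLimit.Theorems.ChaosClosesEulerWindowedInvariance.stub_windowedCollisionInvariance

/-- CLOSED (landed p98482, `Theorems.ChaosClosesEulerMassBalance.stub_massBalance`): exact pathwise mass balance —
body VERBATIM `MassBalance`. -/
theorem stub_massBalance :
    ∀ (σ : ℝ), 0 < σ → σ < 2⁻¹ → ∀ (N : ℕ)
    (Φ : HardSphereFlow (Torus.geometry (Fin 3)) (hsDiameter σ N) (N + 1)),
    ∀ z ∈ Φ.good, ∀ r : ℝ, 0 < r → r < 2⁻¹ →
    ∀ φ : ℝ → T3 → ℝ, Literature.Analysis.FunctionSpaces.Torus.IsSmoothSpaceTimeOn Set.univ φ →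
    ∀ t : ℝ, 0 ≤ t →
    let bx : T3 → T3 → ℝ := fun y x => 3 / (Real.pi * r ^ 3) * max (1 - Torus.euclidDist y x / r) 0
    let ρm : Config (N + 1) (Fin 3) T3 → T3 → ℝ := fun w x₀ => ∫ q, bx q.1 x₀ ∂(empiricalMeasure w)
    let mm : Config (N + 1) (Fin 3) T3 → T3 → V3 := fun w x₀ => ∫ q, bx q.1 x₀ • q.2 ∂(empiricalMeasure w)
    (∫ x, φ t x * ρm (Φ.flow t z) x) - ∫ x, φ 0 x * ρm (Φ.flow 0 z) x =
      ∫ s in Set.Icc 0 t, ∫ x, (deriv (fun s' => φ s' x) s * ρm (Φ.flow s z) x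
        + ∑ k : Fin 3, mm (Φ.flow s z) x k * Literature.Analysis.FunctionSpaces.Torus.partialDeriv k (φ s) x) :=
  Summit.AtomisticToContinuum.HydrodynamicLimit.Theorems.ChaosClosesEulerMassBalance.stub_massBalance

/-- CLOSED (landed p133127, wave 8, `Theorems.ChaosClosesEulerMassBalanceC1.stub_massBalanceC1`): exact pathwise mass
balance for `C¹` space–time tests — body VERBATIM `MassBalanceC1` (the landed `ChaosClosesEulerMassBalance` proof with
`ContDiff ℝ 1 (Torus.stLift φ)` in place of `IsSmoothSpaceTimeOn univ φ`). -/
theorem stub_massBalanceC1 :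
    ∀ (σ : ℝ), 0 < σ → σ < 2⁻¹ → ∀ (N : ℕ)
    (Φ : HardSphereFlow (Torus.geometry (Fin 3)) (hsDiameter σ N) (N + 1)),
    ∀ z ∈ Φ.good, ∀ r : ℝ, 0 < r → r < 2⁻¹ →
    ∀ φ : ℝ → T3 → ℝ, ContDiff ℝ 1 (Literature.Analysis.FunctionSpaces.Torus.stLift φ) →
    ∀ t : ℝ, 0 ≤ t →
    let bx : T3 → T3 → ℝ := fun y x => 3 / (Real.pi * r ^ 3) * max (1 - Torus.euclidDist y x / r) 0
    let ρm : Config (N + 1) (Fin 3) T3 → T3 → ℝ := fun w x₀ => ∫ q, bx q.1 x₀ ∂(empiricalMeasure w)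
    let mm : Config (N + 1) (Fin 3) T3 → T3 → V3 := fun w x₀ => ∫ q, bx q.1 x₀ • q.2 ∂(empiricalMeasure w)
    (∫ x, φ t x * ρm (Φ.flow t z) x) - ∫ x, φ 0 x * ρm (Φ.flow 0 z) x =
      ∫ s in Set.Icc 0 t, ∫ x, (deriv (fun s' => φ s' x) s * ρm (Φ.flow s z) x
        + ∑ k : Fin 3, mm (Φ.flow s z) x k * Literature.Analysis.FunctionSpaces.Torus.partialDeriv k (φ s) x) :=
  Summit.AtomisticToContinuum.HydrodynamicLimit.Theorems.ChaosClosesEulerMassBalanceC1.stub_massBalanceC1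

/-- CLOSED (landed p97752, `Theorems.ChaosClosesEulerInitialLayer.stub_initialLayer`): the `t = 0` layer — body
VERBATIM `InitialLayer`. -/
theorem stub_initialLayer :
    ∀ (a₀ θ₀ : T3 → ℝ) (u₀ : T3 → V3), Continuous a₀ → Continuous θ₀ → Continuous u₀ →
    (∀ x, 0 < a₀ x) → (∀ x, 0 < θ₀ x) → ∃ σ₀ : ℝ, 0 < σ₀ ∧ ∀ σ : ℝ, 0 < σ → σ < σ₀ →
    ∀ (T : ℝ) (ρ θ : ℝ → T3 → ℝ) (u : ℝ → T3 → V3), IsHardSphereEulerSolution σ T ρ u θ → 0 < T →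
    ∀ Φ : (N : ℕ) → HardSphereFlow (Torus.geometry (Fin 3)) (hsDiameter σ N) (N + 1),
    TendstoHydroFieldsAt (fun N => localGibbsLaw σ a₀ u₀ θ₀ N (Φ N)) Φ ρ u θ 0 →
    ∀ η δ : ℝ, 0 < η → 0 < δ → ∃ r₀ : ℝ, 0 < r₀ ∧ ∀ r : ℝ, 0 < r → r < r₀ → ∃ N₀ : ℕ, ∀ N : ℕ, N₀ ≤ N →
    let bx : T3 → T3 → ℝ := fun y x => 3 / (Real.pi * r ^ 3) * max (1 - Torus.euclidDist y x / r) 0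
    localGibbsLaw σ a₀ u₀ θ₀ N (Φ N)
        {z | ∃ x, η < |empiricalDensityField ((Φ N).flow 0 z) (fun y => bx y x) - ρ 0 x|} ≤ ENNReal.ofReal δ ∧
    localGibbsLaw σ a₀ u₀ θ₀ N (Φ N)
        {z | ∃ x, η < ‖empiricalMomentumField ((Φ N).flow 0 z) (fun y => bx y x) - ρ 0 x • u 0 x‖} ≤
          ENNReal.ofReal δ ∧
    localGibbsLaw σ a₀ u₀ θ₀ N (Φ N)
        {z | ∃ x, η < |empiricalEnergyField ((Φ N).flow 0 z) (fun y => bx y x) -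
          totalEnergyDensity (ρ 0 x) (u 0 x) (θ 0 x)|} ≤ ENNReal.ofReal δ :=
  Summit.AtomisticToContinuum.HydrodynamicLimit.Theorems.ChaosClosesEulerInitialLayer.stub_initialLayer

/-- CLOSED (landed as `Theorems.ChaosClosesEulerBF18Shell.stub_bf18Shell`, lead c3, cycle 4, with 20 helper files: ShellMaster,
ShellWeights, ShellFar, ShellMonatomic, ShellL1, ShellInitial, ShellWindow, ShellPointwise (cycle 2–3); ShellTime, ShellSlice,
ShellRHS, ShellInit, ShellL1Int, ShellMeas, ShellData, ShellWin, ShellParam, ShellField/B/C, ShellGlue, ShellCoreA/B/C (cycle 4)):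
THE DETERMINISTIC CORE — body VERBATIM `BF18ShellHS`.  Template: the tree's PROVED Young-measure form `Literature…MVWeakStrongUniquenessProofs.weakStrong_core` with its engines
`MVRelativeEnergyMaster.master_pointwise_inequality` (clamp `Z = clamp a b`), `MVRelativeEnergyPointwise.rawRHS_add_div_eq`,
`BallisticFreeEnergyCoercivity.relEnergyThermo_coercivity_near_far` / `density_le_of_relEnergyThermo` /
`energy_entropy_le_of_relEnergyThermo`, `ClassicalEulerPointData.*`, the EOS hypotheses from
`JParityClosureParityInBandEos.monatomicExcess_bf_hypotheses` and the solution bridge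
`JParityClosureParityInBandBridge.isClassicalEulerSolution_of_isHardSphereEulerSolution_of_eqOn`; the Young measure is
the Dirac mass at `V(s,x)`, exact laws become laws with defect `δ`, the entropy input and the conclusion are
window-averaged (discrete Grönwall on `I(τ) = ∫₀^τ ℰ`).  v8: (H1) over `C¹` tests (see `BF18ShellHS`). -/
theorem stub_bf18Shell :
    ∀ (σ : ℝ), 0 < σ → ∀ (η₁ : ℝ), 0 < η₁ → ∀ (χe f : ℝ → ℝ),
      ContDiffOn ℝ 2 χe (Set.Ioi 0) → ContDiffOn ℝ 2 f (Set.Ioi 0) →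
      (∀ a, 0 < a → χe a = 1 + a * deriv f a) → (∀ a, 0 < a → 0 < χe a + a * deriv χe a) →
      (∃ B : ℝ, ∀ a, 0 < a → |χe a| ≤ B) →
      (∀ a, 0 < a → a * σ ^ 3 ≤ η₁ → f a = hsExcessFreeEnergy (a * σ ^ 3) ∧ χe a = hsCompressibility (a * σ ^ 3)) →
      ∀ (T : ℝ) (ρ θ : ℝ → T3 → ℝ) (u : ℝ → T3 → V3), IsHardSphereEulerSolution σ T ρ u θ →
      (∀ s ∈ Set.Ico 0 T, ∀ x, ρ s x * σ ^ 3 ≤ η₁ / 2) →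
      ∀ t ∈ Set.Ioo 0 T, ∃ a b : ℝ, a < b ∧ ∀ ε : ℝ, 0 < ε → ∃ Δ₀ : ℝ, 0 < Δ₀ ∧ ∀ Δ : ℝ, 0 < Δ → Δ ≤ Δ₀ → Δ < t →
      ∃ δ : ℝ, 0 < δ ∧ ∀ V : ℝ → T3 → ℝ × V3 × ℝ, Measurable (Function.uncurry V) →
      (∃ C : ℝ, ∀ s x, |(V s x).1| ≤ C ∧ ‖(V s x).2.1‖ ≤ C ∧ |(V s x).2.2| ≤ C) →
      (∀ s x, 0 ≤ (V s x).1) → (∀ s x, 0 ≤ (V s x).2.2) →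
      (∀ s x, ‖(V s x).2.1‖ ^ 2 ≤ 2 * (V s x).1 * (V s x).2.2) →
      let θo : ℝ × V3 × ℝ → ℝ := fun U => 2 / 3 * (U.2.2 / U.1 - ‖U.2.1‖ ^ 2 / (2 * U.1 ^ 2))
      let pV : ℝ × V3 × ℝ → ℝ := fun U => U.1 * θo U * χe U.1
      let Zs : ℝ × V3 × ℝ → ℝ := fun U => if 0 < θo U then max a (min (3 / 2 * Real.log (θo U) - Real.log U.1 - f U.1) b) else a
      let Etot : ℝ → T3 → ℝ := fun s x => totalEnergyDensity (ρ s x) (u s x) (θ s x)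
      let cut : ℝ → ℝ → ℝ := fun τ₀ s => Real.smoothTransition ((τ₀ + Δ - s) / Δ)
      (∀ φ : ℝ → T3 → ℝ, ContDiff ℝ 1 (Literature.Analysis.FunctionSpaces.Torus.stLift φ) → ∀ τ ∈ Set.Icc 0 t, (∫ x, φ τ x * (V τ x).1) - ∫ x, φ 0 x * (V 0 x).1 = ∫ s in Set.Icc 0 τ, ∫ x, (deriv (fun s' => φ s' x) s * (V s x).1 + ∑ k : Fin 3, (V s x).2.1 k * Literature.Analysis.FunctionSpaces.Torus.partialDeriv k (φ s) x)) →
      (∀ τ ∈ Set.Icc 0 t, |(∫ x, ⟪u τ x, (V τ x).2.1⟫_ℝ) - (∫ x, ⟪u 0 x, (V 0 x).2.1⟫_ℝ) - ∫ s in Set.Icc 0 τ, ∫ x, (⟪Literature.Analysis.FunctionSpaces.Torus.timeDerivWithin (Set.Ico 0 T) u s x, (V s x).2.1⟫_ℝ + ∑ i : Fin 3, ∑ j : Fin 3, Literature.Analysis.FunctionSpaces.Torus.partialDeriv j (fun y => u s y i) x * ((V s x).2.1 i * (V s x).2.1 j / (V s x).1 + if i = j then pV (V s x) else 0))| ≤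 δ) →
      (∀ τ₀ ∈ Set.Icc 0 (t - Δ), (∫ s in Set.Icc 0 t, ∫ x, ((V s x).1 * Zs (V s x) * Literature.Analysis.FunctionSpaces.Torus.timeDerivWithin (Set.Ico 0 T) (fun s' y => θ s' y * cut τ₀ s') s x + Zs (V s x) * ⟪(V s x).2.1, Literature.Analysis.FunctionSpaces.Torus.gradient (fun y => θ s y * cut τ₀ s) x⟫_ℝ)) + ∫ x, (V 0 x).1 * Zs (V 0 x) * (θ 0 x * cut τ₀ 0) ≤ δ) →
      (∀ τ ∈ Set.Icc 0 t, ∫ x, (V τ x).2.2 ≤ (∫ x, (V 0 x).2.2) + δ) →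
      (∀ x, |(V 0 x).1 - ρ 0 x| ≤ δ ∧ ‖(V 0 x).2.1 - ρ 0 x • u 0 x‖ ≤ δ ∧ |(V 0 x).2.2 - Etot 0 x| ≤ δ) →
      ∀ τ₀ ∈ Set.Icc 0 (t - Δ), ∫ s in Set.Icc τ₀ (τ₀ + Δ), ∫ x, (|(V s x).1 - ρ s x| + ‖(V s x).2.1 - ρ s x • u s x‖ + |(V s x).2.2 - Etot s x|) ≤ ε * Δ :=
  Summit.AtomisticToContinuum.HydrodynamicLimit.Theorems.ChaosClosesEulerBF18Shell.stub_bf18Shell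

/-- CLOSED (landed p138091, lead c3 cycle 4, `Theorems.ChaosClosesEulerKineticReduction.stub_kineticReduction`, over the
reduction pyramid …ChaosClosesEulerReduction* (cycles 2–4: Pathwise/B/C, FrameA/B/D/E, Classical, Eos, Events, ShellInputs, …,
KineticReductionBudget/Data)): THE KINETIC REDUCTION (replaces v4's `stub_relativeEnergyGronwall` given the shell).  On the intersection of finitely many good events the cone-mollified empirical fields `V_N = (ρ_r, m_r, e_r)`
of one trajectory satisfy the five inputs of `BF18ShellHS` with defect `δ`: (H1) = `MassBalance` (exact, landed);
(H2) from `EmpiricalWeakEquation` with `ψ = vₖ` and the time-SHIFTED univ-smooth tests `ũ(s+ε′,x)ζ₁(s)ζ₂(s)` (error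
`O(ε′)`), the kinetic flux split `P_r = m_r⊗m_r/ρ_r + Π_r`, `tr Π_r = 3ρ_rθ_r` IDENTICALLY, the deviator of `Π_r`
against the traceless part of `∇ũ` by `WeakStressIsotropyInBand`, the jump term `((ũ*b_r)(xᵢ) − (ũ*b_r)(xⱼ))·Δvᵢ`
expanded to first order in `ε` (remainder `(ε/r)·K[|Δv|] → 0` at fixed `r`) and matched with
`CollisionalPressureValueInBand` (`a := sym ∇ũ`, `∇ũ*b_r → ∇ũ` uniformly as `r → 0`), the cut-offs `g(σ³ρ_r)`
inactive on the `DensityCap` event under the guard, the `sup` over `τ` from a finite grid plus the pathwise modulus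
(transport Lipschitz in `τ` by energy, collisions by the windowed functional `≤ (1+L)K[bump·g] + tail`:
`CollisionMomentUI`, `CollisionRate` with FIXED bumps); (H3) from `LimitCollisionMeasure.LocalSecondLaw` (13352) with
`η₁ :=` the shell's, clamp levels `a, b` from the shell, tests `θ̃(s+ε′,x)ζ((τ₀+Δ−s)/Δ)ζ₁ζ₂` on a finite grid of `τ₀`
plus Lipschitz dependence of the functional on `τ₀`, and `F_c(ρσ³) = f(ρ)` on the cap event; (H4) exact energy
conservation; (H5) = `InitialLayer`.  The shell's window-averaged `L¹` conclusion at `t_shell := t + Δ′`, `τ₀ := t`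
is `MollifiedCloseTimeAveraged` (`∃η₀ := min(η₁/2, η₀ of the inputs)`).  All tolerances fixed before `r`:
`(ε, Δ) → δ → (ε′, grids, bumps) → (η, δ per input) → r₀ → r → N₀`.  v8: the mass balance (first antecedent) and the
shell's (H1) quantify over `C¹` space–time tests. -/
theorem stub_kineticReduction :
    (∀ (σ : ℝ), 0 < σ → σ < 2⁻¹ → ∀ (N : ℕ)
        (Φ : HardSphereFlow (Torus.geometry (Fin 3)) (hsDiameter σ N) (N + 1)),
        ∀ z ∈ Φ.good, ∀ r : ℝ, 0 < r → r < 2⁻¹ →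
        ∀ φ : ℝ → T3 → ℝ, ContDiff ℝ 1 (Literature.Analysis.FunctionSpaces.Torus.stLift φ) →
        ∀ t : ℝ, 0 ≤ t →
        let bx : T3 → T3 → ℝ := fun y x => 3 / (Real.pi * r ^ 3) * max (1 - Torus.euclidDist y x / r) 0
        let ρm : Config (N + 1) (Fin 3) T3 → T3 → ℝ := fun w x₀ => ∫ q, bx q.1 x₀ ∂(empiricalMeasure w)
        let mm : Config (N + 1) (Fin 3) T3 → T3 → V3 := fun w x₀ => ∫ q, bx q.1 x₀ • q.2 ∂(empiricalMeasure w)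
        (∫ x, φ t x * ρm (Φ.flow t z) x) - ∫ x, φ 0 x * ρm (Φ.flow 0 z) x =
          ∫ s in Set.Icc 0 t, ∫ x, (deriv (fun s' => φ s' x) s * ρm (Φ.flow s z) x
            + ∑ k : Fin 3, mm (Φ.flow s z) x k * Literature.Analysis.FunctionSpaces.Torus.partialDeriv k (φ s) x)) →
    (∀ (σ : ℝ), 0 < σ → σ < 2⁻¹ → ∀ (N : ℕ)
        (Φ : HardSphereFlow (Torus.geometry (Fin 3)) (hsDiameter σ N) (N + 1)),
        ∀ z ∈ Φ.good, ∀ r : ℝ, 0 < r →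
        ∀ φ : ℝ → T3 → ℝ, Literature.Analysis.FunctionSpaces.Torus.IsSmoothSpaceTimeOn Set.univ φ →
        ∀ ψ : V3 → ℝ, ∀ t : ℝ, 0 ≤ t →
        let ε := hsDiameter σ N
        let G : Geometry (Fin 3) T3 := Torus.geometry (Fin 3)
        let γ : ℝ → Config (N + 1) (Fin 3) T3 := fun s => Φ.flow s z
        let pv : ℝ → Fin (N + 1) → Fin (N + 1) → V3 × V3 := fun s i j =>
          reflectVel (G.sepVec (γ s i).1 (γ s j).1) ((γ s i).2, (γ s j).2)
        let bx : T3 → T3 → ℝ := fun y x => 3 / (Real.pi * r ^ 3) * max (1 - Torus.euclidDist y x / r) 0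
        let Mψ : Config (N + 1) (Fin 3) T3 → T3 → ℝ := fun w x₀ => ∫ q, bx q.1 x₀ * ψ q.2 ∂(empiricalMeasure w)
        let Jψ : Config (N + 1) (Fin 3) T3 → T3 → Fin 3 → ℝ := fun w x₀ k =>
          ∫ q, bx q.1 x₀ * (q.2 k * ψ q.2) ∂(empiricalMeasure w)
        (∫ x, φ t x * Mψ (γ t) x) - ∫ x, φ 0 x * Mψ (γ 0) x =
          (∫ s in Set.Icc 0 t, ∫ x, (deriv (fun s' => φ s' x) s * Mψ (γ s) x
            + ∑ k : Fin 3, Jψ (γ s) x k * Literature.Analysis.FunctionSpaces.Torus.partialDeriv k (φ s) x))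
          + (N + 1 : ℝ)⁻¹ * ∑ᶠ (s : ℝ) (_ : s ∈ collisionTimes G ε γ ∩ Set.Ioc 0 t),
              ∑ i : Fin (N + 1), ∑ j : Fin (N + 1),
                (if i ≠ j ∧ ‖G.sepVec (γ s i).1 (γ s j).1‖ = ε then
                  (∫ x, φ s x * bx (γ s i).1 x) * (ψ (γ s i).2 - ψ (pv s i j).1) else 0)) →
    (∀ (a₀ θ₀ : T3 → ℝ) (u₀ : T3 → V3), Continuous a₀ → Continuous θ₀ → Continuous u₀ →
        (∀ x, 0 < a₀ x) → (∀ x, 0 < θ₀ x) → ∃ σ₀ : ℝ, 0 < σ₀ ∧ ∀ σ : ℝ, 0 < σ → σ < σ₀ →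
        ∀ (T : ℝ) (ρ θ : ℝ → T3 → ℝ) (u : ℝ → T3 → V3), IsHardSphereEulerSolution σ T ρ u θ → 0 < T →
        ∀ Φ : (N : ℕ) → HardSphereFlow (Torus.geometry (Fin 3)) (hsDiameter σ N) (N + 1),
        TendstoHydroFieldsAt (fun N => localGibbsLaw σ a₀ u₀ θ₀ N (Φ N)) Φ ρ u θ 0 →
        ∀ η δ : ℝ, 0 < η → 0 < δ → ∃ r₀ : ℝ, 0 < r₀ ∧ ∀ r : ℝ, 0 < r → r < r₀ → ∃ N₀ : ℕ, ∀ N : ℕ, N₀ ≤ N →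
        let bx : T3 → T3 → ℝ := fun y x => 3 / (Real.pi * r ^ 3) * max (1 - Torus.euclidDist y x / r) 0
        localGibbsLaw σ a₀ u₀ θ₀ N (Φ N)
            {z | ∃ x, η < |empiricalDensityField ((Φ N).flow 0 z) (fun y => bx y x) - ρ 0 x|} ≤ ENNReal.ofReal δ ∧
        localGibbsLaw σ a₀ u₀ θ₀ N (Φ N)
            {z | ∃ x, η < ‖empiricalMomentumField ((Φ N).flow 0 z) (fun y => bx y x) - ρ 0 x • u 0 x‖} ≤
              ENNReal.ofReal δ ∧
        localGibbsLaw σ a₀ u₀ θ₀ N (Φ N)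
            {z | ∃ x, η < |empiricalEnergyField ((Φ N).flow 0 z) (fun y => bx y x) -
              totalEnergyDensity (ρ 0 x) (u 0 x) (θ 0 x)|} ≤ ENNReal.ofReal δ) →
    (∃ η₀ : ℝ, 0 < η₀ ∧ ∀ (a₀ θ₀ : T3 → ℝ) (u₀ : T3 → V3), Continuous a₀ → Continuous θ₀ → Continuous u₀ →
        (∀ x, 0 < a₀ x) → (∀ x, 0 < θ₀ x) → ∃ σ₀ : ℝ, 0 < σ₀ ∧ ∀ σ : ℝ, 0 < σ → σ < σ₀ →
        ∀ (T : ℝ) (ρ θ : ℝ → T3 → ℝ) (u : ℝ → T3 → V3), IsHardSphereEulerSolution σ T ρ u θ →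
        ∀ Φ : (N : ℕ) → HardSphereFlow (Torus.geometry (Fin 3)) (hsDiameter σ N) (N + 1),
        TendstoHydroFieldsAt (fun N => localGibbsLaw σ a₀ u₀ θ₀ N (Φ N)) Φ ρ u θ 0 →
        ∀ t ∈ Set.Ico 0 T, ∀ a : Fin 3 → Fin 3 → ℝ × T3 → ℝ, (∀ j k, Continuous (a j k)) →
        (∀ p, ∑ j : Fin 3, a j j p = 0) →
        ∀ g : ℝ → ℝ, Continuous g → (∀ b, η₀ ≤ b → g b = 0) →
        ∀ η δ : ℝ, 0 < η → 0 < δ → ∃ r₀ : ℝ, 0 < r₀ ∧ ∀ r : ℝ, 0 < r → r < r₀ → ∃ N₀ : ℕ, ∀ N : ℕ, N₀ ≤ N →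
        let bx : T3 → T3 → ℝ := fun y x => 3 / (Real.pi * r ^ 3) * max (1 - Torus.euclidDist y x / r) 0
        let ρm : Config (N + 1) (Fin 3) T3 → T3 → ℝ := fun w x₀ => ∫ q, bx q.1 x₀ ∂(empiricalMeasure w)
        let mm : Config (N + 1) (Fin 3) T3 → T3 → V3 := fun w x₀ => ∫ q, bx q.1 x₀ • q.2 ∂(empiricalMeasure w)
        let Pm : Config (N + 1) (Fin 3) T3 → T3 → Fin 3 → Fin 3 → ℝ := fun w x₀ j k =>
          (∫ q, bx q.1 x₀ * (q.2 j * q.2 k) ∂(empiricalMeasure w)) - mm w x₀ j * mm w x₀ k / ρm w x₀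
        localGibbsLaw σ a₀ u₀ θ₀ N (Φ N)
          {z | η < |∫ s in Set.Icc 0 t, ∫ x, g (σ ^ 3 * ρm ((Φ N).flow s z) x) *
            ∑ j : Fin 3, ∑ k : Fin 3, a j k (s, x) * Pm ((Φ N).flow s z) x j k|} ≤ ENNReal.ofReal δ) →
    (∃ η₀ : ℝ, 0 < η₀ ∧ ∀ (a₀ θ₀ : T3 → ℝ) (u₀ : T3 → V3), Continuous a₀ → Continuous θ₀ → Continuous u₀ →
        (∀ x, 0 < a₀ x) → (∀ x, 0 < θ₀ x) → ∃ σ₀ : ℝ, 0 < σ₀ ∧ ∀ σ : ℝ, 0 < σ → σ < σ₀ →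
        ∀ (T : ℝ) (ρ θ : ℝ → T3 → ℝ) (u : ℝ → T3 → V3), IsHardSphereEulerSolution σ T ρ u θ →
        ∀ Φ : (N : ℕ) → HardSphereFlow (Torus.geometry (Fin 3)) (hsDiameter σ N) (N + 1),
        TendstoHydroFieldsAt (fun N => localGibbsLaw σ a₀ u₀ θ₀ N (Φ N)) Φ ρ u θ 0 →
        ∀ t ∈ Set.Ico 0 T, ∀ a : Fin 3 → Fin 3 → ℝ × T3 → ℝ, (∀ j k, Continuous (a j k)) →
        (∀ j k p, a j k p = a k j p) →
        ∀ g : ℝ → ℝ, Continuous g → (∀ b, η₀ ≤ b → g b = 0) →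
        ∀ η δ : ℝ, 0 < η → 0 < δ → ∃ r₀ : ℝ, 0 < r₀ ∧ ∀ r : ℝ, 0 < r → r < r₀ → ∃ N₀ : ℕ, ∀ N : ℕ, N₀ ≤ N →
        let ε := hsDiameter σ N
        let G : Geometry (Fin 3) T3 := Torus.geometry (Fin 3)
        let γ : Config (N + 1) (Fin 3) T3 → ℝ → Config (N + 1) (Fin 3) T3 := fun z s => (Φ N).flow s z
        let bx : T3 → T3 → ℝ := fun y x => 3 / (Real.pi * r ^ 3) * max (1 - Torus.euclidDist y x / r) 0
        let ρm : Config (N + 1) (Fin 3) T3 → T3 → ℝ := fun w x₀ => ∫ q, bx q.1 x₀ ∂(empiricalMeasure w)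
        let mm : Config (N + 1) (Fin 3) T3 → T3 → V3 := fun w x₀ => ∫ q, bx q.1 x₀ • q.2 ∂(empiricalMeasure w)
        let em : Config (N + 1) (Fin 3) T3 → T3 → ℝ := fun w x₀ =>
          ∫ q, bx q.1 x₀ * (‖q.2‖ ^ 2 / 2) ∂(empiricalMeasure w)
        let θm : Config (N + 1) (Fin 3) T3 → T3 → ℝ := fun w x₀ =>
          2 / 3 * (em w x₀ / ρm w x₀ - ‖mm w x₀‖ ^ 2 / (2 * ρm w x₀ ^ 2))
        let pv : Config (N + 1) (Fin 3) T3 → ℝ → Fin (N + 1) → Fin (N + 1) → V3 × V3 := fun z s i j =>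
          reflectVel (G.sepVec (γ z s i).1 (γ z s j).1) ((γ z s i).2, (γ z s j).2)
        let Kc : (Config (N + 1) (Fin 3) T3 → ℝ → Fin (N + 1) → Fin (N + 1) → ℝ) → Config (N + 1) (Fin 3) T3 → ℝ := fun F z =>
          ε / (N + 1 : ℝ) * ∑ᶠ (s : ℝ) (_ : s ∈ collisionTimes G ε (γ z) ∩ Set.Icc 0 t),
            ∑ i : Fin (N + 1), ∑ j : Fin (N + 1),
              (if i ≠ j ∧ ‖G.sepVec (γ z s i).1 (γ z s j).1‖ = ε then F z s i j else 0)
        let D : Config (N + 1) (Fin 3) T3 → ℝ := fun z =>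
          Kc (fun z s i j =>
              g (σ ^ 3 * ρm (γ z s) (γ z s i).1) *
                |⟪(pv z s i j).1 - (pv z s i j).2, ε⁻¹ • G.sepVec (γ z s i).1 (γ z s j).1⟫_ℝ| *
                ∑ k : Fin 3, ∑ l : Fin 3, a k l (s, (γ z s i).1) *
                  ((ε⁻¹ • G.sepVec (γ z s i).1 (γ z s j).1) k * (ε⁻¹ • G.sepVec (γ z s i).1 (γ z s j).1) l)) z
            - 2 * ∫ s in Set.Icc 0 t, ∫ x, g (σ ^ 3 * ρm (γ z s) x) *
                (hsPressure σ (ρm (γ z s) x) (θm (γ z s) x) - ρm (γ z s) x * θm (γ z s) x) *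
                ∑ k : Fin 3, a k k (s, x)
        localGibbsLaw σ a₀ u₀ θ₀ N (Φ N) {z | η < |D z|} ≤ ENNReal.ofReal δ) →
    (∀ (a₀ θ₀ : T3 → ℝ) (u₀ : T3 → V3), Continuous a₀ → Continuous θ₀ → Continuous u₀ →
        (∀ x, 0 < a₀ x) → (∀ x, 0 < θ₀ x) → ∃ σ₀ : ℝ, 0 < σ₀ ∧ ∀ σ : ℝ, 0 < σ → σ < σ₀ →
        ∀ Φ : (N : ℕ) → HardSphereFlow (Torus.geometry (Fin 3)) (hsDiameter σ N) (N + 1),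
        ∀ τ : ℝ, 0 < τ → ∀ η δ : ℝ, 0 < η → 0 < δ → ∃ L : ℝ, ∃ N₀ : ℕ, ∀ N : ℕ, N₀ ≤ N →
        let ε := hsDiameter σ N
        let G : Geometry (Fin 3) T3 := Torus.geometry (Fin 3)
        let γ : Config (N + 1) (Fin 3) T3 → ℝ → Config (N + 1) (Fin 3) T3 := fun z s => (Φ N).flow s z
        let Kc : (Config (N + 1) (Fin 3) T3 → ℝ → Fin (N + 1) → Fin (N + 1) → ℝ) → Config (N + 1) (Fin 3) T3 → ℝ := fun F z =>
          ε / (N + 1 : ℝ) * ∑ᶠ (s : ℝ) (_ : s ∈ collisionTimes G ε (γ z) ∩ Set.Icc 0 τ),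
            ∑ i : Fin (N + 1), ∑ j : Fin (N + 1),
              (if i ≠ j ∧ ‖G.sepVec (γ z s i).1 (γ z s j).1‖ = ε then F z s i j else 0)
        localGibbsLaw σ a₀ u₀ θ₀ N (Φ N)
            {z | η < Kc (fun z s i j => if L < ‖(γ z s i).2‖ ^ 2 + ‖(γ z s j).2‖ ^ 2 then
              1 + ‖(γ z s i).2‖ ^ 2 + ‖(γ z s j).2‖ ^ 2 else 0) z} ≤ ENNReal.ofReal δ) →
    CollisionRate → LimitCollisionMeasure.LocalSecondLaw → DensityCap →
    (∀ (σ : ℝ), 0 < σ → ∀ (η₁ : ℝ), 0 < η₁ → ∀ (χe f : ℝ → ℝ),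
        ContDiffOn ℝ 2 χe (Set.Ioi 0) → ContDiffOn ℝ 2 f (Set.Ioi 0) →
        (∀ a, 0 < a → χe a = 1 + a * deriv f a) → (∀ a, 0 < a → 0 < χe a + a * deriv χe a) →
        (∃ B : ℝ, ∀ a, 0 < a → |χe a| ≤ B) →
        (∀ a, 0 < a → a * σ ^ 3 ≤ η₁ → f a = hsExcessFreeEnergy (a * σ ^ 3) ∧ χe a = hsCompressibility (a * σ ^ 3)) →
        ∀ (T : ℝ) (ρ θ : ℝ → T3 → ℝ) (u : ℝ → T3 → V3), IsHardSphereEulerSolution σ T ρ u θ →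
        (∀ s ∈ Set.Ico 0 T, ∀ x, ρ s x * σ ^ 3 ≤ η₁ / 2) →
        ∀ t ∈ Set.Ioo 0 T, ∃ a b : ℝ, a < b ∧ ∀ ε : ℝ, 0 < ε → ∃ Δ₀ : ℝ, 0 < Δ₀ ∧ ∀ Δ : ℝ, 0 < Δ → Δ ≤ Δ₀ → Δ < t →
        ∃ δ : ℝ, 0 < δ ∧ ∀ V : ℝ → T3 → ℝ × V3 × ℝ, Measurable (Function.uncurry V) →
        (∃ C : ℝ, ∀ s x, |(V s x).1| ≤ C ∧ ‖(V s x).2.1‖ ≤ C ∧ |(V s x).2.2| ≤ C) →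
        (∀ s x, 0 ≤ (V s x).1) → (∀ s x, 0 ≤ (V s x).2.2) →
        (∀ s x, ‖(V s x).2.1‖ ^ 2 ≤ 2 * (V s x).1 * (V s x).2.2) →
        let θo : ℝ × V3 × ℝ → ℝ := fun U => 2 / 3 * (U.2.2 / U.1 - ‖U.2.1‖ ^ 2 / (2 * U.1 ^ 2))
        let pV : ℝ × V3 × ℝ → ℝ := fun U => U.1 * θo U * χe U.1
        let Zs : ℝ × V3 × ℝ → ℝ := fun U => if 0 < θo U then max a (min (3 / 2 * Real.log (θo U) - Real.log U.1 - f U.1) b) else a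
        let Etot : ℝ → T3 → ℝ := fun s x => totalEnergyDensity (ρ s x) (u s x) (θ s x)
        let cut : ℝ → ℝ → ℝ := fun τ₀ s => Real.smoothTransition ((τ₀ + Δ - s) / Δ)
        (∀ φ : ℝ → T3 → ℝ, ContDiff ℝ 1 (Literature.Analysis.FunctionSpaces.Torus.stLift φ) → ∀ τ ∈ Set.Icc 0 t, (∫ x, φ τ x * (V τ x).1) - ∫ x, φ 0 x * (V 0 x).1 = ∫ s in Set.Icc 0 τ, ∫ x, (deriv (fun s' => φ s' x) s * (V s x).1 + ∑ k : Fin 3, (V s x).2.1 k * Literature.Analysis.FunctionSpaces.Torus.partialDeriv k (φ s) x)) →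
        (∀ τ ∈ Set.Icc 0 t, |(∫ x, ⟪u τ x, (V τ x).2.1⟫_ℝ) - (∫ x, ⟪u 0 x, (V 0 x).2.1⟫_ℝ) - ∫ s in Set.Icc 0 τ, ∫ x, (⟪Literature.Analysis.FunctionSpaces.Torus.timeDerivWithin (Set.Ico 0 T) u s x, (V s x).2.1⟫_ℝ + ∑ i : Fin 3, ∑ j : Fin 3, Literature.Analysis.FunctionSpaces.Torus.partialDeriv j (fun y => u s y i) x * ((V s x).2.1 i * (V s x).2.1 j / (V s x).1 + if i = j then pV (V s x) else 0))| ≤ δ) →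
        (∀ τ₀ ∈ Set.Icc 0 (t - Δ), (∫ s in Set.Icc 0 t, ∫ x, ((V s x).1 * Zs (V s x) * Literature.Analysis.FunctionSpaces.Torus.timeDerivWithin (Set.Ico 0 T) (fun s' y => θ s' y * cut τ₀ s') s x + Zs (V s x) * ⟪(V s x).2.1, Literature.Analysis.FunctionSpaces.Torus.gradient (fun y => θ s y * cut τ₀ s) x⟫_ℝ)) + ∫ x, (V 0 x).1 * Zs (V 0 x) * (θ 0 x * cut τ₀ 0) ≤ δ) →
        (∀ τ ∈ Set.Icc 0 t, ∫ x, (V τ x).2.2 ≤ (∫ x, (V 0 x).2.2) + δ) →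
        (∀ x, |(V 0 x).1 - ρ 0 x| ≤ δ ∧ ‖(V 0 x).2.1 - ρ 0 x • u 0 x‖ ≤ δ ∧ |(V 0 x).2.2 - Etot 0 x| ≤ δ) →
        ∀ τ₀ ∈ Set.Icc 0 (t - Δ), ∫ s in Set.Icc τ₀ (τ₀ + Δ), ∫ x, (|(V s x).1 - ρ s x| + ‖(V s x).2.1 - ρ s x • u s x‖ + |(V s x).2.2 - Etot s x|) ≤ ε * Δ) →
    ∃ η₀ : ℝ, 0 < η₀ ∧ ∀ (a₀ θ₀ : T3 → ℝ) (u₀ : T3 → V3), Continuous a₀ → Continuous θ₀ → Continuous u₀ →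
      (∀ x, 0 < a₀ x) → (∀ x, 0 < θ₀ x) → ∃ σ₀ : ℝ, 0 < σ₀ ∧ ∀ σ : ℝ, 0 < σ → σ < σ₀ →
      ∀ (T : ℝ) (ρ θ : ℝ → T3 → ℝ) (u : ℝ → T3 → V3), IsHardSphereEulerSolution σ T ρ u θ →
      (∀ t ∈ Set.Ico 0 T, ∀ x, ρ t x * σ ^ 3 < η₀) →
      ∀ Φ : (N : ℕ) → HardSphereFlow (Torus.geometry (Fin 3)) (hsDiameter σ N) (N + 1),
      TendstoHydroFieldsAt (fun N => localGibbsLaw σ a₀ u₀ θ₀ N (Φ N)) Φ ρ u θ 0 →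
      ∀ t ∈ Set.Ico 0 T, ∀ Δ : ℝ, 0 < Δ → t + Δ < T → ∀ η δ : ℝ, 0 < η → 0 < δ →
      ∃ r₀ : ℝ, 0 < r₀ ∧ ∀ r : ℝ, 0 < r → r < r₀ → ∃ N₀ : ℕ, ∀ N : ℕ, N₀ ≤ N →
      let bx : T3 → T3 → ℝ := fun y x => 3 / (Real.pi * r ^ 3) * max (1 - Torus.euclidDist y x / r) 0
      localGibbsLaw σ a₀ u₀ θ₀ N (Φ N)
          {z | η * Δ < ∫ s in Set.Icc t (t + Δ),
            ((∫ x, |empiricalDensityField ((Φ N).flow s z) (fun y => bx y x) - ρ s x|)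
            + (∫ x, ‖empiricalMomentumField ((Φ N).flow s z) (fun y => bx y x) - ρ s x • u s x‖)
            + ∫ x, |empiricalEnergyField ((Φ N).flow s z) (fun y => bx y x) -
                totalEnergyDensity (ρ s x) (u s x) (θ s x)|)} ≤ ENNReal.ofReal δ :=
  Summit.AtomisticToContinuum.HydrodynamicLimit.Theorems.ChaosClosesEulerKineticReduction.stub_kineticReduction

/-- v4's Grönwall stub, now DERIVED (v6): the kinetic reduction fed with the deterministic shell.  (The cubic tail
`TwoClocks.EnergyCurrentTails` is no longer an antecedent of the Grönwall — the momentum residual's time-modulus needs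
only energy bounds; the tail is consumed by the readout alone.) -/
theorem stub_relativeEnergyGronwall :
    MassBalanceC1 → EmpiricalWeakEquation → InitialLayer → WeakStressIsotropyInBand →
    CollisionalPressureValueInBand → TwoClocks.EnergyCurrentTails → CollisionMomentUI → CollisionRate →
    LimitCollisionMeasure.LocalSecondLaw → DensityCap → MollifiedCloseTimeAveraged :=
  fun hM hW hI hS hP _hT hU hR hL hD => stub_kineticReduction hM hW hI hS hP hU hR hL hD stub_bf18Shell

/-- CLOSED (landed p119530, wave 4, `Theorems.ChaosClosesEulerReadout.stub_readout`, with helpers p112694 p112852 p112959 p115623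
p116062 p118478): THE WEAK READOUT AT THE INSTANT `t`.  Time-averaged `L¹` closeness of the
cone-mollified fields over `[t, t+Δ]` (any fixed `Δ`) ⇒ the `χ`-tested convergence AT `t` (the crux's conclusion
by name): for continuous `χ` and a smooth uniform approximant `χ′`, (i) `|∫χ′dμ_N(t) − ∫χ′dμ_N(s)|` for
`s ∈ [t, t+Δ]` is, by the exact identity `LimitCollisionMeasure.EmpiricalEnskogIdentity` (landed p107599; tests
`a ≡ 1`, `b = χ′`, `c = 1, vₖ, ‖v‖²/2` act on the PARTICLES, no cone), a transport integral (`≤ ‖∇χ′‖·Δ·energy`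
for mass and momentum — `stub_meanDisplacement` —, `≤ ‖∇χ′‖·(M²√(2Ē)Δ + M⁻¹·cubic tail at the single time t)` for
the energy via `TwoClocks.EnergyCurrentTails`) plus a collision term `≤ 2‖∇χ′‖·K^{(t,t+Δ]}[|v|² + |v_*|²]`, and the
windowed functional is `≤ (1+L)·K[bump_Δ·g(σ³ρ_r)] + tail` (`CollisionMomentUI`; on the `DensityCap` event at
`t + Δ < T` with the GUARD `ρσ³ < η₀/2` every collision is in band, `g ≡ 1`; `CollisionRate` with the FIXED test
`bump_Δ` gives `K[bump_Δ g] ≤ C·Δ + η`, `C` r-independent since `∫ₓ B¹_r ≤ C(ρ_max)(½ + Ē)` under the cap) — all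
tolerances `r`-INDEPENDENT, `Δ = Δ(κ, χ′)` fixed before `r`; (ii) `|∫χ′dμ_N(s) − ∫χ′ V_r(s)| ≤ ω_{χ′}(r)·(mass,
½+Ē, Ē)` (`KineticClosureBridge.abs_sub_integral_mul_cone_le` & co.); (iii) the time average of `|∫χ′(V_r(s) −
U(s))|` is `≤ ‖χ′‖∞·η` by the hypothesis; (iv) `U` is uniformly continuous on `[t, t+Δ]`.  Energy tightness:
`KineticClosureBridge.exists_energy_tail_le`.  Output: `HydroLimitInBandConclusion` with `η₀ := min(η₀ᴳ, η₀ᶜᴿ/2)`. -/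
theorem stub_readout :
    (∃ η₀ : ℝ, 0 < η₀ ∧ ∀ (a₀ θ₀ : T3 → ℝ) (u₀ : T3 → V3), Continuous a₀ → Continuous θ₀ → Continuous u₀ →
      (∀ x, 0 < a₀ x) → (∀ x, 0 < θ₀ x) → ∃ σ₀ : ℝ, 0 < σ₀ ∧ ∀ σ : ℝ, 0 < σ → σ < σ₀ →
      ∀ (T : ℝ) (ρ θ : ℝ → T3 → ℝ) (u : ℝ → T3 → V3), IsHardSphereEulerSolution σ T ρ u θ →
      (∀ t ∈ Set.Ico 0 T, ∀ x, ρ t x * σ ^ 3 < η₀) →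
      ∀ Φ : (N : ℕ) → HardSphereFlow (Torus.geometry (Fin 3)) (hsDiameter σ N) (N + 1),
      TendstoHydroFieldsAt (fun N => localGibbsLaw σ a₀ u₀ θ₀ N (Φ N)) Φ ρ u θ 0 →
      ∀ t ∈ Set.Ico 0 T, ∀ Δ : ℝ, 0 < Δ → t + Δ < T → ∀ η δ : ℝ, 0 < η → 0 < δ →
      ∃ r₀ : ℝ, 0 < r₀ ∧ ∀ r : ℝ, 0 < r → r < r₀ → ∃ N₀ : ℕ, ∀ N : ℕ, N₀ ≤ N →
      let bx : T3 → T3 → ℝ := fun y x => 3 / (Real.pi * r ^ 3) * max (1 - Torus.euclidDist y x / r) 0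
      localGibbsLaw σ a₀ u₀ θ₀ N (Φ N)
          {z | η * Δ < ∫ s in Set.Icc t (t + Δ),
            ((∫ x, |empiricalDensityField ((Φ N).flow s z) (fun y => bx y x) - ρ s x|)
            + (∫ x, ‖empiricalMomentumField ((Φ N).flow s z) (fun y => bx y x) - ρ s x • u s x‖)
            + ∫ x, |empiricalEnergyField ((Φ N).flow s z) (fun y => bx y x) -
                totalEnergyDensity (ρ s x) (u s x) (θ s x)|)} ≤ ENNReal.ofReal δ) →
    LimitCollisionMeasure.EmpiricalEnskogIdentity → TwoClocks.EnergyCurrentTails →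
    (∀ (a₀ θ₀ : T3 → ℝ) (u₀ : T3 → V3), Continuous a₀ → Continuous θ₀ → Continuous u₀ →
      (∀ x, 0 < a₀ x) → (∀ x, 0 < θ₀ x) → ∃ σ₀ : ℝ, 0 < σ₀ ∧ ∀ σ : ℝ, 0 < σ → σ < σ₀ →
      ∀ Φ : (N : ℕ) → HardSphereFlow (Torus.geometry (Fin 3)) (hsDiameter σ N) (N + 1),
      ∀ τ : ℝ, 0 < τ → ∀ η δ : ℝ, 0 < η → 0 < δ → ∃ L : ℝ, ∃ N₀ : ℕ, ∀ N : ℕ, N₀ ≤ N →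
      let ε := hsDiameter σ N
      let G : Geometry (Fin 3) T3 := Torus.geometry (Fin 3)
      let γ : Config (N + 1) (Fin 3) T3 → ℝ → Config (N + 1) (Fin 3) T3 := fun z s => (Φ N).flow s z
      let Kc : (Config (N + 1) (Fin 3) T3 → ℝ → Fin (N + 1) → Fin (N + 1) → ℝ) → Config (N + 1) (Fin 3) T3 → ℝ := fun F z =>
        ε / (N + 1 : ℝ) * ∑ᶠ (s : ℝ) (_ : s ∈ collisionTimes G ε (γ z) ∩ Set.Icc 0 τ),
          ∑ i : Fin (N + 1), ∑ j : Fin (N + 1),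
            (if i ≠ j ∧ ‖G.sepVec (γ z s i).1 (γ z s j).1‖ = ε then F z s i j else 0)
      localGibbsLaw σ a₀ u₀ θ₀ N (Φ N)
          {z | η < Kc (fun z s i j => if L < ‖(γ z s i).2‖ ^ 2 + ‖(γ z s j).2‖ ^ 2 then
            1 + ‖(γ z s i).2‖ ^ 2 + ‖(γ z s j).2‖ ^ 2 else 0) z} ≤ ENNReal.ofReal δ) →
    CollisionRate → DensityCap →
    ∃ η₀ : ℝ, 0 < η₀ ∧ ∀ (a₀ θ₀ : T3 → ℝ) (u₀ : T3 → V3), Continuous a₀ → Continuous θ₀ → Continuous u₀ →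
      (∀ x, 0 < a₀ x) → (∀ x, 0 < θ₀ x) → ∃ σ₀ : ℝ, 0 < σ₀ ∧ ∀ σ : ℝ, 0 < σ → σ < σ₀ →
      ∀ (T : ℝ) (ρ θ : ℝ → T3 → ℝ) (u : ℝ → T3 → V3), IsHardSphereEulerSolution σ T ρ u θ →
      (∀ t ∈ Set.Ico 0 T, ∀ x, ρ t x * σ ^ 3 < η₀) →
      ∀ Φ : (N : ℕ) → HardSphereFlow (Torus.geometry (Fin 3)) (hsDiameter σ N) (N + 1),
      TendstoHydroFieldsAt (fun N => localGibbsLaw σ a₀ u₀ θ₀ N (Φ N)) Φ ρ u θ 0 →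
      ∀ t ∈ Set.Ico 0 T, TendstoHydroFieldsAt (fun N => localGibbsLaw σ a₀ u₀ θ₀ N (Φ N)) Φ ρ u θ t :=
  Summit.AtomisticToContinuum.HydrodynamicLimit.Theorems.ChaosClosesEulerReadout.stub_readout

/-- CLOSED (landed p98117, `Theorems.ChaosClosesEulerBridge.stub_bridge`; no longer used by the v4 composition, which
reads out in the weak topology): mollified `L¹` closeness in the band ⇒ the crux's conclusion. Body:
`MollifiedCloseInBand → HydroLimitInBandConclusion`, both VERBATIM. -/
theorem stub_bridge :
    (∃ η₀ : ℝ, 0 < η₀ ∧ ∀ (a₀ θ₀ : T3 → ℝ) (u₀ : T3 → V3), Continuous a₀ → Continuous θ₀ → Continuous u₀ →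
    (∀ x, 0 < a₀ x) → (∀ x, 0 < θ₀ x) → ∃ σ₀ : ℝ, 0 < σ₀ ∧ ∀ σ : ℝ, 0 < σ → σ < σ₀ →
    ∀ (T : ℝ) (ρ θ : ℝ → T3 → ℝ) (u : ℝ → T3 → V3), IsHardSphereEulerSolution σ T ρ u θ →
    (∀ t ∈ Set.Ico 0 T, ∀ x, ρ t x * σ ^ 3 < η₀) →
    ∀ Φ : (N : ℕ) → HardSphereFlow (Torus.geometry (Fin 3)) (hsDiameter σ N) (N + 1),
    TendstoHydroFieldsAt (fun N => localGibbsLaw σ a₀ u₀ θ₀ N (Φ N)) Φ ρ u θ 0 →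
    ∀ t ∈ Set.Ico 0 T, ∀ η δ : ℝ, 0 < η → 0 < δ →
    ∃ r₀ : ℝ, 0 < r₀ ∧ ∀ r : ℝ, 0 < r → r < r₀ → ∃ N₀ : ℕ, ∀ N : ℕ, N₀ ≤ N →
    let bx : T3 → T3 → ℝ := fun y x => 3 / (Real.pi * r ^ 3) * max (1 - Torus.euclidDist y x / r) 0
    localGibbsLaw σ a₀ u₀ θ₀ N (Φ N)
        {z | η < ∫ x, |empiricalDensityField ((Φ N).flow t z) (fun y => bx y x) - ρ t x|} ≤ ENNReal.ofReal δ ∧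
    localGibbsLaw σ a₀ u₀ θ₀ N (Φ N)
        {z | η < ∫ x, ‖empiricalMomentumField ((Φ N).flow t z) (fun y => bx y x) - ρ t x • u t x‖} ≤
          ENNReal.ofReal δ ∧
    localGibbsLaw σ a₀ u₀ θ₀ N (Φ N)
        {z | η < ∫ x, |empiricalEnergyField ((Φ N).flow t z) (fun y => bx y x) -
          totalEnergyDensity (ρ t x) (u t x) (θ t x)|} ≤ ENNReal.ofReal δ) →
    ∃ η₀ : ℝ, 0 < η₀ ∧ ∀ (a₀ θ₀ : T3 → ℝ) (u₀ : T3 → V3), Continuous a₀ → Continuous θ₀ → Continuous u₀ →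
    (∀ x, 0 < a₀ x) → (∀ x, 0 < θ₀ x) → ∃ σ₀ : ℝ, 0 < σ₀ ∧ ∀ σ : ℝ, 0 < σ → σ < σ₀ →
    ∀ (T : ℝ) (ρ θ : ℝ → T3 → ℝ) (u : ℝ → T3 → V3), IsHardSphereEulerSolution σ T ρ u θ →
    (∀ t ∈ Set.Ico 0 T, ∀ x, ρ t x * σ ^ 3 < η₀) →
    ∀ Φ : (N : ℕ) → HardSphereFlow (Torus.geometry (Fin 3)) (hsDiameter σ N) (N + 1),
    TendstoHydroFieldsAt (fun N => localGibbsLaw σ a₀ u₀ θ₀ N (Φ N)) Φ ρ u θ 0 →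
    ∀ t ∈ Set.Ico 0 T, TendstoHydroFieldsAt (fun N => localGibbsLaw σ a₀ u₀ θ₀ N (Φ N)) Φ ρ u θ t :=
  Summit.AtomisticToContinuum.HydrodynamicLimit.Theorems.ChaosClosesEulerBridge.stub_bridge

/-! ## §3 The composition (pure logic, no `sorry`) -/

/-- **The kinetic half at the LOCAL-EQUILIBRIUM docking level (v11).**  `WeakStressIsotropyInBand ∧
CollisionalPressureValueInBand` from `MaxwellianMoments` (provable), the two NEW pointwise inputs PLE / PEC, the
cubic tail 9235 and the quartic collision tightness 13354 (⇒ `CollisionMomentUI`, landed p110597).  Replaces v10's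
`stub_fluxClosure` (whose antecedents — windowed invariance + 13356 + 13350 + 13355 + 13481 + tails — cannot
supply it, `NOTES.md` §F). -/
theorem fluxClosure_of_localEquilibriumLevel (hMM : MaxwellianMoments) (hPLE : PointwiseLocalEquilibrium)
    (hPEC : PointwiseEnskogCollisions) (hT : TwoClocks.EnergyCurrentTails)
    (hCT : LimitCollisionMeasure.CollisionTightness) :
    WeakStressIsotropyInBand ∧ CollisionalPressureValueInBand :=
  ⟨stub_stressIsotropyOfLocalEquilibrium hMM hPLE hT,
    stub_pressureValueOfEnskog hMM hPLE hPEC hT hCT (stub_collisionMomentUI hCT)⟩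

/-- **Docking level recommended to the PLANNER (v11; `NOTES.md` §D/§F):** the crux follows from pointwise local
equilibrium + pointwise Enskog collision statistics + the clamped second law (13352) + quartic collision tightness
(13354) + cubic tails (9235) + the fine-scale cap (13082), through the LANDED deterministic BF18 core, kinetic
reduction and weak readout — modulo only the provable wave-9 stubs `stub_maxwellianMoments`,
`stub_stressIsotropyOfLocalEquilibrium`, `stub_pressureValueOfEnskog`.  Of the crux's own antecedents `hCR`
(13481) is consumed (by the reduction and the readout); `hCC` (13477) and `hLSL` (13081) are not. -/
theorem chaosClosesEuler_of_localEquilibriumLevel (hPLE : PointwiseLocalEquilibrium)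
    (hPEC : PointwiseEnskogCollisions) (hLSLc : LimitCollisionMeasure.LocalSecondLaw)
    (hCT : LimitCollisionMeasure.CollisionTightness) (hT : TwoClocks.EnergyCurrentTails) (hDC : DensityCap) :
    ChaosClosesEuler := fun _hCC hCR _hLSL =>
  -- `_hCC : ContactChaos` (13477, same-time, fixed `χ`) and `_hLSL : LocalSecondLaw` (13081, unclamped) are NOT
  -- consumed (wrong formats, NOTES §B2/§B3/§F); `hCR : CollisionRate` (13481) is, by the reduction and the readout.
  have hUI := stub_collisionMomentUI hCT
  have hF := fluxClosure_of_localEquilibriumLevel stub_maxwellianMoments hPLE hPEC hT hCT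
  stub_readout (stub_relativeEnergyGronwall stub_massBalanceC1 stub_weakEquation stub_initialLayer hF.1 hF.2
    hT hUI hCR hLSLc hDC) stub_empiricalEnskogIdentity hT hUI hCR hDC

/-- **The line closes the crux modulo its stubs (v15).**  The inputs stub supplies the four board items and the new
pointwise Enskog collision statistics; `stub_localEquilibrium` is pointwise local equilibrium itself (primitive, to be
promoted); the rest is the LANDED dock `chaosClosesEuler_of_localEquilibriumLevel`
(= `Theorems.ChaosClosesEulerDock.stub_dock`, p157936). -/
theorem ChaosClosesEuler_of : ChaosClosesEuler := fun hCC hCR hLSL =>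
  have ⟨hT, hCT, hLSLc, hDC, hPEC⟩ := stub_inputs
  chaosClosesEuler_of_localEquilibriumLevel stub_localEquilibrium hPEC hLSLc hCT hT hDC hCC hCR hLSL
end Summit.AtomisticToContinuum.HydrodynamicLimit.Cruxes.ChaosClosesEuler.Sketch

end
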